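import Summits.NavierStokesRegularity.NavierStokesRegularity.Theses.AdaptedFrequency
import Literature.Analysis.FluidPDE.AdaptedBackwardKernel
import Literature.Analysis.FluidPDE.WholeSpaceIBP

/-!
# Disproof of `AdaptedFrequencyConverges` (stmt-NavierStokesRegularity-10493) — findings

Standing adversary file of the crux disprover (`cdisprove`), cycles 1–2 (2026-08-16).  Everything
below is kernel-checked (no `sorry`); prose lives in docstrings.

## 0. Elaboration / junk read-back (probe rc 0)

The crux quantifies `∀ ν T > 0, ∀ (u,p)` classical NS on `Ico 0 T` (unforced), Leray–Hopf on
`[0,T)`, rapidly decaying datum, `IsTypeIBlowup u T` (a SUP-NORM bound `‖u t x‖ ≤ C/√(T−t)`,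
eventually as `t ↑ T`), `∀ x₀ t₀ G`, backward singularity at `(T,x₀)` (`eLpNorm ⊤ = ⊤` on every
backward cylinder `Ioo (T−r²) T × ball x₀ r`), the five adapted-kernel clauses, two-sided
Gaussian comparability, and concludes `∃ Λ₀, Λ → Λ₀` as `t ↑ T` for
`Λ t = (T−t) · deriv H t / H t`, `H t = ∫ ‖curl (u t)‖² G t`.
Junk: `deriv` (0 off differentiability) and `/ H t` (0 at `H t = 0`) only make the conclusion
EASIER; `∫ G = 1` forces integrability; no junk in the hypotheses is exploitable.  The hypotheses
contain a genuine finite-energy Type-I blow-up from rapidly decaying data with a singular point,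
so an UNCONDITIONAL `¬ AdaptedFrequencyConverges` is exactly as hard as `¬ Clay (A)` (a Type-I
blow-up with non-convergent adapted frequency, e.g. a λ-DSS blow-up, Bradshaw–Tsai OP 5.1):
this is WHY THE CRUX RESISTS a cheap kill.

## 1. Load-bearing analysis: the far-field hypotheses carry the whole weight

`AdaptedFrequencyConvergesWithoutDecay` := the crux with the three FAR-FIELD hypotheses removed
(Leray–Hopf = finite energy, `HasRapidSpatialDecay (u 0)`, and the sup-norm in `IsTypeIBlowup`,
the latter WEAKENED to the parabolic-local Type-I bound
`‖x − x₀‖² ≤ T − t → ‖u t x‖ ≤ C/√(T−t)`), everything else kept verbatim: exact unforced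
classical NS, backward singularity at `(T,x₀)`, all five kernel clauses, comparability.
**It is FALSE** (`adaptedFrequencyConverges_false_without_decay`), by an EXACT solution:

* the linear flow `u(t,x) = d(t) D₀x + ½ω(t) e₀×x`, `D₀ = diag(1,−½,−½)`,
  `ω(t) = exp(−sin log(1−t))`, `d = ω′/ω = cos log(1−t) / (1−t)` — an exact classical solution of
  unforced NS on `[0,1) × ℝ³` for EVERY `ν` (`isClassicalNSSolutionOn_vel`; vorticity `ω(t)e₀`
  obeys the stretching law `ω′ = dω`, pressure quadratic), smooth, divergence free, Type-I in every
  parabolic cylinder at `(1,0)` (`local_typeI_vel`: `|∇u| ≲ (1−t)⁻¹`), backward-singular at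
  `(1,0)` (`singular_vel`), but of infinite energy (linear growth);
* its EXACT adapted kernel: the anisotropic Gaussian `G(t) = N(0, diag(α,β,β))`,
  `α = 2ν ω² ∫ₜ¹ ω⁻²`, `β = 2ν ω⁻¹ ∫ₜ¹ ω` (`adjoint_eq_G`: `∂ₜG + u·∇G + νΔG = 0`; unit mass
  `integral_G`; concentration `tendsto_integral_mul_G`; two-sided comparability `G_comparable`
  with `c₂ = 4νe⁻⁴`, `C₂ = 4νe⁴`; `C^∞`);
* adapted enstrophy `H = ω(t)²` exactly, adapted frequency `Λ(t) = 2 cos log(1−t)`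
  (`frequency_eq`), which has NO limit as `t ↑ 1` (`not_tendsto_frequency`: `Λ = 2` along
  `1 − e^{−2πn}`, `Λ = −2` along `1 − e^{−2πn−π}`).

CONSEQUENCES FOR PROVERS.  (i) The card's mechanism as literally described (kernel calculus
`H′ = 2∫(ω·Sω − ν|∇ω|²)G`, symmetric stretching, Agmon–Nirenberg quasi-convexity with a defect from
"relative transport" and "unsteadiness of the rescaled strain") CANNOT close the crux: here
the transport of `ω` vanishes identically (`∇ω = 0`), stretching is symmetric, `u = BS(ω)`-type
kinematics is irrelevant (the flow IS Navier–Stokes), and the strain-unsteadiness defect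
`∂ₛ(τ d) = −sin log(1−t)` is bounded, NON-INTEGRABLE in `s = −log(1−t)`, and realised.  Kill
criterion (d) of the route ("a LINEAR counterexample certifies that #2 must use u = BS(ω)") is
hereby UPGRADED: u = BS(ω) / exact NS is NOT enough either; any proof must use a far-field input —
finite energy, spatial decay, or the sup over ALL `x` in the Type-I bound — in a way that fails for
linear flows.  (ii) In `L²(G dx)` the witness is indistinguishable from a Type-I blow-up
(`∫|u|²G ∼ ν/(1−t)`), so no purely `G`-weighted inequality can work.  (iii) Clause (5)
(concentration) is REDUNDANT given comparability + unit mass + positivity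
(`tendsto_integral_mul_of_le_heatKernel`) — information for `AdaptedKernelExists` too.

## 2. What exactly the witness violates (the minimal far-field input a proof can lean on)

The witness has BOUNDED vorticity (`‖ω(t)‖ = ω(t) ∈ [e⁻¹, e]`) while `∇u ∼ (1−t)⁻¹` blows up through
the strain, and its LOCAL energy near the singular point is unbounded:
`∫_{B₁(0)} |u(t)|² ∼ d(t)² ∼ (1−t)⁻²` along `cos log(1−t) ≠ 0`.  In the Leray–Hopf class
`sup_t ∫_{B₁(x₀)} |u(t)|² ≤ 2E₀ < ∞`, and then bounded vorticity on a backward cylinder forces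
boundedness of `u` there (local Biot–Savart + the harmonic remainder is controlled by local energy),
i.e. at a backward-singular point of a Leray–Hopf solution the VORTICITY must blow up and the
adapted enstrophy must grow (`H(t) → ∞`, Type I: `H ≲ C²(T−t)⁻²`, so `Λ` hovers about `2`, not
about `0` as here).  So the cheapest far-field hypothesis separating the witness from the crux is a
UNIFORM LOCAL ENERGY BOUND near `x₀` (not finite total energy, not decay as such); a proof of the
crux may and must use it — e.g. through enstrophy concentration `H(t) ≳ c (T−t)^{-2+o(1)}`.
The witness is Majda–Bertozzi's classical linear-flow family (Vorticity and Incompressible Flow,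
CUP 2002, Prop. 1.5: `v = ½ω(t)×x + 𝒟(t)x`, `ω′ = 𝒟ω`, quadratic pressure) with the particular
clock `ω(t) = exp(−sin log(1−t))`.

## 3. What is NOT refuted, and the live conditional threat

With locally bounded energy the strain at the singular point cannot be driven "from infinity"; the
honest remaining threat is a finite-energy Type-I λ-DSS blow-up (log-periodic, generically
non-constant `Λ`), excluded only for λ near 1 (Chae–Wolf 2017 Thm 1.3) — conditional, not
constructible here (Bradshaw–Tsai OP 5.1).  TIGHTNESS (ε-family, Part F when checked / file
`Negative/SmallOscillation`): with the clock `ω^ε`, `Λ = 2ε cos log(1−t)`: arbitrarily small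
oscillation budget, local Type-I constant `O(ε)` and comparability constants within `e^{±4ε}` of the
heat kernel's, still no limit — no smallness threshold can be bootstrapped without a far-field input.

## 4. TEST BENCH for ideators / triagers / provers (closed forms of the witness; `σ := −log(1−t)`)

`ω(t,x) = e^{−ε sin σ} e₀` (spatially constant; `∇ω = 0`, `Δω = 0`); strain `S = d·diag(1,−½,−½)`,
`d = ε cos σ /(1−t)`, rescaled strain `(1−t)S = ε cos σ · D₀` (unsteady, `∂_σ` of it `= −ε sin σ · D₀`);
stretching `ω·Sω = d|ω|²`; `H = e^{−2ε sin σ}` (bounded above and below!), `h := (1−t)²H → 0`,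
`Λ = 2ε cos σ`, `dΛ/dσ = −2ε sin σ`, Cesàro mean of `Λ` is `0` (not `2`); kernel `N(0, diag(α,β,β))`,
`α, β ≍ 2ν(1−t)` within `e^{±4ε}`, `e^{±2ε}`; local Type-I constant `≍ ε`; `(1,0)` backward-singular;
`∫_{B₁}|u|² ≍ d² ∼ (1−t)^{-2}` (unbounded local energy), vorticity bounded.  ANY proposed inequality among
`G`-LOCAL quantities (`H, H′, H″, Λ, dΛ/ds, ∫ω·Sω G, ∫|∇ω|²G, ∂ₛS̃, …`) claimed to force convergence of
`Λ` must FAIL on this bench (ε = 1 in Parts A–E, general ε in Part F); hence its derivation must import a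
far-field / pinching input (`h ≥ c > 0` from Type-I mild bounds + persistence of singularities, local
energy, decay).  E.g. a Riccati–Tauber bound `dΛ/ds ≥ −c(Λ−Λ̄)²` about the Cesàro mean fails here at
`σ ≡ π/2 (mod 2π)` (`Λ = Λ̄ = 0`, `dΛ/ds = −2ε`); "Λ increases outside a breathing band" fails for every
band not containing `[−2ε, 2ε]`.

## 5. CYCLE 2 (2026-08-16): the picked line `tauberian-omega-limit` — its OPEN stubs are far-field statements (Part G)

The lead's skeleton (sha 1b56b576…) splits the crux into `stub_kernelCalculus` (differentiability of
`H`), `stub_pinchingUpper` [LANDED p78510] / `stub_pinchingLower` [LANDED p82804 by the lead, via the Type-I Morrey bound +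
Barker–Prange `L³` concentration — a far-field input, as Part G predicts] (`c₀ ≤ (T−t)² H ≤ C₁` near `T`),
`stub_slowDecrease` [hardest] (`Λ t ≤ Λ t' + ε` on late dyadic windows `T − t ≤ 2(T − t')`) and the
real-analysis step `stub_landau` [LANDED p78071].  On the linear witness (all crux hypotheses but the
three far-field ones), in the line's own vocabulary (`adaptedEnstrophy_vel`, `adaptedFrequency_vel`:
`H = ω(t)²`, `Λ = 2cos log(1−t)`; `isAdaptedBackwardKernel_G`, `isGaussianComparable_G`):
* `stub_pinchingUpper_witness` — the witness SATISFIES the landed upper pinching (`C₁ = e²`): the upper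
  pinching is far-field blind (consistent with its landed proof via the Type-I derivative bound);
* `stub_pinchingLower_false_without_decay` — `(1−t)² H → 0` (`tendsto_sq_mul_adaptedEnstrophy_vel`):
  the LOWER pinching is false without the far-field hypotheses — it is the far-field step;
* `stub_slowDecrease_false_without_decay` — `2cos log(1−t)` DROPS by `4 sin(1/3) > 1` across the dyadic
  window `[1 − e^{−(π/2−1/3+2πn)}, 1 − e^{−(π/2+1/3+2πn)}]` (log-length `2/3 ≤ log 2`) for every `n`
  (`two_cos_log_window`, `not_slowlyDecreasing_two_cos_log`): the hardest stub is ALSO false without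
  the far-field hypotheses.  With the ε-family (Part F) the drop is `4ε sin(1/3) > ε`: no smallness of the
  local Type-I constant / near-Gaussianity of the kernel / oscillation budget `|Λ| ≤ δ` rescues slow decrease
  either (`stub_slowDecrease_false_without_decay_small`, Part G2).
So BOTH open NS stubs must import a far-field input (bounded local energy near `x₀` ⇒ vorticity must
blow up at a singular point ⇒ `H → ∞`; the KNSS bounded-ancient tangent-flow class), and
(for the record, the far-field input the lower pinching needs is in print: the pointwise rate `‖u(t)‖∞ ≤ C/√(T−t)`
bounds the critical Morrey quantity `M^{s,l}`, `l < 2`, hence ALL scaled energies `A, C, D, E` near `(T,x₀)` —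
Albritton–Barker arXiv:1811.00502 Lemma 2.6 (p. 6, citing Seregin–Šverák's handbook and Seregin–Zajaczkowski 2006) —
so Type-I zooms at `x₀` converge to mild bounded ancient solutions, singular at the origin by persistence, and an
irrotational slice of such a tangent flow is impossible; this is exactly what the linear witness lacks), and
`stub_slowDecrease` is, modulo the two pinchings and Landau, EQUIVALENT to the crux (crux ⇒ slow
decrease trivially; line: slow decrease ⇒ crux) — the line isolates but does not shrink the NS content.

## 6. CYCLE 2: tightness of the Landau step — the lower pinching cannot be traded for `∃ Λ₀` (Part H)

`landau_false_without_lower_pinching` / `stub_landau_false_without_lower_pinching` (pure real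
analysis): `H(t) = exp(2s + f(s))`, `s = −log(1−t)`, `f = −s + (1+s)(sin log(1+s) − cos log(1+s))/4`
is positive, differentiable, UPPER-pinched (`(1−t)²H = e^{f} ≤ e^{1/2}`), and its frequency
`Λ = 2 + f′(s) = 1 + ½ sin log(1 − log(1−t))` is bounded and SLOWLY OSCILLATING (`|Λ t − Λ t'| ≤ ε` on
late dyadic windows — both signs, so slowly decreasing in the line's sense), yet has NO limit at `1⁻`
(`3/2` along `1 − e·exp(−e^{π/2+2πn})`, `1/2` along `1 − e·exp(−e^{−π/2+2πn})`).  Hence `stub_landau`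
with its conjunct `c₀ ≤ (T−t)² H` deleted is false EVEN with the conclusion weakened from `Λ → 2` to the
crux's `∃ Λ₀, Λ → Λ₀`: a prover cannot bypass the far-field stub `stub_pinchingLower` by settling for an
arbitrary limit; two-sided pinching (⇔ `log((T−t)²H)` bounded) is exactly what turns slow decrease into
convergence.  (Symmetrically `f′ = +1 + ½ sin log(1+s)` kills the version without the UPPER pinching,
which however is landed.)  Structural fact (triage F1; formalised in Part I for the Gaussian class: `no_positive_transverse_variance`, `transverse_variance_eq`, `no_pinched_gaussian_kernel`): a LOWER-pinched linear
exact-NS flow (`(1−t)·ω(t) ≥ c > 0`) admits NO adapted Gaussian kernel of the Part-C form — the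
transverse variance `β = 2ν ω⁻¹ ∫ₜ¹ ω = +∞` — and by the second-moment ODE no comparable adapted kernel
at all; so the §4 test bench cannot be upgraded to a pinched one inside the linear class: pinching and
kernel comparability pull against each other through the strain, and a pinched bench must be a
genuinely nonlinear (bounded-velocity) flow.

## 7. CYCLE 2: the decomposition is tight — `stub_slowDecrease` ⇔ crux (Part J)

`stub_slowDecrease_of_adaptedFrequencyConverges`: the crux implies the lead's active `stub_slowDecrease` verbatim (a convergent `Λ`
is slowly decreasing).  With the pinchings and Landau landed, the remaining NS stub is EQUIVALENT to the crux: the line has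
isolated the NS content (slow decrease of `Λ` over dyadic log-time windows at a Type-I singular point), not reduced it; a kill
of the stub is a kill of the crux and needs the same finite-energy Type-I blow-up (§0, §3).

## Index
Part A clocks/variances · Part B linear flow = exact NS (Majda–Bertozzi 2002 Prop. 1.5) · Part C
anisotropic kernel (spatial calculus, mass, bounds, general concentration lemma, adjoint PDE,
regularity, comparability) · Part D enstrophy/frequency, non-convergence, local Type-I, singular
point · Part E the statement `AdaptedFrequencyConvergesWithoutDecay`, its relation to the crux, and
its refutation · Part F tightness (ε-family).  LANDED in the tree (sorry-free, same content as
here, the two `Without…` statements written INLINE in the theorem types):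
`Theorems/AdaptedFrequencyConverges/Negative/LinearFlow.lean` (p73360), `…/KernelVariances.lean`
(p74220), `…/AdaptedKernel.lean` (p74765), `…/FalseWithoutDecay.lean` (p75939, headline
`adaptedFrequencyConverges_false_without_decay`), `…/EpsFlow.lean` (p77001) and
`…/SmallOscillation.lean` (p78142, `adaptedFrequencyConverges_false_without_decay_small`) —
all six ACCEPTED (2026-08-16).  CYCLE 2: Part G the picked line's stubs on the witness · Part H Landau tightness · Part I pinched clock ⟹ no Gaussian kernel; LANDED `…/Negative/LandauTightness.lean` (p83632), `…/Negative/PinchedClock.lean` (p83655), drefute's `…/Negative/TauberianStubsWithoutDecay.lean` (p81430); addendum `…/Negative/LineStubsActive.lean` (p84889), `…/Negative/SlowDecreaseOfCrux.lean` (p84273, Part J), `…/Negative/SlowDecreaseSmall.lean` (p84983, Part G2, pending farm olean of SmallOscillation at submit time).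
-/

noncomputable section

namespace Summit.NavierStokesRegularity.NavierStokesRegularity.Cruxes.AdaptedFrequencyConverges.Disproof

open scoped Matrix InnerProductSpace RealInnerProductSpace Laplacian Topology
open Literature.Analysis.FluidPDE Set Filter MeasureTheory Real intervalIntegral

/-- physical space [folklore] -/
abbrev E3 := EuclideanSpace ℝ (Fin 3)


/-! ## Part A: clocks and variances -/

/-- The vorticity amplitude clock `ω(t) = exp(−sin log(1−t))`: bounded between `e⁻¹` and `e`, smooth on `t < 1`, oscillating infinitely often as `t ↑ 1`. [folklore] -/
def amp (t : ℝ) : ℝ := Real.exp (-Real.sin (Real.log (1 - t)))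
/-- The strain rate `d(t) = cos log(1−t) / (1−t) = ω′/ω`: critical (`∼ (1−t)⁻¹`) and sign-changing. [folklore] -/
def str (t : ℝ) : ℝ := Real.cos (Real.log (1 - t)) / (1 - t)

/-- `ω(t) > 0`. [folklore] -/
theorem amp_pos (t : ℝ) : 0 < amp t := Real.exp_pos _
/-- `ω(t) ≤ e`. [folklore] -/
theorem amp_le (t : ℝ) : amp t ≤ Real.exp 1 := by
  unfold amp; gcongr; linarith [Real.neg_one_le_sin (Real.log (1 - t)), Real.sin_le_one (Real.log (1 - t))]
/-- `e⁻¹ ≤ ω(t)`. [folklore] -/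
theorem le_amp (t : ℝ) : Real.exp (-1) ≤ amp t := by
  unfold amp; gcongr; linarith [Real.sin_le_one (Real.log (1 - t))]

/-- Derivative of `s ↦ 1 − s`. [folklore] -/
theorem hasDerivAt_one_sub (t : ℝ) : HasDerivAt (fun s : ℝ => 1 - s) (-1) t :=
  (hasDerivAt_id t).const_sub 1

/-- Derivative of `s ↦ log(1 − s)` below `1`. [folklore] -/
theorem hasDerivAt_log_one_sub {t : ℝ} (ht : t < 1) :
    HasDerivAt (fun s => Real.log (1 - s)) (-(1 - t)⁻¹) t := by
  have h2 := (Real.hasDerivAt_log (sub_pos.2 ht).ne').comp t (hasDerivAt_one_sub t)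
  exact h2.congr_deriv (by ring)

/-- **The stretching law** `ω′ = d ω` (by design of the clocks). [folklore] -/
theorem hasDerivAt_amp {t : ℝ} (ht : t < 1) : HasDerivAt amp (amp t * str t) t := by
  have h := ((hasDerivAt_log_one_sub ht).sin.neg).exp
  refine h.congr_deriv ?_
  simp only [Pi.neg_apply, amp, str, div_eq_mul_inv]
  ring

/-- `ω` is smooth below `t = 1`. [folklore] -/
theorem contDiffAt_amp {t : ℝ} (ht : t < 1) {n : WithTop ℕ∞} : ContDiffAt ℝ n amp t := by
  have h1 : ContDiffAt ℝ n (fun s : ℝ => 1 - s) t := contDiffAt_const.sub contDiffAt_id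
  exact ((h1.log (sub_pos.2 ht).ne').sin.neg).exp

/-- `ω` is continuous below `t = 1`. [folklore] -/
theorem continuousAt_amp {t : ℝ} (ht : t < 1) : ContinuousAt amp t :=
  (contDiffAt_amp ht (n := 0)).continuousAt

/-- `ω` is continuous on `(−∞, 1)`. [folklore] -/
theorem continuousOn_amp : ContinuousOn amp (Iio 1) := fun _ ht =>
  (continuousAt_amp ht).continuousWithinAt

/-- `ω` is measurable. [folklore] -/
theorem measurable_amp : Measurable amp := by
  unfold amp; fun_prop

/-! ### the two primitives -/

/-- `I₁(t) = ∫_t^1 ω(s)⁻² ds` [folklore] -/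
def I1 (t : ℝ) : ℝ := ∫ s in t..1, (amp s ^ 2)⁻¹
/-- `I₂(t) = ∫_t^1 ω(s) ds` [folklore] -/
def I2 (t : ℝ) : ℝ := ∫ s in t..1, amp s

/-- `ω⁻² ≤ e²`. [folklore] -/
theorem amp_sq_inv_le (t : ℝ) : (amp t ^ 2)⁻¹ ≤ Real.exp 2 := by
  have h := le_amp t
  have h0 : 0 < Real.exp (-1) := Real.exp_pos _
  calc (amp t ^ 2)⁻¹ ≤ (Real.exp (-1) ^ 2)⁻¹ :=
        inv_anti₀ (pow_pos h0 2) (pow_le_pow_left₀ h0.le h 2)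
    _ = Real.exp 2 := by rw [← Real.exp_nat_mul, ← Real.exp_neg]; norm_num

/-- `e⁻² ≤ ω⁻²`. [folklore] -/
theorem le_amp_sq_inv (t : ℝ) : Real.exp (-2) ≤ (amp t ^ 2)⁻¹ := by
  have h := amp_le t
  calc Real.exp (-2) = (Real.exp 1 ^ 2)⁻¹ := by rw [← Real.exp_nat_mul, ← Real.exp_neg]; norm_num
    _ ≤ (amp t ^ 2)⁻¹ :=
        inv_anti₀ (pow_pos (amp_pos t) 2) (pow_le_pow_left₀ (amp_pos t).le h 2)

/-- `ω⁻²` is measurable. [folklore] -/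
theorem measurable_amp_sq_inv : Measurable (fun s => (amp s ^ 2)⁻¹) :=
  (measurable_amp.pow_const 2).inv

/-- `ω` is interval integrable (bounded and measurable). [folklore] -/
theorem intervalIntegrable_amp (a b : ℝ) : IntervalIntegrable amp volume a b := by
  refine (intervalIntegrable_const (c := Real.exp 1)).mono_fun' measurable_amp.aestronglyMeasurable ?_
  exact Eventually.of_forall fun s => by
    show ‖amp s‖ ≤ Real.exp 1
    rw [Real.norm_of_nonneg (amp_pos s).le]; exact amp_le s

/-- `ω⁻²` is interval integrable (bounded and measurable). [folklore] -/
theorem intervalIntegrable_amp_sq_inv (a b : ℝ) :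
    IntervalIntegrable (fun s => (amp s ^ 2)⁻¹) volume a b := by
  refine (intervalIntegrable_const (c := Real.exp 2)).mono_fun'
    measurable_amp_sq_inv.aestronglyMeasurable ?_
  exact Eventually.of_forall fun s => by
    show ‖(amp s ^ 2)⁻¹‖ ≤ Real.exp 2
    rw [Real.norm_of_nonneg (inv_nonneg.2 (sq_nonneg _))]; exact amp_sq_inv_le s

/-- `I₂′ = −ω` below `1` (FTC at the lower limit). [folklore] -/
theorem hasDerivAt_I2 {t : ℝ} (ht : t < 1) : HasDerivAt I2 (-amp t) t := by
  unfold I2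
  exact integral_hasDerivAt_left (intervalIntegrable_amp t 1)
    (continuousOn_amp.stronglyMeasurableAtFilter isOpen_Iio t ht) (continuousAt_amp ht)

/-- `I₁′ = −ω⁻²` below `1` (FTC at the lower limit). [folklore] -/
theorem hasDerivAt_I1 {t : ℝ} (ht : t < 1) : HasDerivAt I1 (-(amp t ^ 2)⁻¹) t := by
  unfold I1
  have hc : ContinuousOn (fun s => (amp s ^ 2)⁻¹) (Iio 1) := fun s hs =>
    (((continuousAt_amp hs).pow 2).inv₀ (pow_pos (amp_pos s) 2).ne').continuousWithinAt
  exact integral_hasDerivAt_left (intervalIntegrable_amp_sq_inv t 1)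
    (hc.stronglyMeasurableAtFilter isOpen_Iio t ht)
    (((continuousAt_amp ht).pow 2).inv₀ (pow_pos (amp_pos t) 2).ne')

/-- two-sided bounds [folklore] -/
theorem I2_bounds {t : ℝ} (ht : t ≤ 1) :
    Real.exp (-1) * (1 - t) ≤ I2 t ∧ I2 t ≤ Real.exp 1 * (1 - t) := by
  constructor
  · have := intervalIntegral.integral_mono_on ht (intervalIntegrable_const (c := Real.exp (-1)))
      (intervalIntegrable_amp t 1) (fun s _ => le_amp s)
    simpa [I2, mul_comm] using this
  · have := intervalIntegral.integral_mono_on ht (intervalIntegrable_amp t 1)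
      (intervalIntegrable_const (c := Real.exp 1)) (fun s _ => amp_le s)
    simpa [I2, mul_comm] using this

/-- `e⁻²(1−t) ≤ I₁(t) ≤ e²(1−t)` for `t ≤ 1`. [folklore] -/
theorem I1_bounds {t : ℝ} (ht : t ≤ 1) :
    Real.exp (-2) * (1 - t) ≤ I1 t ∧ I1 t ≤ Real.exp 2 * (1 - t) := by
  constructor
  · have := intervalIntegral.integral_mono_on ht (intervalIntegrable_const (c := Real.exp (-2)))
      (intervalIntegrable_amp_sq_inv t 1) (fun s _ => le_amp_sq_inv s)
    simpa [I1, mul_comm] using this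
  · have := intervalIntegral.integral_mono_on ht (intervalIntegrable_amp_sq_inv t 1)
      (intervalIntegrable_const (c := Real.exp 2)) (fun s _ => amp_sq_inv_le s)
    simpa [I1, mul_comm] using this

/-- `I₁ > 0` below `1`. [folklore] -/
theorem I1_pos {t : ℝ} (ht : t < 1) : 0 < I1 t :=
  lt_of_lt_of_le (mul_pos (Real.exp_pos _) (sub_pos.2 ht)) (I1_bounds ht.le).1
/-- `I₂ > 0` below `1`. [folklore] -/
theorem I2_pos {t : ℝ} (ht : t < 1) : 0 < I2 t :=
  lt_of_lt_of_le (mul_pos (Real.exp_pos _) (sub_pos.2 ht)) (I2_bounds ht.le).1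

/-- smoothness of the primitives on `(-∞, 1)` [folklore] -/
theorem contDiffOn_I2 : ContDiffOn ℝ (⊤ : ℕ∞) I2 (Iio 1) := by
  refine (contDiffOn_infty_iff_deriv_of_isOpen isOpen_Iio).2 ⟨?_, ?_⟩
  · exact fun t ht => (hasDerivAt_I2 ht).differentiableAt.differentiableWithinAt
  · have : ContDiffOn ℝ (⊤ : ℕ∞) (fun t => -amp t) (Iio 1) := fun t ht =>
      (contDiffAt_amp ht).neg.contDiffWithinAt
    exact this.congr fun t ht => (hasDerivAt_I2 ht).deriv

/-- `I₁` is smooth on `(−∞, 1)` (its derivative is). [folklore] -/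
theorem contDiffOn_I1 : ContDiffOn ℝ (⊤ : ℕ∞) I1 (Iio 1) := by
  refine (contDiffOn_infty_iff_deriv_of_isOpen isOpen_Iio).2 ⟨?_, ?_⟩
  · exact fun t ht => (hasDerivAt_I1 ht).differentiableAt.differentiableWithinAt
  · have : ContDiffOn ℝ (⊤ : ℕ∞) (fun t => -(amp t ^ 2)⁻¹) (Iio 1) := fun t ht =>
      (((contDiffAt_amp ht).pow 2).inv (pow_pos (amp_pos t) 2).ne').neg.contDiffWithinAt
    exact this.congr fun t ht => (hasDerivAt_I1 ht).deriv

/-! ### the variances -/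

/-- The axial variance `α(t) = 2ν ω(t)² ∫ₜ¹ ω⁻²` of the adapted kernel (solves `α′ = 2dα − 2ν`, `α(1⁻) = 0`). [folklore] -/
def varA (ν t : ℝ) : ℝ := 2 * ν * amp t ^ 2 * I1 t
/-- The transverse variance `β(t) = 2ν ω(t)⁻¹ ∫ₜ¹ ω` of the adapted kernel (solves `β′ = −dβ − 2ν`, `β(1⁻) = 0`). [folklore] -/
def varB (ν t : ℝ) : ℝ := 2 * ν * (amp t)⁻¹ * I2 t

/-- **Variance ODE** `α′ = 2dα − 2ν`. [folklore] -/
theorem hasDerivAt_varA (ν : ℝ) {t : ℝ} (ht : t < 1) :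
    HasDerivAt (varA ν) (2 * str t * varA ν t - 2 * ν) t := by
  have h := (((hasDerivAt_amp ht).pow 2).const_mul (2 * ν)).mul (hasDerivAt_I1 ht)
  refine h.congr_deriv ?_
  have ha : amp t ≠ 0 := (amp_pos t).ne'
  simp only [varA, Pi.pow_apply]
  field_simp
  ring

/-- **Variance ODE** `β′ = −dβ − 2ν`. [folklore] -/
theorem hasDerivAt_varB (ν : ℝ) {t : ℝ} (ht : t < 1) :
    HasDerivAt (varB ν) (-(str t) * varB ν t - 2 * ν) t := by
  have ha : amp t ≠ 0 := (amp_pos t).ne'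
  have h := (((hasDerivAt_amp ht).inv ha).const_mul (2 * ν)).mul (hasDerivAt_I2 ht)
  refine h.congr_deriv ?_
  simp only [varB, Pi.inv_apply]
  field_simp
  ring

/-- `2νe⁻⁴(1−t) ≤ α(t) ≤ 2νe⁴(1−t)`: the axial variance is comparable to `1 − t`. [folklore] -/
theorem varA_bounds {ν : ℝ} (hν : 0 ≤ ν) {t : ℝ} (ht : t ≤ 1) :
    2 * ν * Real.exp (-4) * (1 - t) ≤ varA ν t ∧ varA ν t ≤ 2 * ν * Real.exp 4 * (1 - t) := by
  obtain ⟨h1, h2⟩ := I1_bounds ht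
  have ha1 := amp_le t
  have ha2 := le_amp t
  have ha0 : 0 ≤ amp t := (amp_pos t).le
  have hI : 0 ≤ I1 t := h1.trans' (mul_nonneg (Real.exp_pos _).le (sub_nonneg.2 ht))
  have he : 0 ≤ Real.exp (-1) := (Real.exp_pos _).le
  have e1 : Real.exp (-4) = Real.exp (-1) ^ 2 * Real.exp (-2) := by
    rw [← Real.exp_nat_mul, ← Real.exp_add]; norm_num
  have e2 : Real.exp 4 = Real.exp 1 ^ 2 * Real.exp 2 := by
    rw [← Real.exp_nat_mul, ← Real.exp_add]; norm_num
  constructor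
  · rw [e1, varA]
    calc 2 * ν * (Real.exp (-1) ^ 2 * Real.exp (-2)) * (1 - t)
        = 2 * ν * Real.exp (-1) ^ 2 * (Real.exp (-2) * (1 - t)) := by ring
      _ ≤ 2 * ν * amp t ^ 2 * I1 t := by gcongr
  · rw [e2, varA]
    calc 2 * ν * amp t ^ 2 * I1 t ≤ 2 * ν * Real.exp 1 ^ 2 * (Real.exp 2 * (1 - t)) := by gcongr
      _ = 2 * ν * (Real.exp 1 ^ 2 * Real.exp 2) * (1 - t) := by ring

/-- `2νe⁻²(1−t) ≤ β(t) ≤ 2νe²(1−t)`: the transverse variance is comparable to `1 − t`. [folklore] -/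
theorem varB_bounds {ν : ℝ} (hν : 0 ≤ ν) {t : ℝ} (ht : t ≤ 1) :
    2 * ν * Real.exp (-2) * (1 - t) ≤ varB ν t ∧ varB ν t ≤ 2 * ν * Real.exp 2 * (1 - t) := by
  obtain ⟨h1, h2⟩ := I2_bounds ht
  have ha1 : (amp t)⁻¹ ≤ Real.exp 1 := by
    calc (amp t)⁻¹ ≤ (Real.exp (-1))⁻¹ := inv_anti₀ (Real.exp_pos _) (le_amp t)
      _ = Real.exp 1 := by rw [← Real.exp_neg]; norm_num
  have ha2 : Real.exp (-1) ≤ (amp t)⁻¹ := by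
    calc Real.exp (-1) = (Real.exp 1)⁻¹ := by rw [← Real.exp_neg]
      _ ≤ (amp t)⁻¹ := inv_anti₀ (amp_pos t) (amp_le t)
  have ha0 : 0 ≤ (amp t)⁻¹ := inv_nonneg.2 (amp_pos t).le
  have hI : 0 ≤ I2 t := h1.trans' (mul_nonneg (Real.exp_pos _).le (sub_nonneg.2 ht))
  have he : 0 ≤ Real.exp (-1) := (Real.exp_pos _).le
  have e1 : Real.exp (-2) = Real.exp (-1) * Real.exp (-1) := by
    rw [← Real.exp_add]; norm_num
  have e2 : Real.exp 2 = Real.exp 1 * Real.exp 1 := by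
    rw [← Real.exp_add]; norm_num
  constructor
  · rw [e1, varB]
    calc 2 * ν * (Real.exp (-1) * Real.exp (-1)) * (1 - t)
        = 2 * ν * Real.exp (-1) * (Real.exp (-1) * (1 - t)) := by ring
      _ ≤ 2 * ν * (amp t)⁻¹ * I2 t := by gcongr
  · rw [e2, varB]
    calc 2 * ν * (amp t)⁻¹ * I2 t ≤ 2 * ν * Real.exp 1 * (Real.exp 1 * (1 - t)) := by gcongr
      _ = 2 * ν * (Real.exp 1 * Real.exp 1) * (1 - t) := by ring

/-- `α > 0` below `1`. [folklore] -/
theorem varA_pos {ν : ℝ} (hν : 0 < ν) {t : ℝ} (ht : t < 1) : 0 < varA ν t :=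
  lt_of_lt_of_le (by have := Real.exp_pos (-4); have := sub_pos.2 ht; positivity)
    (varA_bounds hν.le ht.le).1

/-- `β > 0` below `1`. [folklore] -/
theorem varB_pos {ν : ℝ} (hν : 0 < ν) {t : ℝ} (ht : t < 1) : 0 < varB ν t :=
  lt_of_lt_of_le (by have := Real.exp_pos (-2); have := sub_pos.2 ht; positivity)
    (varB_bounds hν.le ht.le).1

/-- `α` is smooth on `(−∞, 1)`. [folklore] -/
theorem contDiffOn_varA (ν : ℝ) : ContDiffOn ℝ (⊤ : ℕ∞) (varA ν) (Iio 1) := by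
  have h1 : ContDiffOn ℝ (⊤ : ℕ∞) (fun t => 2 * ν * amp t ^ 2) (Iio 1) := fun t ht =>
    (contDiffAt_const.mul ((contDiffAt_amp ht).pow 2)).contDiffWithinAt
  exact h1.mul contDiffOn_I1

/-- `β` is smooth on `(−∞, 1)`. [folklore] -/
theorem contDiffOn_varB (ν : ℝ) : ContDiffOn ℝ (⊤ : ℕ∞) (varB ν) (Iio 1) := by
  have h1 : ContDiffOn ℝ (⊤ : ℕ∞) (fun t => 2 * ν * (amp t)⁻¹) (Iio 1) := fun t ht =>
    (contDiffAt_const.mul ((contDiffAt_amp ht).inv (amp_pos t).ne')).contDiffWithinAt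
  exact h1.mul contDiffOn_I2


/-! ## Part B: the linear flow -/

/-- `d′(t)` [folklore] -/
def strDeriv (t : ℝ) : ℝ :=
  (Real.sin (Real.log (1 - t)) + Real.cos (Real.log (1 - t))) / (1 - t) ^ 2

/-- `d′ = strDeriv`. [folklore] -/
theorem hasDerivAt_str {t : ℝ} (ht : t < 1) : HasDerivAt str (strDeriv t) t := by
  have h := ((hasDerivAt_log_one_sub ht).cos).div (hasDerivAt_one_sub t) (sub_pos.2 ht).ne'
  have h1t : (1 - t) ≠ 0 := (sub_pos.2 ht).ne'
  refine h.congr_deriv ?_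
  simp only [strDeriv]
  field_simp
  ring

/-- `d` is smooth below `1`. [folklore] -/
theorem contDiffAt_str {t : ℝ} (ht : t < 1) {n : WithTop ℕ∞} : ContDiffAt ℝ n str t := by
  have h1 : ContDiffAt ℝ n (fun s : ℝ => 1 - s) t := contDiffAt_const.sub contDiffAt_id
  exact ((h1.log (sub_pos.2 ht).ne').cos).div h1 (sub_pos.2 ht).ne'

/-- `d′` is smooth below `1`. [folklore] -/
theorem contDiffAt_strDeriv {t : ℝ} (ht : t < 1) {n : WithTop ℕ∞} : ContDiffAt ℝ n strDeriv t := by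
  have h1 : ContDiffAt ℝ n (fun s : ℝ => 1 - s) t := contDiffAt_const.sub contDiffAt_id
  have hl := h1.log (sub_pos.2 ht).ne'
  exact (hl.sin.add hl.cos).div (h1.pow 2) (pow_ne_zero 2 (sub_pos.2 ht).ne')

/-! ### linear algebra -/

/-- The traceless axisymmetric strain matrix `diag(1, −½, −½)`. [folklore] -/
def D0M : Matrix (Fin 3) (Fin 3) ℝ := !![1, 0, 0; 0, -1/2, 0; 0, 0, -1/2]
/-- The rotation generator about `e₀`: `J x = e₀ × x = (0, −x₂, x₁)`. [folklore] -/
def JM : Matrix (Fin 3) (Fin 3) ℝ := !![0, 0, 0; 0, 0, -1; 0, 1, 0]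

/-- `D₀` as a continuous linear map of `ℝ³`. [folklore] -/
def D0 : E3 →L[ℝ] E3 := Matrix.toEuclideanCLM (𝕜 := ℝ) D0M
/-- `J` as a continuous linear map of `ℝ³`. [folklore] -/
def J : E3 →L[ℝ] E3 := Matrix.toEuclideanCLM (𝕜 := ℝ) JM

/-- `(D₀x)₀ = x₀`. [folklore] -/
@[simp] theorem D0_apply0 (x : E3) : (D0 x) 0 = x 0 := by
  simp [D0, D0M, Matrix.mulVec, dotProduct, Fin.sum_univ_three]
/-- `(D₀x)₁ = −x₁/2`. [folklore] -/
@[simp] theorem D0_apply1 (x : E3) : (D0 x) 1 = -(x 1) / 2 := by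
  simp [D0, D0M, Matrix.mulVec, dotProduct, Fin.sum_univ_three]; ring
/-- `(D₀x)₂ = −x₂/2`. [folklore] -/
@[simp] theorem D0_apply2 (x : E3) : (D0 x) 2 = -(x 2) / 2 := by
  simp [D0, D0M, Matrix.mulVec, dotProduct, Fin.sum_univ_three]; ring
/-- `(Jx)₀ = 0`. [folklore] -/
@[simp] theorem J_apply0 (x : E3) : (J x) 0 = 0 := by
  simp [J, JM, Matrix.mulVec, dotProduct, Fin.sum_univ_three]
/-- `(Jx)₁ = −x₂`. [folklore] -/
@[simp] theorem J_apply1 (x : E3) : (J x) 1 = -(x 2) := by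
  simp [J, JM, Matrix.mulVec, dotProduct, Fin.sum_univ_three]
/-- `(Jx)₂ = x₁`. [folklore] -/
@[simp] theorem J_apply2 (x : E3) : (J x) 2 = x 1 := by
  simp [J, JM, Matrix.mulVec, dotProduct, Fin.sum_univ_three]

/-- the linear velocity field with strain rate `a` and rotation rate `b/2`. [folklore] -/
def linVel (a b : ℝ) (x : E3) : E3 := a • D0 x + (b / 2) • J x

/-- The linear field is the continuous linear map `a D₀ + (b/2) J`. [folklore] -/
theorem linVel_eq (a b : ℝ) : linVel a b = ⇑(a • D0 + (b / 2) • J) := by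
  funext x; simp [linVel]

/-- Its Fréchet derivative is itself. [folklore] -/
theorem hasFDerivAt_linVel (a b : ℝ) (x : E3) :
    HasFDerivAt (linVel a b) (a • D0 + (b / 2) • J) x := by
  rw [linVel_eq]; exact (a • D0 + (b / 2) • J).hasFDerivAt

/-- `D(linVel a b) = a D₀ + (b/2) J`. [folklore] -/
theorem fderiv_linVel (a b : ℝ) (x : E3) : fderiv ℝ (linVel a b) x = a • D0 + (b / 2) • J :=
  (hasFDerivAt_linVel a b x).fderiv

/-- The linear field is smooth. [folklore] -/
theorem contDiff_linVel (a b : ℝ) {n : WithTop ℕ∞} : ContDiff ℝ n (linVel a b) := by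
  rw [linVel_eq]; exact (a • D0 + (b / 2) • J).contDiff

/-- Coordinate `0` of the linear field. [folklore] -/
@[simp] theorem linVel_apply0 (a b : ℝ) (x : E3) : (linVel a b x) 0 = a * x 0 := by
  simp [linVel]
/-- Coordinate `1` of the linear field. [folklore] -/
@[simp] theorem linVel_apply1 (a b : ℝ) (x : E3) :
    (linVel a b x) 1 = -(a / 2) * x 1 - (b / 2) * x 2 := by
  simp [linVel]; ring
/-- Coordinate `2` of the linear field. [folklore] -/
@[simp] theorem linVel_apply2 (a b : ℝ) (x : E3) :
    (linVel a b x) 2 = -(a / 2) * x 2 + (b / 2) * x 1 := by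
  simp [linVel]; ring

/-- **The vorticity of the linear field is spatially constant**: `curl (a D₀x + (b/2) e₀×x) = b e₀`. [folklore] -/
theorem curl_linVel (a b : ℝ) (x : E3) : curl (linVel a b) x = EuclideanSpace.single 0 b := by
  simp only [curl, fderiv_linVel]
  ext i
  fin_cases i <;> simp

/-- `‖curl‖² = b²`. [folklore] -/
theorem norm_curl_linVel_sq (a b : ℝ) (x : E3) : ‖curl (linVel a b) x‖ ^ 2 = b ^ 2 := by
  rw [curl_linVel, EuclideanSpace.norm_eq, Real.sq_sqrt (by positivity)]
  simp

/-- The linear field is divergence free (`tr D₀ = tr J = 0`). [folklore] -/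
theorem divergence_linVel (a b : ℝ) (x : E3) : VectorCalculus.divergence (linVel a b) x = 0 := by
  rw [divergence_eq_sum_inner_fderiv (EuclideanSpace.basisFun (Fin 3) ℝ), fderiv_linVel]
  simp [Fin.sum_univ_three, EuclideanSpace.inner_single_left]
  ring

/-- The (vector) Laplacian of a linear field vanishes. [folklore] -/
theorem laplacian_linVel (a b : ℝ) (x : E3) : (Δ (linVel a b)) x = 0 := by
  rw [laplacian_eq_sum_fderiv_fderiv (EuclideanSpace.basisFun (Fin 3) ℝ) (contDiff_linVel a b)]
  simp [fderiv_linVel]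

/-- `(u·∇)u = (a D₀ + (b/2) J) u` for the linear field. [folklore] -/
theorem convect_linVel (a b : ℝ) (x : E3) :
    convect (linVel a b) (linVel a b) x = (a • D0 + (b / 2) • J) (linVel a b x) := by
  rw [convect_apply, fderiv_linVel]

/-! ### the exact solution -/

/-- **The witness velocity** `u(t, x) = d(t) D₀x + ½ω(t) e₀×x` (exact linear Navier–Stokes flow, any viscosity). [folklore] -/
def vel (t : ℝ) (x : E3) : E3 := linVel (str t) (amp t) x

/-- Axial pressure coefficient `P₁ = d′ + d²`. [folklore] -/
def P1 (t : ℝ) : ℝ := strDeriv t + str t ^ 2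
/-- Transverse pressure coefficient `P₂ = −d′/2 + d²/4 − ω²/4`. [folklore] -/
def P2 (t : ℝ) : ℝ := -(strDeriv t) / 2 + (str t) ^ 2 / 4 - (amp t) ^ 2 / 4

/-- **The witness pressure** `p(t, x) = −½(P₁ x₀² + P₂ (x₁² + x₂²))`. [folklore] -/
def pres (t : ℝ) (x : E3) : ℝ := -(1/2) * (P1 t * (x 0) ^ 2 + P2 t * ((x 1) ^ 2 + (x 2) ^ 2))

/-- gradient vector of the pressure [folklore] -/
def presGrad (t : ℝ) (x : E3) : E3 := !₂[-(P1 t * x 0), -(P2 t * x 1), -(P2 t * x 2)]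

/-- coordinate functionals [folklore] -/
def crd (i : Fin 3) : E3 →L[ℝ] ℝ := PiLp.proj 2 (fun _ : Fin 3 => ℝ) i

/-- `crd i x = xᵢ`. [folklore] -/
@[simp] theorem crd_apply (i : Fin 3) (x : E3) : crd i x = x i := rfl

/-- The pressure gradient is `−(P₁x₀, P₂x₁, P₂x₂)`. [folklore] -/
theorem hasGradientAt_pres (t : ℝ) (x : E3) : HasGradientAt (pres t) (presGrad t x) x := by
  rw [hasGradientAt_iff_hasFDerivAt]
  have h0 := ((crd 0).hasFDerivAt (x := x)).pow 2
  have h1 := ((crd 1).hasFDerivAt (x := x)).pow 2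
  have h2 := ((crd 2).hasFDerivAt (x := x)).pow 2
  have h := ((h0.const_mul (P1 t)).add ((h1.add h2).const_mul (P2 t))).const_mul (-(1/2) : ℝ)
  have h' : HasFDerivAt (pres t) _ x :=
    h.congr_of_eventuallyEq (Eventually.of_forall fun y => by simp [pres])
  refine h'.congr_fderiv ?_
  ext v
  simp [presGrad, PiLp.inner_apply, Fin.sum_univ_three]
  ring

/-- `∇p = presGrad`. [folklore] -/
theorem gradient_pres (t : ℝ) (x : E3) : gradient (pres t) x = presGrad t x :=
  (hasGradientAt_pres t x).gradient

/-- Time derivative of the velocity at fixed `x` (uses the stretching law `ω′ = dω`). [folklore] -/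
theorem hasDerivAt_vel {t : ℝ} (ht : t < 1) (x : E3) :
    HasDerivAt (fun s => vel s x) (strDeriv t • D0 x + (amp t * str t / 2) • J x) t := by
  have h1 := (hasDerivAt_str ht).smul_const (D0 x)
  have h2 := ((hasDerivAt_amp ht).div_const 2).smul_const (J x)
  exact h1.add h2

/-- The one-sided time derivative within `[0,1)` agrees with it. [folklore] -/
theorem timeDerivWithin_vel {t : ℝ} (ht : t ∈ Ico (0:ℝ) 1) (x : E3) :
    timeDerivWithin (Ico 0 1) vel t x = strDeriv t • D0 x + (amp t * str t / 2) • J x := by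
  rw [timeDerivWithin_apply]
  exact ((hasDerivAt_vel ht.2 x).hasDerivWithinAt).derivWithin (uniqueDiffOn_Ico 0 1 t ht)

/-- **The momentum equation** `∂ₜu + (u·∇)u = νΔu − ∇p` holds pointwise on `[0,1) × ℝ³` (any `ν`: `Δu = 0`). [folklore] -/
theorem momentum_vel (ν : ℝ) {t : ℝ} (ht : t ∈ Ico (0:ℝ) 1) (x : E3) :
    timeDerivWithin (Ico 0 1) vel t x + convect (vel t) (vel t) x =
      ν • (Δ (vel t)) x - gradient (pres t) x + (0 : ℝ → E3 → E3) t x := by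
  rw [timeDerivWithin_vel ht, show vel t = linVel (str t) (amp t) from rfl, convect_linVel,
    laplacian_linVel, gradient_pres]
  ext i
  fin_cases i <;> simp [presGrad, P1, P2] <;> ring

/-- Joint smoothness of `(t, x) ↦ u(t, x)` below `t = 1`. [folklore] -/
theorem contDiffAt_uncurry_vel {t : ℝ} (ht : t < 1) (x : E3) {n : WithTop ℕ∞} :
    ContDiffAt ℝ n (Function.uncurry vel) (t, x) := by
  have hs : ContDiffAt ℝ n (fun p : ℝ × E3 => str p.1) (t, x) :=
    (contDiffAt_str ht).comp (t, x) contDiffAt_fst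
  have ha : ContDiffAt ℝ n (fun p : ℝ × E3 => amp p.1 / 2) (t, x) :=
    ((contDiffAt_amp ht).comp (t, x) contDiffAt_fst).div_const 2
  have hD : ContDiffAt ℝ n (fun p : ℝ × E3 => D0 p.2) (t, x) :=
    D0.contDiff.contDiffAt.comp (t, x) contDiffAt_snd
  have hJ : ContDiffAt ℝ n (fun p : ℝ × E3 => J p.2) (t, x) :=
    J.contDiff.contDiffAt.comp (t, x) contDiffAt_snd
  have := (hs.smul hD).add (ha.smul hJ)
  exact this

/-- `u` is jointly smooth on `[0,1) × ℝ³`. [folklore] -/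
theorem isSmoothSpaceTimeOn_vel : IsSmoothSpaceTimeOn (Ico 0 1) vel := fun p hp =>
  (contDiffAt_uncurry_vel (mem_prod.1 hp).1.2 p.2).contDiffWithinAt

/-- Joint smoothness of `(t, x) ↦ p(t, x)` below `t = 1`. [folklore] -/
theorem contDiffAt_uncurry_pres {t : ℝ} (ht : t < 1) (x : E3) {n : WithTop ℕ∞} :
    ContDiffAt ℝ n (Function.uncurry pres) (t, x) := by
  have hc : ∀ i : Fin 3, ContDiffAt ℝ n (fun p : ℝ × E3 => (p.2 i) ^ 2) (t, x) := fun i =>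
    (((EuclideanSpace.proj (𝕜 := ℝ) i).contDiff.contDiffAt.comp (t, x) contDiffAt_snd)).pow 2
  have h1 : ContDiffAt ℝ n (fun p : ℝ × E3 => P1 p.1) (t, x) :=
    ((contDiffAt_strDeriv ht).add ((contDiffAt_str ht).pow 2)).comp (t, x) contDiffAt_fst
  have h2 : ContDiffAt ℝ n (fun p : ℝ × E3 => P2 p.1) (t, x) := by
    have : ContDiffAt ℝ n P2 t :=
      (((contDiffAt_strDeriv ht).neg.div_const 2).add (((contDiffAt_str ht).pow 2).div_const 4)).sub
        (((contDiffAt_amp ht).pow 2).div_const 4)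
    exact this.comp (t, x) contDiffAt_fst
  exact contDiffAt_const.mul ((h1.mul (hc 0)).add (h2.mul ((hc 1).add (hc 2))))

/-- `p` is jointly smooth on `[0,1) × ℝ³`. [folklore] -/
theorem isSmoothSpaceTimeOn_pres : IsSmoothSpaceTimeOn (Ico 0 1) pres := fun p hp =>
  (contDiffAt_uncurry_pres (mem_prod.1 hp).1.2 p.2).contDiffWithinAt

/-- **The linear flow is an exact classical Navier–Stokes solution on `[0,1) × ℝ³`** (any `ν`). [folklore] -/
theorem isClassicalNSSolutionOn_vel (ν : ℝ) : IsClassicalNSSolutionOn (Ico 0 1) ν 0 vel pres where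
  smooth_velocity := isSmoothSpaceTimeOn_vel
  smooth_pressure := isSmoothSpaceTimeOn_pres
  momentum _ ht x := momentum_vel ν ht x
  divFree _ _ x := divergence_linVel _ _ x


/-! ## Part C1: anisotropic Gaussian, spatial calculus -/


/-! ### the anisotropic Gaussian with variances `a, b, b` -/

/-- The quadratic form `Q(x) = x₀²/(2a) + (x₁² + x₂²)/(2b)` of the anisotropic Gaussian. [folklore] -/
def gQ (a b : ℝ) (x : E3) : ℝ := (x 0) ^ 2 / (2 * a) + ((x 1) ^ 2 + (x 2) ^ 2) / (2 * b)
/-- Its normalising constant `(√(2πa) · 2πb)⁻¹`. [folklore] -/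
def gC (a b : ℝ) : ℝ := (Real.sqrt (2 * π * a) * (2 * π * b))⁻¹
/-- The anisotropic Gaussian density `N(0, diag(a, b, b))` on `ℝ³`. [folklore] -/
def gK (a b : ℝ) (x : E3) : ℝ := gC a b * Real.exp (-(gQ a b x))

/-- linear form `Q'(x) v = x₀v₀/a + (x₁v₁ + x₂v₂)/b` [folklore] -/
def gQ' (a b : ℝ) (x : E3) : E3 →L[ℝ] ℝ := (x 0 / a) • crd 0 + (x 1 / b) • crd 1 + (x 2 / b) • crd 2

/-- `Q′(x) v = x₀v₀/a + (x₁v₁ + x₂v₂)/b`. [folklore] -/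
@[simp] theorem gQ'_apply (a b : ℝ) (x v : E3) :
    gQ' a b x v = x 0 * v 0 / a + (x 1 * v 1 + x 2 * v 2) / b := by
  simp [gQ']; ring

/-- `DQ(x) = Q′(x)`. [folklore] -/
theorem hasFDerivAt_gQ (a b : ℝ) (x : E3) : HasFDerivAt (gQ a b) (gQ' a b x) x := by
  have h0 := ((crd 0).hasFDerivAt (x := x)).pow 2
  have h1 := ((crd 1).hasFDerivAt (x := x)).pow 2
  have h2 := ((crd 2).hasFDerivAt (x := x)).pow 2
  have h := (h0.mul_const (2 * a)⁻¹).add ((h1.add h2).mul_const (2 * b)⁻¹)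
  have h' : HasFDerivAt (gQ a b) _ x :=
    h.congr_of_eventuallyEq (Eventually.of_forall fun y => by simp [gQ, div_eq_mul_inv])
  refine h'.congr_fderiv ?_
  ext v
  simp
  ring

/-- `DK(x) = −K(x) Q′(x)`. [folklore] -/
theorem hasFDerivAt_gK (a b : ℝ) (x : E3) :
    HasFDerivAt (gK a b) ((-(gK a b x)) • gQ' a b x) x := by
  have h := ((hasFDerivAt_gQ a b x).neg.exp).const_mul (gC a b)
  have h' : HasFDerivAt (gK a b) _ x :=
    h.congr_of_eventuallyEq (Eventually.of_forall fun y => by simp [gK])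
  refine h'.congr_fderiv ?_
  ext v
  simp [gK]
  ring

/-- `DK(x) v = −K(x) (x₀v₀/a + (x₁v₁ + x₂v₂)/b)`. [folklore] -/
theorem fderiv_gK_apply (a b : ℝ) (x v : E3) :
    fderiv ℝ (gK a b) x v = -(gK a b x) * (x 0 * v 0 / a + (x 1 * v 1 + x 2 * v 2) / b) := by
  rw [(hasFDerivAt_gK a b x).fderiv]
  simp

/-- `Q` is smooth. [folklore] -/
theorem contDiff_gQ (a b : ℝ) {n : WithTop ℕ∞} : ContDiff ℝ n (gQ a b) := by
  have hc : ∀ i : Fin 3, ContDiff ℝ n (fun x : E3 => (x i) ^ 2) := fun i => (crd i).contDiff.pow 2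
  have := ((hc 0).div_const (2 * a)).add (((hc 1).add (hc 2)).div_const (2 * b))
  exact this

/-- `K` is smooth. [folklore] -/
theorem contDiff_gK (a b : ℝ) {n : WithTop ℕ∞} : ContDiff ℝ n (gK a b) :=
  contDiff_const.mul (contDiff_gQ a b).neg.exp

/-- `K` is differentiable. [folklore] -/
theorem differentiableAt_gK (a b : ℝ) (x : E3) : DifferentiableAt ℝ (gK a b) x :=
  (hasFDerivAt_gK a b x).differentiableAt

/-- pure second partials: `∂ᵢ∂ᵢ K = K ((xᵢ/γᵢ)² − 1/γᵢ)` [folklore] -/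
theorem fderiv_fderiv_gK_single (a b : ℝ) (x : E3) (i : Fin 3) :
    fderiv ℝ (fun w => fderiv ℝ (gK a b) w (EuclideanSpace.single i 1)) x (EuclideanSpace.single i 1) =
      gK a b x * ((x i / (if i = 0 then a else b)) ^ 2 - 1 / (if i = 0 then a else b)) := by
  -- the first partial as a product of two scalar functions
  have hfun : (fun w => fderiv ℝ (gK a b) w (EuclideanSpace.single i 1)) =
      fun w => -(gK a b w) * (w i / (if i = 0 then a else b)) := by
    funext w
    rw [fderiv_gK_apply]
    fin_cases i <;> simp
  rw [hfun]
  have hG : HasFDerivAt (fun w => -(gK a b w)) _ x := (hasFDerivAt_gK a b x).neg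
  have hc : HasFDerivAt (fun w : E3 => w i / (if i = 0 then a else b))
      (((if i = 0 then a else b))⁻¹ • crd i) x := by
    have := ((crd i).hasFDerivAt (x := x)).mul_const ((if i = 0 then a else b))⁻¹
    refine (this.congr_of_eventuallyEq (Eventually.of_forall fun y => by
      simp [div_eq_mul_inv])).congr_fderiv ?_
    ext v; simp
  have hm : HasFDerivAt (fun w => -(gK a b w) * (w i / (if i = 0 then a else b))) _ x := hG.mul hc
  rw [hm.fderiv]
  fin_cases i <;> simp <;> ring

/-- **Laplacian of the anisotropic Gaussian**: `ΔK = K (x₀²/a² + (x₁² + x₂²)/b² − 1/a − 2/b)`. [folklore] -/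
theorem laplacian_gK (a b : ℝ) (x : E3) :
    (Δ (gK a b)) x = gK a b x * ((x 0 / a) ^ 2 + (x 1 / b) ^ 2 + (x 2 / b) ^ 2 - 1 / a - 2 / b) := by
  rw [laplacian_eq_sum_fderiv_fderiv (EuclideanSpace.basisFun (Fin 3) ℝ) (contDiff_gK a b)]
  simp only [EuclideanSpace.basisFun_apply, fderiv_fderiv_gK_single, Fin.sum_univ_three]
  simp
  ring

/-- `K > 0` for positive variances. [folklore] -/
theorem gK_pos {a b : ℝ} (ha : 0 < a) (hb : 0 < b) (x : E3) : 0 < gK a b x := by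
  unfold gK gC
  positivity


/-! ## Part C2: mass and bounds -/


/-- 1D Gaussian mass `∫ exp(−y²/(2v)) dy = √(2πv)` [folklore] -/
theorem integral_exp_neg_sq_div (v : ℝ) :
    ∫ y : ℝ, Real.exp (-(y ^ 2) / (2 * v)) = Real.sqrt (2 * π * v) := by
  have h := integral_gaussian (2 * v)⁻¹
  have e : (fun y : ℝ => Real.exp (-(2 * v)⁻¹ * y ^ 2)) = fun y => Real.exp (-(y ^ 2) / (2 * v)) := by
    funext y; congr 1; rw [div_eq_mul_inv]; ring
  rw [e] at h
  rw [h]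
  congr 1
  rw [div_inv_eq_mul]; ring

/-- **unit mass** of the anisotropic Gaussian [folklore] -/
theorem integral_gK {a b : ℝ} (ha : 0 < a) (hb : 0 < b) : ∫ x : E3, gK a b x = 1 := by
  have hmp : MeasurePreserving (MeasurableEquiv.toLp 2 (Fin 3 → ℝ)) :=
    PiLp.volume_preserving_toLp (Fin 3)
  simp only [gK, MeasureTheory.integral_const_mul]
  rw [← hmp.integral_comp']
  -- the integrand is a product over coordinates
  have hprod : ∀ y : Fin 3 → ℝ, Real.exp (-(gQ a b ((MeasurableEquiv.toLp 2 (Fin 3 → ℝ)) y))) =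
      ∏ i : Fin 3, Real.exp (-((y i) ^ 2) / (2 * (if i = 0 then a else b))) := by
    intro y
    rw [Fin.prod_univ_three, ← Real.exp_add, ← Real.exp_add]
    congr 1
    simp [gQ]
    ring
  simp_rw [hprod]
  rw [volume_pi, integral_fintype_prod_eq_prod
    (f := fun (i : Fin 3) (s : ℝ) => Real.exp (-(s ^ 2) / (2 * (if i = 0 then a else b))))]
  rw [Fin.prod_univ_three]
  simp only [Fin.isValue, ↓reduceIte, Fin.one_eq_zero_iff, OfNat.ofNat_ne_one,
    Fin.reduceEq]
  rw [integral_exp_neg_sq_div a, integral_exp_neg_sq_div b, gC]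
  have h2 : Real.sqrt (2 * π * b) * Real.sqrt (2 * π * b) = 2 * π * b :=
    Real.mul_self_sqrt (by positivity)
  have hpos : 0 < Real.sqrt (2 * π * a) * (2 * π * b) := by positivity
  rw [mul_assoc (Real.sqrt (2 * π * a)), h2]
  exact inv_mul_cancel₀ hpos.ne'

/-- `‖x‖² = x₀² + x₁² + x₂²` on `ℝ³`. [folklore] -/
theorem norm_sq_eq (x : E3) : ‖x‖ ^ 2 = (x 0) ^ 2 + (x 1) ^ 2 + (x 2) ^ 2 := by
  rw [EuclideanSpace.norm_eq, Real.sq_sqrt (by positivity)]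
  simp [Fin.sum_univ_three]

/-- `‖x‖²/(2M) ≤ Q(x) ≤ ‖x‖²/(2m)` when `m ≤ a, b ≤ M` [folklore] -/
theorem gQ_bounds {a b m M : ℝ} (hm : 0 < m) (hma : m ≤ a) (hmb : m ≤ b) (haM : a ≤ M) (hbM : b ≤ M)
    (x : E3) : ‖x‖ ^ 2 / (2 * M) ≤ gQ a b x ∧ gQ a b x ≤ ‖x‖ ^ 2 / (2 * m) := by
  have ha : 0 < a := hm.trans_le hma
  have hb : 0 < b := hm.trans_le hmb
  have hM : 0 < M := ha.trans_le haM
  rw [norm_sq_eq, gQ]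
  have h0 := sq_nonneg (x 0); have h1 := sq_nonneg (x 1); have h2 := sq_nonneg (x 2)
  constructor
  · rw [show ((x 0) ^ 2 + (x 1) ^ 2 + (x 2) ^ 2) / (2 * M) = (x 0) ^ 2 / (2 * M) + ((x 1) ^ 2 + (x 2) ^ 2) / (2 * M) by ring]
    gcongr
  · rw [show ((x 0) ^ 2 + (x 1) ^ 2 + (x 2) ^ 2) / (2 * m) = (x 0) ^ 2 / (2 * m) + ((x 1) ^ 2 + (x 2) ^ 2) / (2 * m) by ring]
    gcongr

/-- the normalising constant is antitone in both variances [folklore] -/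
theorem gC_le_gC {a b a' b' : ℝ} (ha' : 0 < a') (hb' : 0 < b') (ha : a' ≤ a) (hb : b' ≤ b) :
    gC a b ≤ gC a' b' := by
  unfold gC
  have : 0 < Real.sqrt (2 * π * a') * (2 * π * b') := by positivity
  apply inv_anti₀ this
  gcongr

/-- two-sided Gaussian bounds of the anisotropic kernel [folklore] -/
theorem gK_le {a b m M : ℝ} (hm : 0 < m) (hma : m ≤ a) (hmb : m ≤ b) (haM : a ≤ M) (hbM : b ≤ M)
    (x : E3) : gK a b x ≤ gC m m * Real.exp (-(‖x‖ ^ 2) / (2 * M)) := by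
  have ha : 0 < a := hm.trans_le hma
  have hb : 0 < b := hm.trans_le hmb
  unfold gK
  refine mul_le_mul (gC_le_gC hm hm hma hmb) ?_ (Real.exp_pos _).le ?_
  · rw [Real.exp_le_exp, neg_div]; exact neg_le_neg (gQ_bounds hm hma hmb haM hbM x).1
  · unfold gC; positivity

/-- Lower Gaussian bound of `K` when `m ≤ a, b ≤ M`. [folklore] -/
theorem le_gK {a b m M : ℝ} (hm : 0 < m) (hma : m ≤ a) (hmb : m ≤ b) (haM : a ≤ M) (hbM : b ≤ M)
    (x : E3) : gC M M * Real.exp (-(‖x‖ ^ 2) / (2 * m)) ≤ gK a b x := by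
  have ha : 0 < a := hm.trans_le hma
  have hb : 0 < b := hm.trans_le hmb
  unfold gK
  refine mul_le_mul (gC_le_gC ha hb haM hbM) ?_ (Real.exp_pos _).le ?_
  · rw [Real.exp_le_exp, neg_div]; exact neg_le_neg (gQ_bounds hm hma hmb haM hbM x).2
  · unfold gC; positivity

/-- `gC m m = (2πm)^{-3/2}` [folklore] -/
theorem gC_self {m : ℝ} (hm : 0 < m) : gC m m = (2 * π * m) ^ (-(3:ℝ) / 2) := by
  unfold gC
  have h : 0 < 2 * π * m := by positivity
  rw [Real.sqrt_eq_rpow, ← Real.rpow_one (2 * π * m), ← Real.rpow_mul h.le,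
    ← Real.rpow_add h, ← Real.rpow_neg h.le, Real.rpow_one]
  norm_num


/-! ## Part C3: concentration from a Gaussian upper bound (general lemma) -/

/-- **Concentration is implied by a heat-kernel upper bound plus unit mass.** If, for `t ↑ T`,
the slices `G t` are nonnegative, have unit mass and lie below a constant multiple of a backward
heat kernel with pole `(T, x₀)`, then `∫ φ G(t) → φ(x₀)` for every bounded continuous `φ`.
(So clause (5) of the adapted-kernel interface is redundant given comparability and (4).) [folklore] -/
theorem tendsto_integral_mul_of_le_heatKernel {G : ℝ → E3 → ℝ} {T : ℝ} {x₀ : E3} {K ν' : ℝ}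
    (hν' : 0 < ν')
    (hG : ∀ᶠ t in 𝓝[<] T, (∀ x, 0 ≤ G t x) ∧ (∫ x, G t x = 1) ∧
      ∀ x, G t x ≤ K * backwardHeatKernel ν' T x₀ t x)
    {φ : E3 → ℝ} (hφ : Continuous φ) {M : ℝ} (hM : ∀ x, |φ x| ≤ M) :
    Tendsto (fun t => ∫ x, φ x * G t x) (𝓝[<] T) (𝓝 (φ x₀)) := by
  -- test function ψ = |φ - φ x₀|, bounded continuous with ψ x₀ = 0
  set ψ : E3 → ℝ := fun x => |φ x - φ x₀| with hψ
  have hψc : Continuous ψ := (hφ.sub continuous_const).abs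
  have hψM : ∀ x, |ψ x| ≤ 2 * M := fun x => by
    rw [hψ]; simp only [abs_abs]
    calc |φ x - φ x₀| ≤ |φ x| + |φ x₀| := abs_sub _ _
      _ ≤ M + M := add_le_add (hM x) (hM x₀)
      _ = 2 * M := by ring
  have hlim : Tendsto (fun t => ∫ x, ψ x * backwardHeatKernel ν' T x₀ t x) (𝓝[<] T) (𝓝 0) := by
    have := tendsto_integral_mul_backwardHeatKernel hν' T x₀ hψc hψM
    simpa [hψ] using this
  -- squeeze |∫ φ G - φ x₀| ≤ K ∫ ψ Γ
  rw [tendsto_iff_norm_sub_tendsto_zero]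
  refine squeeze_zero' (Eventually.of_forall fun t => norm_nonneg _) ?_
    (by simpa using hlim.const_mul K)
  filter_upwards [hG, self_mem_nhdsWithin] with t ⟨hpos, hmass, hle⟩ htT
  have hint : Integrable (G t) := by
    by_contra h; rw [integral_undef h] at hmass; exact zero_ne_one hmass
  have hK0 : ∀ x, 0 ≤ K * backwardHeatKernel ν' T x₀ t x := fun x => (hpos x).trans (hle x)
  have hΓint : Integrable (backwardHeatKernel ν' T x₀ t) :=
    ((isAdaptedBackwardKernel_backwardHeatKernel hν' T x₀).integrable (t := t) htT)
  have hφG : Integrable (fun x => φ x * G t x) :=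
    hint.bdd_mul hφ.aestronglyMeasurable
      (Eventually.of_forall fun x => by rw [Real.norm_eq_abs]; exact hM x)
  have hψΓ : Integrable (fun x => ψ x * (K * backwardHeatKernel ν' T x₀ t x)) :=
    (hΓint.const_mul K).bdd_mul hψc.aestronglyMeasurable
      (Eventually.of_forall fun x => by rw [Real.norm_eq_abs]; exact hψM x)
  have h1 : (∫ x, φ x * G t x) - φ x₀ = ∫ x, (φ x - φ x₀) * G t x := by
    have e : ∫ x, (φ x - φ x₀) * G t x = (∫ x, φ x * G t x) - ∫ x, φ x₀ * G t x := by
      rw [← integral_sub hφG (hint.const_mul _)]; congr 1; funext x; ring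
    rw [e, MeasureTheory.integral_const_mul, hmass, mul_one]
  rw [h1, Real.norm_eq_abs]
  calc |∫ x, (φ x - φ x₀) * G t x| ≤ ∫ x, |(φ x - φ x₀) * G t x| := abs_integral_le_integral_abs
    _ ≤ ∫ x, ψ x * (K * backwardHeatKernel ν' T x₀ t x) := by
        refine integral_mono_of_nonneg (Eventually.of_forall fun x => abs_nonneg _) hψΓ
          (Eventually.of_forall fun x => ?_)
        simp only [hψ, abs_mul, abs_of_nonneg (hpos x)]
        exact mul_le_mul_of_nonneg_left (hle x) (abs_nonneg _)
    _ = K * ∫ x, ψ x * backwardHeatKernel ν' T x₀ t x := by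
        rw [← MeasureTheory.integral_const_mul]; congr 1; funext x; ring

/-! ## Part C4: the time-dependent adapted kernel of the linear flow -/

/-- time derivative of `s ↦ gK (A s) (B s) x` in closed form [folklore] -/
theorem hasDerivAt_gK_comp {A B : ℝ → ℝ} {A' B' t : ℝ} (hA : HasDerivAt A A' t) (hB : HasDerivAt B B' t)
    (hAt : 0 < A t) (hBt : 0 < B t) (x : E3) :
    HasDerivAt (fun s => gK (A s) (B s) x)
      (gK (A t) (B t) x * (-(A' / (2 * A t)) - B' / B t + (x 0) ^ 2 * A' / (2 * (A t) ^ 2)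
        + ((x 1) ^ 2 + (x 2) ^ 2) * B' / (2 * (B t) ^ 2))) t := by
  have h2A : HasDerivAt (fun s => 2 * π * A s) (2 * π * A') t := hA.const_mul _
  have h2B : HasDerivAt (fun s => 2 * π * B s) (2 * π * B') t := hB.const_mul _
  have hpA : 0 < 2 * π * A t := by positivity
  have hsq := h2A.sqrt hpA.ne'
  have hprod := hsq.mul h2B
  have hne : Real.sqrt (2 * π * A t) * (2 * π * B t) ≠ 0 := by positivity
  have hC : HasDerivAt (fun s => gC (A s) (B s)) _ t := hprod.inv hne
  have hQA := ((hA.const_mul 2).inv (by positivity)).const_mul ((x 0) ^ 2)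
  have hQB := ((hB.const_mul 2).inv (by positivity)).const_mul ((x 1) ^ 2 + (x 2) ^ 2)
  have hQ : HasDerivAt (fun s => gQ (A s) (B s) x)
      ((x 0) ^ 2 * (-(2 * A') / (2 * A t) ^ 2) +
        ((x 1) ^ 2 + (x 2) ^ 2) * (-(2 * B') / (2 * B t) ^ 2)) t := by
    refine (hQA.add hQB).congr_of_eventuallyEq (Eventually.of_forall fun s => ?_)
    simp only [gQ, div_eq_mul_inv, Pi.inv_apply, Pi.add_apply]
  have hK : HasDerivAt (fun s => gK (A s) (B s) x) _ t := hC.mul hQ.neg.exp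
  refine hK.congr_deriv ?_
  simp only [gK, gC, gQ, Pi.mul_apply, Pi.neg_apply]
  -- algebra: replace `A t` by `r²/(2π)` with `r = √(2πA)`
  have hr2 : Real.sqrt (2 * π * A t) ^ 2 = 2 * π * A t := Real.sq_sqrt hpA.le
  have hr0 : 0 < Real.sqrt (2 * π * A t) := Real.sqrt_pos.2 hpA
  generalize Real.sqrt (2 * π * A t) = r at hr2 hr0 ⊢
  have hpi : (π : ℝ) ≠ 0 := Real.pi_pos.ne'
  have hAr : A t = r ^ 2 / (2 * π) := by rw [hr2]; field_simp
  have hB0 : B t ≠ 0 := hBt.ne'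
  have hr0' : r ≠ 0 := hr0.ne'
  rw [hAr]
  field_simp
  ring

/-- the adapted kernel of the linear flow: anisotropic Gaussian with variances `α(t), β(t), β(t)` [folklore] -/
def G (ν t : ℝ) (x : E3) : ℝ := gK (varA ν t) (varB ν t) x

/-- `G > 0` below `t = 1`. [folklore] -/
theorem G_pos {ν : ℝ} (hν : 0 < ν) {t : ℝ} (ht : t < 1) (x : E3) : 0 < G ν t x :=
  gK_pos (varA_pos hν ht) (varB_pos hν ht) x

/-- **Unit mass** `∫ G(t) = 1` below `t = 1`. [folklore] -/
theorem integral_G {ν : ℝ} (hν : 0 < ν) {t : ℝ} (ht : t < 1) : ∫ x, G ν t x = 1 :=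
  integral_gK (varA_pos hν ht) (varB_pos hν ht)

/-- Time derivative of `G` at fixed `x` (chain rule with the variance ODEs). [folklore] -/
theorem hasDerivAt_G {ν : ℝ} (hν : 0 < ν) {t : ℝ} (ht : t < 1) (x : E3) :
    HasDerivAt (fun s => G ν s x)
      (G ν t x * (-((2 * str t * varA ν t - 2 * ν) / (2 * varA ν t))
        - (-(str t) * varB ν t - 2 * ν) / varB ν t
        + (x 0) ^ 2 * (2 * str t * varA ν t - 2 * ν) / (2 * (varA ν t) ^ 2)
        + ((x 1) ^ 2 + (x 2) ^ 2) * (-(str t) * varB ν t - 2 * ν) / (2 * (varB ν t) ^ 2))) t :=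
  hasDerivAt_gK_comp (hasDerivAt_varA ν ht) (hasDerivAt_varB ν ht) (varA_pos hν ht) (varB_pos hν ht) x

/-- **the adjoint equation** `∂ₜG + u·∇G + νΔG = 0` for the linear flow and its kernel [folklore] -/
theorem adjoint_eq_G {ν : ℝ} (hν : 0 < ν) {t : ℝ} (ht : t ∈ Ico (0:ℝ) 1) (x : E3) :
    timeDerivWithin (Ico 0 1) (G ν) t x + fderiv ℝ (G ν t) x (vel t x) +
      ν * (Δ (G ν t)) x = 0 := by
  have hA := varA_pos hν ht.2
  have hB := varB_pos hν ht.2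
  rw [timeDerivWithin_apply,
    ((hasDerivAt_G hν ht.2 x).hasDerivWithinAt).derivWithin (uniqueDiffOn_Ico 0 1 t ht)]
  rw [show G ν t = gK (varA ν t) (varB ν t) from rfl, fderiv_gK_apply, laplacian_gK]
  simp only [vel, linVel_apply0, linVel_apply1, linVel_apply2]
  field_simp
  ring

/-! ## Part C5: joint regularity, comparability, concentration of `G` -/

/-- `G` is jointly `Cⁿ` on `(−∞, 1) × ℝ³` (every `n`). [folklore] -/
theorem contDiffOn_uncurry_G (ν : ℝ) (hν : 0 < ν) {n : ℕ∞} :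
    ContDiffOn ℝ (n : WithTop ℕ∞) (Function.uncurry (G ν)) (Iio 1 ×ˢ univ) := by
  have hmaps : MapsTo (Prod.fst : ℝ × E3 → ℝ) (Iio 1 ×ˢ univ) (Iio 1) := fun p hp =>
    (mem_prod.1 hp).1
  have hA : ContDiffOn ℝ n (fun p : ℝ × E3 => varA ν p.1) (Iio 1 ×ˢ univ) :=
    ((contDiffOn_varA ν).of_le (by exact_mod_cast le_top)).comp contDiffOn_fst hmaps
  have hB : ContDiffOn ℝ n (fun p : ℝ × E3 => varB ν p.1) (Iio 1 ×ˢ univ) :=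
    ((contDiffOn_varB ν).of_le (by exact_mod_cast le_top)).comp contDiffOn_fst hmaps
  have hApos : ∀ p ∈ Iio (1:ℝ) ×ˢ (univ : Set E3), varA ν p.1 ≠ 0 := fun p hp =>
    (varA_pos hν (mem_prod.1 hp).1).ne'
  have hBpos : ∀ p ∈ Iio (1:ℝ) ×ˢ (univ : Set E3), varB ν p.1 ≠ 0 := fun p hp =>
    (varB_pos hν (mem_prod.1 hp).1).ne'
  have hc : ∀ i : Fin 3, ContDiffOn ℝ n (fun p : ℝ × E3 => (p.2 i) ^ 2) (Iio 1 ×ˢ univ) := fun i =>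
    (((crd i).contDiff.comp contDiff_snd).pow 2).contDiffOn
  -- the normalising constant
  have hC : ContDiffOn ℝ n (fun p : ℝ × E3 => gC (varA ν p.1) (varB ν p.1)) (Iio 1 ×ˢ univ) := by
    unfold gC
    refine ContDiffOn.inv ?_ fun p hp => ?_
    · refine ((contDiffOn_const.mul hA).sqrt fun p hp => ?_).mul (contDiffOn_const.mul hB)
      have := varA_pos hν (mem_prod.1 hp).1
      positivity
    · have := varA_pos hν (mem_prod.1 hp).1
      have := varB_pos hν (mem_prod.1 hp).1
      positivity
  -- the quadratic form
  have hQ : ContDiffOn ℝ n (fun p : ℝ × E3 => gQ (varA ν p.1) (varB ν p.1) p.2) (Iio 1 ×ˢ univ) := by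
    unfold gQ
    refine ((hc 0).div (contDiffOn_const.mul hA) fun p hp => ?_).add
      (((hc 1).add (hc 2)).div (contDiffOn_const.mul hB) fun p hp => ?_)
    · exact mul_ne_zero two_ne_zero (hApos p hp)
    · exact mul_ne_zero two_ne_zero (hBpos p hp)
  exact hC.mul hQ.neg.exp

/-- `G` is jointly `C²` on `[0, 1) × ℝ³` (clause (1)). [folklore] -/
theorem contDiffOn_uncurry_G_Ico (ν : ℝ) (hν : 0 < ν) :
    ContDiffOn ℝ 2 (Function.uncurry (G ν)) (Ico 0 1 ×ˢ univ) :=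
  (contDiffOn_uncurry_G ν hν (n := 2)).mono (prod_mono Ico_subset_Iio_self Subset.rfl)

/-- `√(c τ) · (c τ) = c^{3/2} τ^{3/2}` bookkeeping: `gC (cτ) (cτ) = (2πc)^{-3/2} τ^{-3/2}` [folklore] -/
theorem gC_mul_self {c τ : ℝ} (hc : 0 < c) (hτ : 0 < τ) :
    gC (c * τ) (c * τ) = (2 * π * c) ^ (-(3:ℝ) / 2) * τ ^ (-(3:ℝ) / 2) := by
  rw [gC_self (mul_pos hc hτ), show 2 * π * (c * τ) = (2 * π * c) * τ by ring,
    Real.mul_rpow (by positivity) hτ.le]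

/-- **two-sided Gaussian comparability** of `G` on `[0, 1)` about the pole `(1, 0)` [folklore] -/
theorem G_comparable {ν : ℝ} (hν : 0 < ν) :
    ∃ c₁ c₂ C₁ C₂ : ℝ, 0 < c₁ ∧ 0 < c₂ ∧ 0 < C₁ ∧ 0 < C₂ ∧ ∀ t ∈ Ico (0:ℝ) 1, ∀ x : E3,
      c₁ * (1 - t) ^ (-(3:ℝ) / 2) * Real.exp (-(‖x - 0‖ ^ 2) / (c₂ * (1 - t))) ≤ G ν t x ∧
        G ν t x ≤ C₁ * (1 - t) ^ (-(3:ℝ) / 2) * Real.exp (-(‖x - 0‖ ^ 2) / (C₂ * (1 - t))) := by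
  set m := 2 * ν * Real.exp (-4) with hm
  set M := 2 * ν * Real.exp 4 with hM
  have hm0 : 0 < m := by positivity
  have hM0 : 0 < M := by positivity
  refine ⟨(2 * π * M) ^ (-(3:ℝ) / 2), 2 * m, (2 * π * m) ^ (-(3:ℝ) / 2), 2 * M,
    by positivity, by positivity, by positivity, by positivity, fun t ht x => ?_⟩
  have hτ : 0 < 1 - t := sub_pos.2 ht.2
  obtain ⟨hA1, hA2⟩ := varA_bounds hν.le ht.2.le
  obtain ⟨hB1, hB2⟩ := varB_bounds hν.le ht.2.le
  have e1 : Real.exp (-4) ≤ Real.exp (-2) := Real.exp_le_exp.2 (by norm_num)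
  have e2 : Real.exp 2 ≤ Real.exp 4 := Real.exp_le_exp.2 (by norm_num)
  have hmA : m * (1 - t) ≤ varA ν t := by rw [hm]; linarith
  have hmB : m * (1 - t) ≤ varB ν t := by
    rw [hm]; nlinarith [mul_le_mul_of_nonneg_right e1 (by positivity : (0:ℝ) ≤ 2 * ν * (1 - t))]
  have hAM : varA ν t ≤ M * (1 - t) := by rw [hM]; linarith
  have hBM : varB ν t ≤ M * (1 - t) := by
    rw [hM]; nlinarith [mul_le_mul_of_nonneg_right e2 (by positivity : (0:ℝ) ≤ 2 * ν * (1 - t))]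
  rw [sub_zero]
  constructor
  · have h := le_gK (mul_pos hm0 hτ) hmA hmB hAM hBM x
    rw [gC_mul_self hM0 hτ] at h
    calc (2 * π * M) ^ (-(3:ℝ) / 2) * (1 - t) ^ (-(3:ℝ) / 2) * Real.exp (-‖x‖ ^ 2 / (2 * m * (1 - t)))
        = (2 * π * M) ^ (-(3:ℝ) / 2) * (1 - t) ^ (-(3:ℝ) / 2) *
            Real.exp (-‖x‖ ^ 2 / (2 * (m * (1 - t)))) := by rw [mul_assoc 2 m]
      _ ≤ G ν t x := h
  · have h := gK_le (mul_pos hm0 hτ) hmA hmB hAM hBM x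
    rw [gC_mul_self hm0 hτ] at h
    calc G ν t x ≤ (2 * π * m) ^ (-(3:ℝ) / 2) * (1 - t) ^ (-(3:ℝ) / 2) *
            Real.exp (-‖x‖ ^ 2 / (2 * (M * (1 - t)))) := h
      _ = (2 * π * m) ^ (-(3:ℝ) / 2) * (1 - t) ^ (-(3:ℝ) / 2) *
            Real.exp (-‖x‖ ^ 2 / (2 * M * (1 - t))) := by rw [mul_assoc 2 M]

/-- the upper bound rewritten against the backward heat kernel with `4ν' = 2M` [folklore] -/
theorem G_le_heatKernel {ν : ℝ} (hν : 0 < ν) :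
    ∃ K ν' : ℝ, 0 < ν' ∧ ∀ t ∈ Ico (0:ℝ) 1, ∀ x : E3,
      G ν t x ≤ K * backwardHeatKernel ν' 1 0 t x := by
  obtain ⟨c₁, c₂, C₁, C₂, -, -, hC₁, hC₂, h⟩ := G_comparable hν
  refine ⟨C₁ * (4 * π * (C₂ / 4)) ^ ((3:ℝ) / 2), C₂ / 4, by positivity, fun t ht x => ?_⟩
  have hτ : 0 < 1 - t := sub_pos.2 ht.2
  rw [backwardHeatKernel_eq (by positivity) 0 ht.2 x]
  simp only [finrank_euclideanSpace_fin, Nat.cast_ofNat]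
  have h4 : 4 * (C₂ / 4) * (1 - t) = C₂ * (1 - t) := by ring
  rw [h4]
  have hpow : (4 * π * (C₂ / 4)) ^ ((3:ℝ) / 2) * (4 * π * (C₂ / 4)) ^ (-(3:ℝ) / 2) = 1 := by
    rw [← Real.rpow_add (by positivity)]; norm_num
  calc G ν t x ≤ C₁ * (1 - t) ^ (-(3:ℝ) / 2) * Real.exp (-(‖x - 0‖ ^ 2) / (C₂ * (1 - t))) := (h t ht x).2
    _ = C₁ * (4 * π * (C₂ / 4)) ^ ((3:ℝ) / 2) * ((4 * π * (C₂ / 4)) ^ (-(3:ℝ) / 2) *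
          (1 - t) ^ (-(3:ℝ) / 2) * Real.exp (-(‖x - 0‖ ^ 2) / (C₂ * (1 - t)))) := by
        calc C₁ * (1 - t) ^ (-(3:ℝ) / 2) * Real.exp (-(‖x - 0‖ ^ 2) / (C₂ * (1 - t)))
            = C₁ * ((4 * π * (C₂ / 4)) ^ ((3:ℝ) / 2) * (4 * π * (C₂ / 4)) ^ (-(3:ℝ) / 2)) *
              (1 - t) ^ (-(3:ℝ) / 2) * Real.exp (-(‖x - 0‖ ^ 2) / (C₂ * (1 - t))) := by
                rw [hpow, mul_one]
          _ = _ := by ring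

/-- **concentration at the pole** `(1, 0)` [folklore] -/
theorem tendsto_integral_mul_G {ν : ℝ} (hν : 0 < ν) {φ : E3 → ℝ} (hφ : Continuous φ)
    (hM : ∃ M : ℝ, ∀ x, |φ x| ≤ M) :
    Tendsto (fun t => ∫ x, φ x * G ν t x) (𝓝[<] 1) (𝓝 (φ 0)) := by
  obtain ⟨M, hM⟩ := hM
  obtain ⟨K, ν', hν', hle⟩ := G_le_heatKernel hν
  refine tendsto_integral_mul_of_le_heatKernel (K := K) hν' ?_ hφ hM
  have hIco : ∀ᶠ t in 𝓝[<] (1:ℝ), t ∈ Ico (0:ℝ) 1 := by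
    have : Ico (0:ℝ) 1 ∈ 𝓝[<] (1:ℝ) := Ico_mem_nhdsLT zero_lt_one
    exact this
  filter_upwards [hIco] with t ht
  exact ⟨fun x => (G_pos hν ht.2 x).le, integral_G hν ht.2, hle t ht⟩

/-! ## Part D: adapted enstrophy and frequency of the linear flow; the refutation -/

/-- the adapted enstrophy is `ω(t)²` [folklore] -/
theorem integral_curl_vel_sq_mul_G {ν : ℝ} (hν : 0 < ν) {t : ℝ} (ht : t < 1) :
    ∫ x, ‖curl (vel t) x‖ ^ 2 * G ν t x = amp t ^ 2 := by
  rw [show vel t = linVel (str t) (amp t) from rfl]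
  simp_rw [norm_curl_linVel_sq]
  rw [MeasureTheory.integral_const_mul, integral_G hν ht, mul_one]

/-- the adapted frequency is `2 cos (log (1 - t))` on `[0, 1)` [folklore] -/
theorem frequency_eq {ν : ℝ} (hν : 0 < ν) {H Λ : ℝ → ℝ}
    (hH : H = fun t => ∫ x, ‖curl (vel t) x‖ ^ 2 * G ν t x)
    (hΛ : Λ = fun t => (1 - t) * deriv H t / H t) {t : ℝ} (ht : t < 1) :
    Λ t = 2 * Real.cos (Real.log (1 - t)) := by
  have hHeq : H =ᶠ[𝓝 t] fun s => amp s ^ 2 := by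
    filter_upwards [Iio_mem_nhds ht] with s hs
    rw [hH]; exact integral_curl_vel_sq_mul_G hν hs
  have hd : deriv H t = 2 * amp t * (amp t * str t) := by
    rw [hHeq.deriv_eq]
    have h2 : HasDerivAt (fun s => amp s ^ 2) (((2 : ℕ) : ℝ) * amp t ^ (2 - 1) * (amp t * str t)) t :=
      (hasDerivAt_amp ht).pow 2
    rw [h2.deriv]; norm_num
  have hHt : H t = amp t ^ 2 := hHeq.eq_of_nhds
  rw [hΛ]
  simp only [hd, hHt, str]
  have ha : amp t ≠ 0 := (amp_pos t).ne'
  have h1 : (1 - t) ≠ 0 := (sub_pos.2 ht).ne'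
  field_simp

/-- **the adapted frequency of the linear flow has no limit at the singular time** [folklore] -/
theorem not_tendsto_frequency {ν : ℝ} (hν : 0 < ν) {H Λ : ℝ → ℝ}
    (hH : H = fun t => ∫ x, ‖curl (vel t) x‖ ^ 2 * G ν t x)
    (hΛ : Λ = fun t => (1 - t) * deriv H t / H t) :
    ¬ ∃ Λ₀ : ℝ, Tendsto Λ (𝓝[<] 1) (𝓝 Λ₀) := by
  rintro ⟨Λ₀, hlim⟩
  -- two sequences tending to `1⁻` along which `Λ` is `2` and `-2`
  have hseq : ∀ c : ℝ, Tendsto (fun n : ℕ => 1 - Real.exp (-(n * (2 * π) + c))) atTop (𝓝[<] (1:ℝ)) := by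
    intro c
    refine tendsto_nhdsWithin_iff.2 ⟨?_, Eventually.of_forall fun n => ?_⟩
    · have h1 : Tendsto (fun n : ℕ => (n : ℝ) * (2 * π) + c) atTop atTop :=
        tendsto_atTop_add_const_right _ _ (tendsto_natCast_atTop_atTop.atTop_mul_const (by positivity))
      have h2 := Real.tendsto_exp_neg_atTop_nhds_zero.comp h1
      have h3 := h2.const_sub (1:ℝ)
      simpa using h3
    · exact sub_lt_self _ (Real.exp_pos _)
  have hval : ∀ (c : ℝ) (n : ℕ), Λ (1 - Real.exp (-(n * (2 * π) + c))) = 2 * Real.cos (n * (2 * π) + c) := by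
    intro c n
    rw [frequency_eq hν hH hΛ (sub_lt_self _ (Real.exp_pos _)), sub_sub_cancel, Real.log_exp, Real.cos_neg]
  have hlim0 := hlim.comp (hseq 0)
  have hlimπ := hlim.comp (hseq π)
  have e0 : (Λ ∘ fun n : ℕ => 1 - Real.exp (-(n * (2 * π) + 0))) = fun _ => 2 := by
    funext n; rw [Function.comp_apply, hval, add_zero, Real.cos_nat_mul_two_pi]; norm_num
  have eπ : (Λ ∘ fun n : ℕ => 1 - Real.exp (-(n * (2 * π) + π))) = fun _ => -2 := by
    funext n; rw [Function.comp_apply, hval, Real.cos_nat_mul_two_pi_add_pi]; norm_num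
  rw [e0] at hlim0
  rw [eπ] at hlimπ
  have h2 : Λ₀ = 2 := tendsto_nhds_unique hlim0 tendsto_const_nhds
  have hm2 : Λ₀ = -2 := tendsto_nhds_unique hlimπ tendsto_const_nhds
  linarith

/-- **parabolic-local Type-I bound** at the singular point `(1, 0)` [folklore] -/
theorem local_typeI_vel : ∃ C : ℝ, ∀ᶠ t in 𝓝[<] (1:ℝ), ∀ x : E3, ‖x - 0‖ ^ 2 ≤ 1 - t →
    ‖vel t x‖ ≤ C / Real.sqrt (1 - t) := by
  refine ⟨‖D0‖ + Real.exp 1 / 2 * ‖J‖, ?_⟩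
  filter_upwards [Ico_mem_nhdsLT zero_lt_one] with t ht x hx
  rw [sub_zero] at hx
  have hτ : 0 < 1 - t := sub_pos.2 ht.2
  have hτ1 : 1 - t ≤ 1 := by linarith [ht.1]
  have hsq : 0 < Real.sqrt (1 - t) := Real.sqrt_pos.2 hτ
  have hxle : ‖x‖ ≤ Real.sqrt (1 - t) := by
    rw [← Real.sqrt_sq (norm_nonneg x)]; exact Real.sqrt_le_sqrt hx
  have hstr : |str t| ≤ 1 / (1 - t) := by
    rw [str, abs_div, abs_of_pos hτ]
    exact div_le_div_of_nonneg_right (Real.abs_cos_le_one _) hτ.le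
  have hamp : |amp t / 2| ≤ Real.exp 1 / 2 := by
    rw [abs_of_pos (by have := amp_pos t; positivity)]; linarith [amp_le t]
  -- ‖u‖ ≤ |d| ‖D0‖ ‖x‖ + |ω/2| ‖J‖ ‖x‖
  have h1 : ‖vel t x‖ ≤ |str t| * (‖D0‖ * ‖x‖) + |amp t / 2| * (‖J‖ * ‖x‖) := by
    unfold vel linVel
    refine (norm_add_le _ _).trans (add_le_add ?_ ?_)
    · rw [norm_smul, Real.norm_eq_abs]
      exact mul_le_mul_of_nonneg_left (D0.le_opNorm x) (abs_nonneg _)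
    · rw [norm_smul, Real.norm_eq_abs]
      exact mul_le_mul_of_nonneg_left (J.le_opNorm x) (abs_nonneg _)
  have hsqrt_le : Real.sqrt (1 - t) ≤ 1 / Real.sqrt (1 - t) := by
    rw [le_div_iff₀ hsq, Real.mul_self_sqrt hτ.le]; exact hτ1
  have hinv : 1 / (1 - t) * Real.sqrt (1 - t) = 1 / Real.sqrt (1 - t) := by
    field_simp
    rw [Real.sq_sqrt hτ.le]
  calc ‖vel t x‖ ≤ |str t| * (‖D0‖ * ‖x‖) + |amp t / 2| * (‖J‖ * ‖x‖) := h1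
    _ ≤ (1 / (1 - t)) * (‖D0‖ * Real.sqrt (1 - t)) + (Real.exp 1 / 2) * (‖J‖ * Real.sqrt (1 - t)) := by
        gcongr
    _ = ‖D0‖ * (1 / (1 - t) * Real.sqrt (1 - t)) + Real.exp 1 / 2 * ‖J‖ * Real.sqrt (1 - t) := by ring
    _ ≤ ‖D0‖ * (1 / Real.sqrt (1 - t)) + Real.exp 1 / 2 * ‖J‖ * (1 / Real.sqrt (1 - t)) := by
        rw [hinv]; gcongr
    _ = (‖D0‖ + Real.exp 1 / 2 * ‖J‖) / Real.sqrt (1 - t) := by ring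

/-! ## Part D2: `(1, 0)` is a backward-singular point of the linear flow -/

/-- along `tₙ = 1 − e^{−2πn}` the strain rate is `e^{2πn}`: the field is unbounded near `(1, 0)`
on the axis point `(r/2, 0, 0)` [folklore] -/
theorem vel_axis (t r : ℝ) : vel t (EuclideanSpace.single 0 r) = EuclideanSpace.single 0 (str t * r) := by
  ext i
  fin_cases i <;> simp [vel]

/-- `‖c e₀‖ = |c|`. [folklore] -/
theorem norm_single_zero (c : ℝ) : ‖(EuclideanSpace.single (0 : Fin 3) c : E3)‖ = |c| := by
  rw [EuclideanSpace.norm_eq]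
  simp [Real.sqrt_sq_eq_abs]

/-- Along `tₙ = 1 − e^{−2πn}` the strain rate is `e^{2πn}`. [folklore] -/
theorem str_special (n : ℕ) : str (1 - Real.exp (-(n * (2 * π)))) = Real.exp (n * (2 * π)) := by
  rw [str, sub_sub_cancel, Real.log_exp, Real.cos_neg, Real.cos_nat_mul_two_pi, Real.exp_neg]
  field_simp

/-- **backward singularity**: `u` is essentially unbounded on every parabolic cylinder at `(1, 0)` [folklore] -/
theorem singular_vel (r : ℝ) (hr : 0 < r) :
    eLpNorm (Function.uncurry vel) ⊤ (volume.restrict (parabolicCylinder r ((1:ℝ), (0 : E3)))) = ⊤ := by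
  by_contra hne
  set S := eLpNorm (Function.uncurry vel) ⊤ (volume.restrict (parabolicCylinder r ((1:ℝ), (0:E3))))
    with hS
  have hSlt : S < ⊤ := lt_top_iff_ne_top.2 hne
  -- a.e. bound on the cylinder
  have hae : ∀ᵐ p ∂(volume.restrict (parabolicCylinder r ((1:ℝ), (0:E3)))),
      ‖Function.uncurry vel p‖ₑ ≤ S := by
    rw [hS, eLpNorm_exponent_top]; exact ae_le_eLpNormEssSup
  -- choose n with e^{-2πn} < r² and (r/2) e^{2πn} > S.toReal + 1
  obtain ⟨n, hn⟩ : ∃ n : ℕ, max (Real.log (r ^ 2)⁻¹) (Real.log ((S.toReal + 1) / (r / 2))) < n * (2 * π) := by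
    obtain ⟨n, hn⟩ := exists_nat_gt (max (Real.log (r ^ 2)⁻¹) (Real.log ((S.toReal + 1) / (r / 2))) / (2 * π))
    exact ⟨n, (div_lt_iff₀ (by positivity)).1 hn⟩
  have hn1 : Real.exp (-(n * (2 * π))) < r ^ 2 := by
    rw [Real.exp_neg, inv_lt_comm₀ (Real.exp_pos _) (by positivity), ← Real.log_lt_iff_lt_exp (by positivity)]
    exact (le_max_left _ _).trans_lt hn
  have hn2 : S.toReal + 1 < (r / 2) * Real.exp (n * (2 * π)) := by
    rw [← div_lt_iff₀' (by positivity), ← Real.log_lt_iff_lt_exp (by positivity)]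
    exact (le_max_right _ _).trans_lt hn
  set t₀ : ℝ := 1 - Real.exp (-(n * (2 * π))) with ht₀
  set x₀ : E3 := EuclideanSpace.single 0 (r / 2) with hx₀
  have ht₀1 : t₀ < 1 := sub_lt_self _ (Real.exp_pos _)
  have hval : ‖vel t₀ x₀‖ = (r / 2) * Real.exp (n * (2 * π)) := by
    rw [hx₀, vel_axis, ht₀, str_special, norm_single_zero, abs_of_pos (by positivity)]
    ring
  -- the open set where `‖u‖ > S.toReal + 1`, intersected with the cylinder, has positive measure
  set U : Set (ℝ × E3) := {p | S.toReal + 1 < ‖Function.uncurry vel p‖} ∩ (Iio 1 ×ˢ univ) with hU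
  have hcont : ContinuousOn (fun p : ℝ × E3 => ‖Function.uncurry vel p‖) (Iio 1 ×ˢ univ) :=
    fun p hp => ((contDiffAt_uncurry_vel (n := 0) (mem_prod.1 hp).1 p.2).continuousAt.norm).continuousWithinAt
  have hUo : IsOpen U := by
    rw [hU, inter_comm]
    exact hcont.isOpen_inter_preimage (isOpen_Iio.prod isOpen_univ) isOpen_Ioi
  have hmem : ((t₀, x₀) : ℝ × E3) ∈ U ∩ parabolicCylinder r ((1:ℝ), (0:E3)) := by
    refine ⟨⟨?_, ht₀1, mem_univ _⟩, ?_⟩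
    · show S.toReal + 1 < ‖vel t₀ x₀‖
      rw [hval]; exact hn2
    · rw [mem_parabolicCylinder]
      refine ⟨⟨by rw [ht₀]; linarith, ht₀1⟩, ?_⟩
      rw [hx₀, dist_zero_right, norm_single_zero, abs_of_pos (by positivity)]
      linarith
  have hpos : 0 < volume (U ∩ parabolicCylinder r ((1:ℝ), (0:E3))) :=
    (hUo.inter (isOpen_parabolicCylinder r _)).measure_pos volume ⟨_, hmem⟩
  -- but the a.e. bound says this set is null
  have hnull : volume.restrict (parabolicCylinder r ((1:ℝ), (0:E3))) U = 0 := by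
    refine measure_eq_zero_iff_ae_notMem.2 ?_
    filter_upwards [hae] with p hp hpU
    have h1 : ‖Function.uncurry vel p‖ₑ ≤ S := hp
    have h2 : S.toReal + 1 < ‖Function.uncurry vel p‖ := hpU.1
    have h3 : (‖Function.uncurry vel p‖ₑ).toReal ≤ S.toReal := ENNReal.toReal_mono hne h1
    rw [toReal_enorm] at h3
    linarith
  rw [Measure.restrict_apply hUo.measurableSet] at hnull
  exact hpos.ne' hnull


/-! ## Part E: the load-bearing statement and its refutation -/

open Summit.NavierStokesRegularity.NavierStokesRegularity.Theses.AdaptedFrequency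

/-- `AdaptedFrequencyConverges` with the FAR-FIELD hypotheses dropped: no Leray–Hopf (finite
energy) class, no rapid decay of the datum, and the sup-norm Type-I bound `IsTypeIBlowup u T`
weakened to the parabolic-local Type-I bound at the singular point
(`‖x − x₀‖² ≤ T − t → ‖u t x‖ ≤ C/√(T − t)`, eventually as `t ↑ T`).  Everything local is kept
verbatim: exact unforced classical NS on `[0,T)`, backward singularity at `(T, x₀)`, the five
adapted-kernel clauses, two-sided Gaussian comparability, and the conclusion. [folklore] -/
def AdaptedFrequencyConvergesWithoutDecay : Prop :=
  ∀ (ν T : ℝ), 0 < ν → 0 < T → ∀ (u : ℝ → EuclideanSpace ℝ (Fin 3) → EuclideanSpace ℝ (Fin 3)) (p : ℝ → EuclideanSpace ℝ (Fin 3) → ℝ), Literature.Analysis.FluidPDE.IsClassicalNSSolutionOn (Set.Ico 0 T) ν 0 u p → ∀ (x₀ : EuclideanSpace ℝ (Fin 3)) (t₀ : ℝ) (G : ℝ → EuclideanSpace ℝ (Fin 3) → ℝ), t₀ ∈ Set.Ico 0 T → (∃ C : ℝ, ∀ᶠ t in 𝓝[<] T, ∀ x, ‖x - x₀‖ ^ 2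 ≤ T - t → ‖u t x‖ ≤ C / Real.sqrt (T - t)) → (∀ r : ℝ, 0 < r → MeasureTheory.eLpNorm (Function.uncurry u) ⊤ (MeasureTheory.Measure.restrict MeasureTheory.volume (Literature.Analysis.FluidPDE.parabolicCylinder r (T, x₀))) = ⊤) → ContDiffOn ℝ 2 (Function.uncurry G) (Set.Ico t₀ T ×ˢ Set.univ) ∧ (∀ t ∈ Set.Ico t₀ T, ∀ x, 0 < G t x) ∧ (∀ t ∈ Set.Ico t₀ T, ∀ x, Literature.Analysis.FluidPDE.timeDerivWithin (Set.Ico t₀ T) G t x + fderiv ℝ (G t) x (u t x) + ν * Laplacian.laplacian (G t) x = 0) ∧ (∀ t ∈ Set.Ico t₀ T, ∫ x, G t x = 1) ∧ (∀ φ : EuclideanSpace ℝ (Fin 3) → ℝ, Continuous φ → (∃ M : ℝ, ∀ x, |φ x| ≤ M) → Filter.Tendsto (fun t => ∫ x, φ x * G t x) (nhdsWithin T (Set.Iio T)) (nhds (φ x₀))) → (∃ c₁ c₂ C₁ C₂ : ℝ, 0 < c₁ ∧ 0 < c₂ ∧ 0 < C₁ ∧ 0 < C₂ ∧ ∀ t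 ∈ Set.Ico t₀ T, ∀ x, c₁ * (T - t) ^ (-(3:ℝ) / 2) * Real.exp (-(‖x - x₀‖ ^ 2) / (c₂ * (T - t))) ≤ G t x ∧ G t x ≤ C₁ * (T - t) ^ (-(3:ℝ) / 2) * Real.exp (-(‖x - x₀‖ ^ 2) / (C₂ * (T - t)))) → ∀ H Λ : ℝ → ℝ, H = (fun t => ∫ x, ‖Literature.Analysis.FluidPDE.curl (u t) x‖ ^ 2 * G t x) → Λ = (fun t => (T - t) * deriv H t / H t) → ∃ Λ₀ : ℝ, Filter.Tendsto Λ (nhdsWithin T (Set.Iio T)) (nhds Λ₀)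

/-- The weakened statement implies the crux: its hypotheses are a subset of the crux's (the local
Type-I bound follows from `IsTypeIBlowup`).  So `¬ AdaptedFrequencyConvergesWithoutDecay` below is
a genuine LOAD-BEARING lemma: every proof of the crux must use Leray–Hopf / decay / the sup-norm. [folklore] -/
theorem adaptedFrequencyConverges_of_withoutDecay (h : AdaptedFrequencyConvergesWithoutDecay) :
    AdaptedFrequencyConverges := by
  intro ν T hν hT u p hcl _hLH _hdec hTI x₀ t₀ G ht₀ hsing hK hcomp H Λ hH hΛ
  refine h ν T hν hT u p hcl x₀ t₀ G ht₀ ?_ hsing hK hcomp H Λ hH hΛ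
  obtain ⟨C, hC⟩ := hTI
  exact ⟨C, hC.mono fun t ht x _ => ht x⟩

/-- Contrapositive bookkeeping form (negative conclusion). [folklore] -/
theorem not_withoutDecay_of_not_adaptedFrequencyConverges (h : ¬ AdaptedFrequencyConverges) :
    ¬ AdaptedFrequencyConvergesWithoutDecay :=
  fun hW => h (adaptedFrequencyConverges_of_withoutDecay hW)

/-- the five adapted-kernel clauses for the kernel `G ν` of the linear flow on `[0, 1)` [folklore] -/
theorem kernel_clauses {ν : ℝ} (hν : 0 < ν) :
    ContDiffOn ℝ 2 (Function.uncurry (G ν)) (Set.Ico 0 1 ×ˢ Set.univ) ∧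
    (∀ t ∈ Set.Ico (0:ℝ) 1, ∀ x, 0 < G ν t x) ∧
    (∀ t ∈ Set.Ico (0:ℝ) 1, ∀ x, timeDerivWithin (Set.Ico 0 1) (G ν) t x +
      fderiv ℝ (G ν t) x (vel t x) + ν * Laplacian.laplacian (G ν t) x = 0) ∧
    (∀ t ∈ Set.Ico (0:ℝ) 1, ∫ x, G ν t x = 1) ∧
    (∀ φ : E3 → ℝ, Continuous φ → (∃ M : ℝ, ∀ x, |φ x| ≤ M) →
      Tendsto (fun t => ∫ x, φ x * G ν t x) (𝓝[<] 1) (𝓝 (φ 0))) :=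
  ⟨contDiffOn_uncurry_G_Ico ν hν, fun _ ht x => G_pos hν ht.2 x, fun _ ht x => adjoint_eq_G hν ht x,
    fun _ ht => integral_G hν ht.2, fun _ hφ hM => tendsto_integral_mul_G hν hφ hM⟩

/-- **`AdaptedFrequencyConverges` is false without its far-field hypotheses** (any proof must use
finite energy / decay / the sup-norm Type-I bound): witnessed at `ν = T = 1`, `x₀ = 0`, `t₀ = 0`
by the exact linear Navier–Stokes flow `vel`/`pres`, its exact anisotropic Gaussian adapted kernel
`G 1`, adapted enstrophy `ω(t)²` and adapted frequency `2 cos log(1−t)`, which does not converge. [folklore] -/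
theorem adaptedFrequencyConverges_false_without_decay : ¬ AdaptedFrequencyConvergesWithoutDecay := by
  intro h
  have h1 : (0:ℝ) < 1 := one_pos
  obtain ⟨Λ₀, hlim⟩ := h 1 1 h1 h1 vel pres (isClassicalNSSolutionOn_vel 1) 0 0 (G 1)
    ⟨le_rfl, h1⟩ local_typeI_vel singular_vel (kernel_clauses h1) (G_comparable h1) _ _ rfl rfl
  exact not_tendsto_frequency h1 rfl rfl ⟨Λ₀, hlim⟩

/-! ## Part F: TIGHTNESS — the ε-family (small oscillation, small local Type-I constant, near-Gaussian kernel) -/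

/-! ### ε-clocks -/

/-- `ω_ε(t) = exp(−ε sin log(1−t))`. [folklore] -/
def ampE (ε t : ℝ) : ℝ := Real.exp (-(ε * Real.sin (Real.log (1 - t))))

/-- `d_ε = ε d`. [folklore] -/
def strE (ε t : ℝ) : ℝ := ε * str t

/-- `ω_ε > 0`. [folklore] -/
theorem ampE_pos (ε t : ℝ) : 0 < ampE ε t := Real.exp_pos _

/-- `ω_ε ≤ e^{|ε|}`. [folklore] -/
theorem ampE_le (ε t : ℝ) : ampE ε t ≤ Real.exp |ε| := by
  unfold ampE; gcongr
  have h1 := Real.neg_one_le_sin (Real.log (1 - t)); have h2 := Real.sin_le_one (Real.log (1 - t))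
  have : |ε * Real.sin (Real.log (1 - t))| ≤ |ε| := by
    rw [abs_mul]; exact mul_le_of_le_one_right (abs_nonneg _) (abs_le.2 ⟨h1, h2⟩)
  linarith [neg_abs_le (ε * Real.sin (Real.log (1 - t))), this]

/-- `e^{−|ε|} ≤ ω_ε`. [folklore] -/
theorem le_ampE (ε t : ℝ) : Real.exp (-|ε|) ≤ ampE ε t := by
  unfold ampE; gcongr
  have h1 := Real.neg_one_le_sin (Real.log (1 - t)); have h2 := Real.sin_le_one (Real.log (1 - t))
  have : |ε * Real.sin (Real.log (1 - t))| ≤ |ε| := by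
    rw [abs_mul]; exact mul_le_of_le_one_right (abs_nonneg _) (abs_le.2 ⟨h1, h2⟩)
  linarith [le_abs_self (ε * Real.sin (Real.log (1 - t))), this]

/-- the ε-stretching law `ω_ε′ = d_ε ω_ε`. [folklore] -/
theorem hasDerivAt_ampE (ε : ℝ) {t : ℝ} (ht : t < 1) : HasDerivAt (ampE ε) (ampE ε t * strE ε t) t := by
  have h := (((hasDerivAt_log_one_sub ht).sin.const_mul ε).neg).exp
  refine h.congr_deriv ?_
  simp only [Pi.neg_apply, ampE, strE, str, div_eq_mul_inv]
  ring

/-- `ω_ε` is smooth below `1`. [folklore] -/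
theorem contDiffAt_ampE (ε : ℝ) {t : ℝ} (ht : t < 1) {n : WithTop ℕ∞} : ContDiffAt ℝ n (ampE ε) t := by
  have h1 : ContDiffAt ℝ n (fun s : ℝ => 1 - s) t := contDiffAt_const.sub contDiffAt_id
  exact ((contDiffAt_const.mul (h1.log (sub_pos.2 ht).ne').sin).neg).exp

/-- `d_ε` is smooth below `1`. [folklore] -/
theorem contDiffAt_strE (ε : ℝ) {t : ℝ} (ht : t < 1) {n : WithTop ℕ∞} : ContDiffAt ℝ n (strE ε) t :=
  contDiffAt_const.mul (contDiffAt_str ht)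

/-- `d_ε′ = ε d′`. [folklore] -/
theorem hasDerivAt_strE (ε : ℝ) {t : ℝ} (ht : t < 1) : HasDerivAt (strE ε) (ε * strDeriv t) t :=
  (hasDerivAt_str ht).const_mul ε

/-- `ω_ε` is continuous below `1`. [folklore] -/
theorem continuousAt_ampE (ε : ℝ) {t : ℝ} (ht : t < 1) : ContinuousAt (ampE ε) t :=
  (contDiffAt_ampE ε ht (n := 0)).continuousAt

/-- `ω_ε` is measurable. [folklore] -/
theorem measurable_ampE (ε : ℝ) : Measurable (ampE ε) := by unfold ampE; fun_prop

/-! ### the ε-flow: exact Navier–Stokes -/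

/-- `u_ε = d_ε D₀x + ½ω_ε e₀×x`. [folklore] -/
def velE (ε t : ℝ) (x : E3) : E3 := linVel (strE ε t) (ampE ε t) x

/-- pressure coefficients and pressure of the ε-flow. [folklore] -/
def P1E (ε t : ℝ) : ℝ := ε * strDeriv t + strE ε t ^ 2
/-- transverse pressure coefficient of the ε-flow. [folklore] -/
def P2E (ε t : ℝ) : ℝ := -(ε * strDeriv t) / 2 + (strE ε t) ^ 2 / 4 - (ampE ε t) ^ 2 / 4
/-- pressure of the ε-flow. [folklore] -/
def presE (ε t : ℝ) (x : E3) : ℝ := -(1/2) * (P1E ε t * (x 0) ^ 2 + P2E ε t * ((x 1) ^ 2 + (x 2) ^ 2))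
/-- its gradient. [folklore] -/
def presGradE (ε t : ℝ) (x : E3) : E3 := !₂[-(P1E ε t * x 0), -(P2E ε t * x 1), -(P2E ε t * x 2)]

/-- `∇p_ε = presGradE`. [folklore] -/
theorem hasGradientAt_presE (ε t : ℝ) (x : E3) : HasGradientAt (presE ε t) (presGradE ε t x) x := by
  rw [hasGradientAt_iff_hasFDerivAt]
  have h0 := ((crd 0).hasFDerivAt (x := x)).pow 2
  have h1 := ((crd 1).hasFDerivAt (x := x)).pow 2
  have h2 := ((crd 2).hasFDerivAt (x := x)).pow 2
  have h := ((h0.const_mul (P1E ε t)).add ((h1.add h2).const_mul (P2E ε t))).const_mul (-(1/2) : ℝ)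
  have h' : HasFDerivAt (presE ε t) _ x :=
    h.congr_of_eventuallyEq (Eventually.of_forall fun y => by simp [presE])
  refine h'.congr_fderiv ?_
  ext v
  simp [presGradE, PiLp.inner_apply, Fin.sum_univ_three]
  ring

/-- time derivative of `u_ε` at fixed `x`. [folklore] -/
theorem hasDerivAt_velE (ε : ℝ) {t : ℝ} (ht : t < 1) (x : E3) :
    HasDerivAt (fun s => velE ε s x) ((ε * strDeriv t) • D0 x + (ampE ε t * strE ε t / 2) • J x) t :=
  ((hasDerivAt_strE ε ht).smul_const (D0 x)).add (((hasDerivAt_ampE ε ht).div_const 2).smul_const (J x))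

/-- **momentum equation for the ε-flow** (any `ν`). [folklore] -/
theorem momentum_velE (ε ν : ℝ) {t : ℝ} (ht : t ∈ Ico (0:ℝ) 1) (x : E3) :
    timeDerivWithin (Ico 0 1) (velE ε) t x + convect (velE ε t) (velE ε t) x =
      ν • (Δ (velE ε t)) x - gradient (presE ε t) x + (0 : ℝ → E3 → E3) t x := by
  rw [timeDerivWithin_apply, ((hasDerivAt_velE ε ht.2 x).hasDerivWithinAt).derivWithin
    (uniqueDiffOn_Ico 0 1 t ht), show velE ε t = linVel (strE ε t) (ampE ε t) from rfl, convect_linVel,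
    laplacian_linVel, (hasGradientAt_presE ε t x).gradient]
  ext i
  fin_cases i <;> simp [presGradE, P1E, P2E] <;> ring

/-- joint smoothness of `u_ε`. [folklore] -/
theorem contDiffAt_uncurry_velE (ε : ℝ) {t : ℝ} (ht : t < 1) (x : E3) {n : WithTop ℕ∞} :
    ContDiffAt ℝ n (Function.uncurry (velE ε)) (t, x) := by
  have hs : ContDiffAt ℝ n (fun p : ℝ × E3 => strE ε p.1) (t, x) :=
    ContDiffAt.comp (f := Prod.fst) (t, x) (contDiffAt_strE ε ht) contDiffAt_fst
  have ha : ContDiffAt ℝ n (fun p : ℝ × E3 => ampE ε p.1 / 2) (t, x) :=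
    (ContDiffAt.comp (f := Prod.fst) (t, x) (contDiffAt_ampE ε ht) contDiffAt_fst).div_const 2
  have hD : ContDiffAt ℝ n (fun p : ℝ × E3 => D0 p.2) (t, x) :=
    D0.contDiff.contDiffAt.comp (t, x) contDiffAt_snd
  have hJ : ContDiffAt ℝ n (fun p : ℝ × E3 => J p.2) (t, x) :=
    J.contDiff.contDiffAt.comp (t, x) contDiffAt_snd
  exact (hs.smul hD).add (ha.smul hJ)

/-- joint smoothness of `p_ε`. [folklore] -/
theorem contDiffAt_uncurry_presE (ε : ℝ) {t : ℝ} (ht : t < 1) (x : E3) {n : WithTop ℕ∞} :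
    ContDiffAt ℝ n (Function.uncurry (presE ε)) (t, x) := by
  have hc : ∀ i : Fin 3, ContDiffAt ℝ n (fun p : ℝ × E3 => (p.2 i) ^ 2) (t, x) := fun i =>
    (((crd i).contDiff.contDiffAt.comp (t, x) contDiffAt_snd)).pow 2
  have h1 : ContDiffAt ℝ n (fun p : ℝ × E3 => P1E ε p.1) (t, x) := by
    have : ContDiffAt ℝ n (P1E ε) t :=
      (contDiffAt_const.mul (contDiffAt_strDeriv ht)).add ((contDiffAt_strE ε ht).pow 2)
    exact ContDiffAt.comp (f := Prod.fst) (t, x) this contDiffAt_fst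
  have h2 : ContDiffAt ℝ n (fun p : ℝ × E3 => P2E ε p.1) (t, x) := by
    have : ContDiffAt ℝ n (P2E ε) t :=
      (((contDiffAt_const.mul (contDiffAt_strDeriv ht)).neg.div_const 2).add
        (((contDiffAt_strE ε ht).pow 2).div_const 4)).sub (((contDiffAt_ampE ε ht).pow 2).div_const 4)
    exact ContDiffAt.comp (f := Prod.fst) (t, x) this contDiffAt_fst
  exact contDiffAt_const.mul ((h1.mul (hc 0)).add (h2.mul ((hc 1).add (hc 2))))

/-- **the ε-flow is an exact classical Navier–Stokes solution on `[0,1) × ℝ³`** (any `ν`). [folklore] -/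
theorem isClassicalNSSolutionOn_velE (ε ν : ℝ) : IsClassicalNSSolutionOn (Ico 0 1) ν 0 (velE ε) (presE ε) where
  smooth_velocity p hp := (contDiffAt_uncurry_velE ε (mem_prod.1 hp).1.2 p.2).contDiffWithinAt
  smooth_pressure p hp := (contDiffAt_uncurry_presE ε (mem_prod.1 hp).1.2 p.2).contDiffWithinAt
  momentum _ ht x := momentum_velE ε ν ht x
  divFree _ _ x := divergence_linVel _ _ x

/-! ### the ε-kernel -/

/-- `I₁^ε(t) = ∫ₜ¹ ω_ε⁻²`. [folklore] -/
def I1E (ε t : ℝ) : ℝ := ∫ s in t..1, (ampE ε s ^ 2)⁻¹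
/-- `I₂^ε(t) = ∫ₜ¹ ω_ε`. [folklore] -/
def I2E (ε t : ℝ) : ℝ := ∫ s in t..1, ampE ε s

/-- `ω_ε⁻² ≤ e^{2|ε|}`. [folklore] -/
theorem ampE_sq_inv_le (ε t : ℝ) : (ampE ε t ^ 2)⁻¹ ≤ Real.exp (2 * |ε|) := by
  have h0 : 0 < Real.exp (-|ε|) := Real.exp_pos _
  calc (ampE ε t ^ 2)⁻¹ ≤ (Real.exp (-|ε|) ^ 2)⁻¹ :=
        inv_anti₀ (pow_pos h0 2) (pow_le_pow_left₀ h0.le (le_ampE ε t) 2)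
    _ = Real.exp (2 * |ε|) := by rw [← Real.exp_nat_mul, ← Real.exp_neg]; norm_num

/-- `e^{−2|ε|} ≤ ω_ε⁻²`. [folklore] -/
theorem le_ampE_sq_inv (ε t : ℝ) : Real.exp (-(2 * |ε|)) ≤ (ampE ε t ^ 2)⁻¹ := by
  calc Real.exp (-(2 * |ε|)) = (Real.exp |ε| ^ 2)⁻¹ := by
        rw [← Real.exp_nat_mul, ← Real.exp_neg]; norm_num
    _ ≤ (ampE ε t ^ 2)⁻¹ :=
        inv_anti₀ (pow_pos (ampE_pos ε t) 2) (pow_le_pow_left₀ (ampE_pos ε t).le (ampE_le ε t) 2)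

/-- interval integrability of `ω_ε`. [folklore] -/
theorem intervalIntegrable_ampE (ε a b : ℝ) : IntervalIntegrable (ampE ε) volume a b := by
  refine (intervalIntegrable_const (c := Real.exp |ε|)).mono_fun' (measurable_ampE ε).aestronglyMeasurable ?_
  exact Eventually.of_forall fun s => by
    show ‖ampE ε s‖ ≤ Real.exp |ε|
    rw [Real.norm_of_nonneg (ampE_pos ε s).le]; exact ampE_le ε s

/-- interval integrability of `ω_ε⁻²`. [folklore] -/
theorem intervalIntegrable_ampE_sq_inv (ε a b : ℝ) :
    IntervalIntegrable (fun s => (ampE ε s ^ 2)⁻¹) volume a b := by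
  refine (intervalIntegrable_const (c := Real.exp (2 * |ε|))).mono_fun'
    ((measurable_ampE ε).pow_const 2).inv.aestronglyMeasurable ?_
  exact Eventually.of_forall fun s => by
    show ‖(ampE ε s ^ 2)⁻¹‖ ≤ Real.exp (2 * |ε|)
    rw [Real.norm_of_nonneg (inv_nonneg.2 (sq_nonneg _))]; exact ampE_sq_inv_le ε s

/-- `(I₂^ε)′ = −ω_ε`. [folklore] -/
theorem hasDerivAt_I2E (ε : ℝ) {t : ℝ} (ht : t < 1) : HasDerivAt (I2E ε) (-ampE ε t) t := by
  unfold I2E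
  have hc : ContinuousOn (ampE ε) (Iio 1) := fun s hs => (continuousAt_ampE ε hs).continuousWithinAt
  exact integral_hasDerivAt_left (intervalIntegrable_ampE ε t 1)
    (hc.stronglyMeasurableAtFilter isOpen_Iio t ht) (continuousAt_ampE ε ht)

/-- `(I₁^ε)′ = −ω_ε⁻²`. [folklore] -/
theorem hasDerivAt_I1E (ε : ℝ) {t : ℝ} (ht : t < 1) : HasDerivAt (I1E ε) (-(ampE ε t ^ 2)⁻¹) t := by
  unfold I1E
  have hc : ContinuousOn (fun s => (ampE ε s ^ 2)⁻¹) (Iio 1) := fun s hs =>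
    (((continuousAt_ampE ε hs).pow 2).inv₀ (pow_pos (ampE_pos ε s) 2).ne').continuousWithinAt
  exact integral_hasDerivAt_left (intervalIntegrable_ampE_sq_inv ε t 1)
    (hc.stronglyMeasurableAtFilter isOpen_Iio t ht)
    (((continuousAt_ampE ε ht).pow 2).inv₀ (pow_pos (ampE_pos ε t) 2).ne')

/-- bounds for `I₂^ε`. [folklore] -/
theorem I2E_bounds (ε : ℝ) {t : ℝ} (ht : t ≤ 1) :
    Real.exp (-|ε|) * (1 - t) ≤ I2E ε t ∧ I2E ε t ≤ Real.exp |ε| * (1 - t) := by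
  constructor
  · have := intervalIntegral.integral_mono_on ht (intervalIntegrable_const (c := Real.exp (-|ε|)))
      (intervalIntegrable_ampE ε t 1) (fun s _ => le_ampE ε s)
    simpa [I2E, mul_comm] using this
  · have := intervalIntegral.integral_mono_on ht (intervalIntegrable_ampE ε t 1)
      (intervalIntegrable_const (c := Real.exp |ε|)) (fun s _ => ampE_le ε s)
    simpa [I2E, mul_comm] using this

/-- bounds for `I₁^ε`. [folklore] -/
theorem I1E_bounds (ε : ℝ) {t : ℝ} (ht : t ≤ 1) :
    Real.exp (-(2 * |ε|)) * (1 - t) ≤ I1E ε t ∧ I1E ε t ≤ Real.exp (2 * |ε|) * (1 - t) := by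
  constructor
  · have := intervalIntegral.integral_mono_on ht (intervalIntegrable_const (c := Real.exp (-(2 * |ε|))))
      (intervalIntegrable_ampE_sq_inv ε t 1) (fun s _ => le_ampE_sq_inv ε s)
    simpa [I1E, mul_comm] using this
  · have := intervalIntegral.integral_mono_on ht (intervalIntegrable_ampE_sq_inv ε t 1)
      (intervalIntegrable_const (c := Real.exp (2 * |ε|))) (fun s _ => ampE_sq_inv_le ε s)
    simpa [I1E, mul_comm] using this

/-- `I₂^ε` is smooth on `(−∞,1)`. [folklore] -/
theorem contDiffOn_I2E (ε : ℝ) : ContDiffOn ℝ (⊤ : ℕ∞) (I2E ε) (Iio 1) := by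
  refine (contDiffOn_infty_iff_deriv_of_isOpen isOpen_Iio).2 ⟨?_, ?_⟩
  · exact fun t ht => (hasDerivAt_I2E ε ht).differentiableAt.differentiableWithinAt
  · have : ContDiffOn ℝ (⊤ : ℕ∞) (fun t => -ampE ε t) (Iio 1) := fun t ht =>
      (contDiffAt_ampE ε ht).neg.contDiffWithinAt
    exact this.congr fun t ht => (hasDerivAt_I2E ε ht).deriv

/-- `I₁^ε` is smooth on `(−∞,1)`. [folklore] -/
theorem contDiffOn_I1E (ε : ℝ) : ContDiffOn ℝ (⊤ : ℕ∞) (I1E ε) (Iio 1) := by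
  refine (contDiffOn_infty_iff_deriv_of_isOpen isOpen_Iio).2 ⟨?_, ?_⟩
  · exact fun t ht => (hasDerivAt_I1E ε ht).differentiableAt.differentiableWithinAt
  · have : ContDiffOn ℝ (⊤ : ℕ∞) (fun t => -(ampE ε t ^ 2)⁻¹) (Iio 1) := fun t ht =>
      (((contDiffAt_ampE ε ht).pow 2).inv (pow_pos (ampE_pos ε t) 2).ne').neg.contDiffWithinAt
    exact this.congr fun t ht => (hasDerivAt_I1E ε ht).deriv

/-- axial variance of the ε-kernel. [folklore] -/
def varAE (ν ε t : ℝ) : ℝ := 2 * ν * ampE ε t ^ 2 * I1E ε t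
/-- transverse variance of the ε-kernel. [folklore] -/
def varBE (ν ε t : ℝ) : ℝ := 2 * ν * (ampE ε t)⁻¹ * I2E ε t

/-- `α_ε′ = 2d_ε α_ε − 2ν`. [folklore] -/
theorem hasDerivAt_varAE (ν ε : ℝ) {t : ℝ} (ht : t < 1) :
    HasDerivAt (varAE ν ε) (2 * strE ε t * varAE ν ε t - 2 * ν) t := by
  have h := (((hasDerivAt_ampE ε ht).pow 2).const_mul (2 * ν)).mul (hasDerivAt_I1E ε ht)
  refine h.congr_deriv ?_
  have ha : ampE ε t ≠ 0 := (ampE_pos ε t).ne'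
  simp only [varAE, Pi.pow_apply]
  field_simp
  ring

/-- `β_ε′ = −d_ε β_ε − 2ν`. [folklore] -/
theorem hasDerivAt_varBE (ν ε : ℝ) {t : ℝ} (ht : t < 1) :
    HasDerivAt (varBE ν ε) (-(strE ε t) * varBE ν ε t - 2 * ν) t := by
  have ha : ampE ε t ≠ 0 := (ampE_pos ε t).ne'
  have h := (((hasDerivAt_ampE ε ht).inv ha).const_mul (2 * ν)).mul (hasDerivAt_I2E ε ht)
  refine h.congr_deriv ?_
  simp only [varBE, Pi.inv_apply]
  field_simp
  ring

/-- `α_ε` is comparable to `2ν(1−t)` within `e^{±4|ε|}`. [folklore] -/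
theorem varAE_bounds {ν : ℝ} (hν : 0 ≤ ν) (ε : ℝ) {t : ℝ} (ht : t ≤ 1) :
    2 * ν * Real.exp (-(4 * |ε|)) * (1 - t) ≤ varAE ν ε t ∧
      varAE ν ε t ≤ 2 * ν * Real.exp (4 * |ε|) * (1 - t) := by
  obtain ⟨h1, h2⟩ := I1E_bounds ε ht
  have ha1 := ampE_le ε t
  have ha2 := le_ampE ε t
  have ha0 : 0 ≤ ampE ε t := (ampE_pos ε t).le
  have hI : 0 ≤ I1E ε t := h1.trans' (mul_nonneg (Real.exp_pos _).le (sub_nonneg.2 ht))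
  have he : 0 ≤ Real.exp (-|ε|) := (Real.exp_pos _).le
  have e1 : Real.exp (-(4 * |ε|)) = Real.exp (-|ε|) ^ 2 * Real.exp (-(2 * |ε|)) := by
    rw [← Real.exp_nat_mul, ← Real.exp_add]; ring_nf
  have e2 : Real.exp (4 * |ε|) = Real.exp |ε| ^ 2 * Real.exp (2 * |ε|) := by
    rw [← Real.exp_nat_mul, ← Real.exp_add]; ring_nf
  constructor
  · rw [e1, varAE]
    calc 2 * ν * (Real.exp (-|ε|) ^ 2 * Real.exp (-(2 * |ε|))) * (1 - t)
        = 2 * ν * Real.exp (-|ε|) ^ 2 * (Real.exp (-(2 * |ε|)) * (1 - t)) := by ring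
      _ ≤ 2 * ν * ampE ε t ^ 2 * I1E ε t := by gcongr
  · rw [e2, varAE]
    calc 2 * ν * ampE ε t ^ 2 * I1E ε t ≤ 2 * ν * Real.exp |ε| ^ 2 * (Real.exp (2 * |ε|) * (1 - t)) := by
          gcongr
      _ = 2 * ν * (Real.exp |ε| ^ 2 * Real.exp (2 * |ε|)) * (1 - t) := by ring

/-- `β_ε` is comparable to `2ν(1−t)` within `e^{±2|ε|}`. [folklore] -/
theorem varBE_bounds {ν : ℝ} (hν : 0 ≤ ν) (ε : ℝ) {t : ℝ} (ht : t ≤ 1) :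
    2 * ν * Real.exp (-(2 * |ε|)) * (1 - t) ≤ varBE ν ε t ∧
      varBE ν ε t ≤ 2 * ν * Real.exp (2 * |ε|) * (1 - t) := by
  obtain ⟨h1, h2⟩ := I2E_bounds ε ht
  have ha1 : (ampE ε t)⁻¹ ≤ Real.exp |ε| := by
    calc (ampE ε t)⁻¹ ≤ (Real.exp (-|ε|))⁻¹ := inv_anti₀ (Real.exp_pos _) (le_ampE ε t)
      _ = Real.exp |ε| := by rw [← Real.exp_neg, neg_neg]
  have ha2 : Real.exp (-|ε|) ≤ (ampE ε t)⁻¹ := by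
    calc Real.exp (-|ε|) = (Real.exp |ε|)⁻¹ := by rw [← Real.exp_neg]
      _ ≤ (ampE ε t)⁻¹ := inv_anti₀ (ampE_pos ε t) (ampE_le ε t)
  have ha0 : 0 ≤ (ampE ε t)⁻¹ := inv_nonneg.2 (ampE_pos ε t).le
  have hI : 0 ≤ I2E ε t := h1.trans' (mul_nonneg (Real.exp_pos _).le (sub_nonneg.2 ht))
  have he : 0 ≤ Real.exp (-|ε|) := (Real.exp_pos _).le
  have e1 : Real.exp (-(2 * |ε|)) = Real.exp (-|ε|) * Real.exp (-|ε|) := by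
    rw [← Real.exp_add]; ring_nf
  have e2 : Real.exp (2 * |ε|) = Real.exp |ε| * Real.exp |ε| := by
    rw [← Real.exp_add]; ring_nf
  constructor
  · rw [e1, varBE]
    calc 2 * ν * (Real.exp (-|ε|) * Real.exp (-|ε|)) * (1 - t)
        = 2 * ν * Real.exp (-|ε|) * (Real.exp (-|ε|) * (1 - t)) := by ring
      _ ≤ 2 * ν * (ampE ε t)⁻¹ * I2E ε t := by gcongr
  · rw [e2, varBE]
    calc 2 * ν * (ampE ε t)⁻¹ * I2E ε t ≤ 2 * ν * Real.exp |ε| * (Real.exp |ε| * (1 - t)) := by gcongr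
      _ = 2 * ν * (Real.exp |ε| * Real.exp |ε|) * (1 - t) := by ring

/-- `α_ε > 0` below `1`. [folklore] -/
theorem varAE_pos {ν : ℝ} (hν : 0 < ν) (ε : ℝ) {t : ℝ} (ht : t < 1) : 0 < varAE ν ε t :=
  lt_of_lt_of_le (by have := Real.exp_pos (-(4 * |ε|)); have := sub_pos.2 ht; positivity)
    (varAE_bounds hν.le ε ht.le).1

/-- `β_ε > 0` below `1`. [folklore] -/
theorem varBE_pos {ν : ℝ} (hν : 0 < ν) (ε : ℝ) {t : ℝ} (ht : t < 1) : 0 < varBE ν ε t :=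
  lt_of_lt_of_le (by have := Real.exp_pos (-(2 * |ε|)); have := sub_pos.2 ht; positivity)
    (varBE_bounds hν.le ε ht.le).1

/-- `α_ε` is smooth on `(−∞,1)`. [folklore] -/
theorem contDiffOn_varAE (ν ε : ℝ) : ContDiffOn ℝ (⊤ : ℕ∞) (varAE ν ε) (Iio 1) := by
  have h1 : ContDiffOn ℝ (⊤ : ℕ∞) (fun t => 2 * ν * ampE ε t ^ 2) (Iio 1) := fun t ht =>
    (contDiffAt_const.mul ((contDiffAt_ampE ε ht).pow 2)).contDiffWithinAt
  exact h1.mul (contDiffOn_I1E ε)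

/-- `β_ε` is smooth on `(−∞,1)`. [folklore] -/
theorem contDiffOn_varBE (ν ε : ℝ) : ContDiffOn ℝ (⊤ : ℕ∞) (varBE ν ε) (Iio 1) := by
  have h1 : ContDiffOn ℝ (⊤ : ℕ∞) (fun t => 2 * ν * (ampE ε t)⁻¹) (Iio 1) := fun t ht =>
    (contDiffAt_const.mul ((contDiffAt_ampE ε ht).inv (ampE_pos ε t).ne')).contDiffWithinAt
  exact h1.mul (contDiffOn_I2E ε)

/-- **the ε-kernel** `G_ε(t) = N(0, diag(α_ε, β_ε, β_ε))`. [folklore] -/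
def GE (ν ε t : ℝ) (x : E3) : ℝ := gK (varAE ν ε t) (varBE ν ε t) x

/-- `G_ε > 0`. [folklore] -/
theorem GE_pos {ν : ℝ} (hν : 0 < ν) (ε : ℝ) {t : ℝ} (ht : t < 1) (x : E3) : 0 < GE ν ε t x :=
  gK_pos (varAE_pos hν ε ht) (varBE_pos hν ε ht) x

/-- unit mass of `G_ε`. [folklore] -/
theorem integral_GE {ν : ℝ} (hν : 0 < ν) (ε : ℝ) {t : ℝ} (ht : t < 1) : ∫ x, GE ν ε t x = 1 :=
  integral_gK (varAE_pos hν ε ht) (varBE_pos hν ε ht)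

/-- **adjoint equation for the ε-kernel**. [folklore] -/
theorem adjoint_eq_GE {ν : ℝ} (hν : 0 < ν) (ε : ℝ) {t : ℝ} (ht : t ∈ Ico (0:ℝ) 1) (x : E3) :
    timeDerivWithin (Ico 0 1) (GE ν ε) t x + fderiv ℝ (GE ν ε t) x (velE ε t x) +
      ν * (Δ (GE ν ε t)) x = 0 := by
  have hA := varAE_pos hν ε ht.2
  have hB := varBE_pos hν ε ht.2
  have hd : HasDerivAt (fun s => GE ν ε s x) _ t :=
    hasDerivAt_gK_comp (hasDerivAt_varAE ν ε ht.2) (hasDerivAt_varBE ν ε ht.2) hA hB x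
  rw [timeDerivWithin_apply, (hd.hasDerivWithinAt).derivWithin (uniqueDiffOn_Ico 0 1 t ht)]
  rw [show GE ν ε t = gK (varAE ν ε t) (varBE ν ε t) from rfl, fderiv_gK_apply, laplacian_gK]
  simp only [velE, linVel_apply0, linVel_apply1, linVel_apply2]
  field_simp
  ring

/-- joint smoothness of `G_ε` on `(−∞,1) × ℝ³`. [folklore] -/
theorem contDiffOn_uncurry_GE (ν : ℝ) (hν : 0 < ν) (ε : ℝ) {n : ℕ∞} :
    ContDiffOn ℝ (n : WithTop ℕ∞) (Function.uncurry (GE ν ε)) (Iio 1 ×ˢ univ) := by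
  have hmaps : MapsTo (Prod.fst : ℝ × E3 → ℝ) (Iio 1 ×ˢ univ) (Iio 1) := fun p hp =>
    (mem_prod.1 hp).1
  have hA : ContDiffOn ℝ n (fun p : ℝ × E3 => varAE ν ε p.1) (Iio 1 ×ˢ univ) :=
    ((contDiffOn_varAE ν ε).of_le (by exact_mod_cast le_top)).comp contDiffOn_fst hmaps
  have hB : ContDiffOn ℝ n (fun p : ℝ × E3 => varBE ν ε p.1) (Iio 1 ×ˢ univ) :=
    ((contDiffOn_varBE ν ε).of_le (by exact_mod_cast le_top)).comp contDiffOn_fst hmaps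
  have hc : ∀ i : Fin 3, ContDiffOn ℝ n (fun p : ℝ × E3 => (p.2 i) ^ 2) (Iio 1 ×ˢ univ) := fun i =>
    (((crd i).contDiff.comp contDiff_snd).pow 2).contDiffOn
  have hC : ContDiffOn ℝ n (fun p : ℝ × E3 => gC (varAE ν ε p.1) (varBE ν ε p.1)) (Iio 1 ×ˢ univ) := by
    unfold gC
    refine ContDiffOn.inv ?_ fun p hp => ?_
    · refine ((contDiffOn_const.mul hA).sqrt fun p hp => ?_).mul (contDiffOn_const.mul hB)
      have := varAE_pos hν ε (mem_prod.1 hp).1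
      positivity
    · have := varAE_pos hν ε (mem_prod.1 hp).1
      have := varBE_pos hν ε (mem_prod.1 hp).1
      positivity
  have hQ : ContDiffOn ℝ n (fun p : ℝ × E3 => gQ (varAE ν ε p.1) (varBE ν ε p.1) p.2) (Iio 1 ×ˢ univ) := by
    unfold gQ
    refine ((hc 0).div (contDiffOn_const.mul hA) fun p hp => ?_).add
      (((hc 1).add (hc 2)).div (contDiffOn_const.mul hB) fun p hp => ?_)
    · exact mul_ne_zero two_ne_zero (varAE_pos hν ε (mem_prod.1 hp).1).ne'
    · exact mul_ne_zero two_ne_zero (varBE_pos hν ε (mem_prod.1 hp).1).ne'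
  exact hC.mul hQ.neg.exp

/-- **comparability of `G_ε` with constants within `e^{±4|ε|}` of the heat kernel's `4ν`**. [folklore] -/
theorem GE_comparable {ν : ℝ} (hν : 0 < ν) (ε : ℝ) :
    ∀ t ∈ Ico (0:ℝ) 1, ∀ x : E3,
      (2 * π * (2 * ν * Real.exp (4 * |ε|))) ^ (-(3:ℝ) / 2) * (1 - t) ^ (-(3:ℝ) / 2) *
          Real.exp (-(‖x - 0‖ ^ 2) / ((4 * ν * Real.exp (-(4 * |ε|))) * (1 - t))) ≤ GE ν ε t x ∧
        GE ν ε t x ≤ (2 * π * (2 * ν * Real.exp (-(4 * |ε|)))) ^ (-(3:ℝ) / 2) * (1 - t) ^ (-(3:ℝ) / 2) *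
          Real.exp (-(‖x - 0‖ ^ 2) / ((4 * ν * Real.exp (4 * |ε|)) * (1 - t))) := by
  intro t ht x
  set m := 2 * ν * Real.exp (-(4 * |ε|)) with hm
  set M := 2 * ν * Real.exp (4 * |ε|) with hM
  have hm0 : 0 < m := by positivity
  have hM0 : 0 < M := by positivity
  have hτ : 0 < 1 - t := sub_pos.2 ht.2
  obtain ⟨hA1, hA2⟩ := varAE_bounds hν.le ε ht.2.le
  obtain ⟨hB1, hB2⟩ := varBE_bounds hν.le ε ht.2.le
  have e1 : Real.exp (-(4 * |ε|)) ≤ Real.exp (-(2 * |ε|)) := Real.exp_le_exp.2 (by linarith [abs_nonneg ε])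
  have e2 : Real.exp (2 * |ε|) ≤ Real.exp (4 * |ε|) := Real.exp_le_exp.2 (by linarith [abs_nonneg ε])
  have hmA : m * (1 - t) ≤ varAE ν ε t := by rw [hm]; linarith
  have hmB : m * (1 - t) ≤ varBE ν ε t := by
    rw [hm]; nlinarith [mul_le_mul_of_nonneg_right e1 (by positivity : (0:ℝ) ≤ 2 * ν * (1 - t))]
  have hAM : varAE ν ε t ≤ M * (1 - t) := by rw [hM]; linarith
  have hBM : varBE ν ε t ≤ M * (1 - t) := by
    rw [hM]; nlinarith [mul_le_mul_of_nonneg_right e2 (by positivity : (0:ℝ) ≤ 2 * ν * (1 - t))]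
  rw [sub_zero, show 4 * ν * Real.exp (-(4 * |ε|)) = 2 * m by rw [hm]; ring,
    show 4 * ν * Real.exp (4 * |ε|) = 2 * M by rw [hM]; ring]
  constructor
  · have h := le_gK (mul_pos hm0 hτ) hmA hmB hAM hBM x
    rw [gC_mul_self hM0 hτ] at h
    calc (2 * π * M) ^ (-(3:ℝ) / 2) * (1 - t) ^ (-(3:ℝ) / 2) * Real.exp (-‖x‖ ^ 2 / (2 * m * (1 - t)))
        = (2 * π * M) ^ (-(3:ℝ) / 2) * (1 - t) ^ (-(3:ℝ) / 2) *
            Real.exp (-‖x‖ ^ 2 / (2 * (m * (1 - t)))) := by rw [mul_assoc 2 m]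
      _ ≤ GE ν ε t x := h
  · have h := gK_le (mul_pos hm0 hτ) hmA hmB hAM hBM x
    rw [gC_mul_self hm0 hτ] at h
    calc GE ν ε t x ≤ (2 * π * m) ^ (-(3:ℝ) / 2) * (1 - t) ^ (-(3:ℝ) / 2) *
            Real.exp (-‖x‖ ^ 2 / (2 * (M * (1 - t)))) := h
      _ = (2 * π * m) ^ (-(3:ℝ) / 2) * (1 - t) ^ (-(3:ℝ) / 2) *
            Real.exp (-‖x‖ ^ 2 / (2 * M * (1 - t))) := by rw [mul_assoc 2 M]

/-- concentration of `G_ε` at the pole (via the general heat-kernel-bound lemma). [folklore] -/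
theorem tendsto_integral_mul_GE {ν : ℝ} (hν : 0 < ν) (ε : ℝ) {φ : E3 → ℝ} (hφ : Continuous φ)
    (hM : ∃ M : ℝ, ∀ x, |φ x| ≤ M) :
    Tendsto (fun t => ∫ x, φ x * GE ν ε t x) (𝓝[<] 1) (𝓝 (φ 0)) := by
  obtain ⟨M, hM⟩ := hM
  set C₁ := (2 * π * (2 * ν * Real.exp (-(4 * |ε|)))) ^ (-(3:ℝ) / 2) with hC₁
  set C₂ := 4 * ν * Real.exp (4 * |ε|) with hC₂
  have hC₂0 : 0 < C₂ := by positivity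
  refine tendsto_integral_mul_of_le_heatKernel (K := C₁ * (4 * π * (C₂ / 4)) ^ ((3:ℝ) / 2))
    (ν' := C₂ / 4) (by positivity) ?_ hφ hM
  filter_upwards [Ico_mem_nhdsLT zero_lt_one] with t ht
  refine ⟨fun x => (GE_pos hν ε ht.2 x).le, integral_GE hν ε ht.2, fun x => ?_⟩
  have hτ : 0 < 1 - t := sub_pos.2 ht.2
  rw [backwardHeatKernel_eq (by positivity) 0 ht.2 x]
  simp only [finrank_euclideanSpace_fin, Nat.cast_ofNat]
  rw [show 4 * (C₂ / 4) * (1 - t) = C₂ * (1 - t) by ring]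
  have hpow : (4 * π * (C₂ / 4)) ^ ((3:ℝ) / 2) * (4 * π * (C₂ / 4)) ^ (-(3:ℝ) / 2) = 1 := by
    rw [← Real.rpow_add (by positivity)]; norm_num
  calc GE ν ε t x ≤ C₁ * (1 - t) ^ (-(3:ℝ) / 2) * Real.exp (-(‖x - 0‖ ^ 2) / (C₂ * (1 - t))) :=
        ((GE_comparable hν ε) t ht x).2
    _ = C₁ * ((4 * π * (C₂ / 4)) ^ ((3:ℝ) / 2) * (4 * π * (C₂ / 4)) ^ (-(3:ℝ) / 2)) *
          (1 - t) ^ (-(3:ℝ) / 2) * Real.exp (-(‖x - 0‖ ^ 2) / (C₂ * (1 - t))) := by rw [hpow, mul_one]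
    _ = _ := by ring

/-! ### ε-frequency, local Type-I constant, singularity, and the small-constant refutation -/

/-- the adapted enstrophy of the ε-witness is `ω_ε²`. [folklore] -/
theorem integral_curl_velE_sq_mul_GE {ν : ℝ} (hν : 0 < ν) (ε : ℝ) {t : ℝ} (ht : t < 1) :
    ∫ x, ‖curl (velE ε t) x‖ ^ 2 * GE ν ε t x = ampE ε t ^ 2 := by
  rw [show velE ε t = linVel (strE ε t) (ampE ε t) from rfl]
  simp_rw [norm_curl_linVel_sq]
  rw [MeasureTheory.integral_const_mul, integral_GE hν ε ht, mul_one]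

/-- **the adapted frequency of the ε-witness is `2ε cos log(1−t)`**. [folklore] -/
theorem frequencyE_eq {ν : ℝ} (hν : 0 < ν) (ε : ℝ) {H Λ : ℝ → ℝ}
    (hH : H = fun t => ∫ x, ‖curl (velE ε t) x‖ ^ 2 * GE ν ε t x)
    (hΛ : Λ = fun t => (1 - t) * deriv H t / H t) {t : ℝ} (ht : t < 1) :
    Λ t = 2 * ε * Real.cos (Real.log (1 - t)) := by
  have hHeq : H =ᶠ[𝓝 t] fun s => ampE ε s ^ 2 := by
    filter_upwards [Iio_mem_nhds ht] with s hs
    rw [hH]; exact integral_curl_velE_sq_mul_GE hν ε hs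
  have hd : deriv H t = 2 * ampE ε t * (ampE ε t * strE ε t) := by
    rw [hHeq.deriv_eq]
    have h2 : HasDerivAt (fun s => ampE ε s ^ 2)
        (((2 : ℕ) : ℝ) * ampE ε t ^ (2 - 1) * (ampE ε t * strE ε t)) t := (hasDerivAt_ampE ε ht).pow 2
    rw [h2.deriv]; norm_num
  have hHt : H t = ampE ε t ^ 2 := hHeq.eq_of_nhds
  rw [hΛ]
  simp only [hd, hHt, strE, str]
  have ha : ampE ε t ≠ 0 := (ampE_pos ε t).ne'
  have h1 : (1 - t) ≠ 0 := (sub_pos.2 ht).ne'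
  field_simp

/-- **no limit for any `ε ≠ 0`**, although `|Λ| ≤ 2|ε|`. [folklore] -/
theorem not_tendsto_frequencyE {ν : ℝ} (hν : 0 < ν) {ε : ℝ} (hε : ε ≠ 0) {H Λ : ℝ → ℝ}
    (hH : H = fun t => ∫ x, ‖curl (velE ε t) x‖ ^ 2 * GE ν ε t x)
    (hΛ : Λ = fun t => (1 - t) * deriv H t / H t) :
    ¬ ∃ Λ₀ : ℝ, Tendsto Λ (𝓝[<] 1) (𝓝 Λ₀) := by
  rintro ⟨Λ₀, hlim⟩
  have hseq : ∀ c : ℝ, Tendsto (fun n : ℕ => 1 - Real.exp (-(n * (2 * π) + c))) atTop (𝓝[<] (1:ℝ)) := by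
    intro c
    refine tendsto_nhdsWithin_iff.2 ⟨?_, Eventually.of_forall fun n => ?_⟩
    · have h1 : Tendsto (fun n : ℕ => (n : ℝ) * (2 * π) + c) atTop atTop :=
        tendsto_atTop_add_const_right _ _ (tendsto_natCast_atTop_atTop.atTop_mul_const (by positivity))
      simpa using (Real.tendsto_exp_neg_atTop_nhds_zero.comp h1).const_sub (1:ℝ)
    · exact sub_lt_self _ (Real.exp_pos _)
  have hval : ∀ (c : ℝ) (n : ℕ), Λ (1 - Real.exp (-(n * (2 * π) + c))) =
      2 * ε * Real.cos (n * (2 * π) + c) := by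
    intro c n
    rw [frequencyE_eq hν ε hH hΛ (sub_lt_self _ (Real.exp_pos _)), sub_sub_cancel, Real.log_exp,
      Real.cos_neg]
  have hlim0 := hlim.comp (hseq 0)
  have hlimπ := hlim.comp (hseq π)
  have e0 : (Λ ∘ fun n : ℕ => 1 - Real.exp (-(n * (2 * π) + 0))) = fun _ => 2 * ε := by
    funext n; rw [Function.comp_apply, hval, add_zero, Real.cos_nat_mul_two_pi]; ring
  have eπ : (Λ ∘ fun n : ℕ => 1 - Real.exp (-(n * (2 * π) + π))) = fun _ => -(2 * ε) := by
    funext n; rw [Function.comp_apply, hval, Real.cos_nat_mul_two_pi_add_pi]; ring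
  rw [e0] at hlim0
  rw [eπ] at hlimπ
  have h2 : Λ₀ = 2 * ε := tendsto_nhds_unique hlim0 tendsto_const_nhds
  have hm2 : Λ₀ = -(2 * ε) := tendsto_nhds_unique hlimπ tendsto_const_nhds
  exact hε (by linarith)

/-- **the local Type-I constant of the ε-witness is `O(ε)` eventually**: on `‖x‖² ≤ 1 − t`,
`‖u_ε‖ ≤ (|ε|‖D₀‖ + e^{|ε|}‖J‖ (1−t)/2) / √(1−t) ≤ 2|ε|‖D₀‖ … ` — stated with the explicit constant
`|ε| ‖D₀‖ + δ` for any `δ > 0`, eventually as `t ↑ 1`. [folklore] -/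
theorem local_typeI_velE (ε : ℝ) {δ : ℝ} (hδ : 0 < δ) : ∀ᶠ t in 𝓝[<] (1:ℝ), ∀ x : E3, ‖x - 0‖ ^ 2 ≤ 1 - t →
    ‖velE ε t x‖ ≤ (|ε| * ‖D0‖ + δ) / Real.sqrt (1 - t) := by
  -- eventually `e^{|ε|} ‖J‖ (1 − t) / 2 ≤ δ`
  have hev : ∀ᶠ t in 𝓝[<] (1:ℝ), Real.exp |ε| / 2 * ‖J‖ * (1 - t) ≤ δ := by
    have hc : Tendsto (fun t : ℝ => Real.exp |ε| / 2 * ‖J‖ * (1 - t)) (𝓝[<] (1:ℝ)) (𝓝 0) := by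
      have : Tendsto (fun t : ℝ => Real.exp |ε| / 2 * ‖J‖ * (1 - t)) (𝓝 (1:ℝ))
          (𝓝 (Real.exp |ε| / 2 * ‖J‖ * (1 - 1))) :=
        ((continuous_const.mul (continuous_const.sub continuous_id)).tendsto 1)
      rw [sub_self, mul_zero] at this
      exact this.mono_left nhdsWithin_le_nhds
    exact (hc.eventually (ge_mem_nhds hδ))
  filter_upwards [Ico_mem_nhdsLT zero_lt_one, hev] with t ht hδt x hx
  rw [sub_zero] at hx
  have hτ : 0 < 1 - t := sub_pos.2 ht.2
  have hsq : 0 < Real.sqrt (1 - t) := Real.sqrt_pos.2 hτ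
  have hxle : ‖x‖ ≤ Real.sqrt (1 - t) := by
    rw [← Real.sqrt_sq (norm_nonneg x)]; exact Real.sqrt_le_sqrt hx
  have hstr : |strE ε t| ≤ |ε| * (1 / (1 - t)) := by
    rw [strE, abs_mul, str, abs_div, abs_of_pos hτ]
    exact mul_le_mul_of_nonneg_left (div_le_div_of_nonneg_right (Real.abs_cos_le_one _) hτ.le)
      (abs_nonneg _)
  have hamp : |ampE ε t / 2| ≤ Real.exp |ε| / 2 := by
    rw [abs_of_pos (by have := ampE_pos ε t; positivity)]; linarith [ampE_le ε t]
  have h1 : ‖velE ε t x‖ ≤ |strE ε t| * (‖D0‖ * ‖x‖) + |ampE ε t / 2| * (‖J‖ * ‖x‖) := by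
    unfold velE linVel
    refine (norm_add_le _ _).trans (add_le_add ?_ ?_)
    · rw [norm_smul, Real.norm_eq_abs]
      exact mul_le_mul_of_nonneg_left (D0.le_opNorm x) (abs_nonneg _)
    · rw [norm_smul, Real.norm_eq_abs]
      exact mul_le_mul_of_nonneg_left (J.le_opNorm x) (abs_nonneg _)
  have hinv : 1 / (1 - t) * Real.sqrt (1 - t) = 1 / Real.sqrt (1 - t) := by
    field_simp
    rw [Real.sq_sqrt hτ.le]
  have hsqrt_eq : Real.sqrt (1 - t) = (1 - t) * (1 / Real.sqrt (1 - t)) := by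
    field_simp
    rw [Real.sq_sqrt hτ.le]
  calc ‖velE ε t x‖ ≤ |strE ε t| * (‖D0‖ * ‖x‖) + |ampE ε t / 2| * (‖J‖ * ‖x‖) := h1
    _ ≤ (|ε| * (1 / (1 - t))) * (‖D0‖ * Real.sqrt (1 - t)) +
          (Real.exp |ε| / 2) * (‖J‖ * Real.sqrt (1 - t)) := by gcongr
    _ = |ε| * ‖D0‖ * (1 / (1 - t) * Real.sqrt (1 - t)) +
          Real.exp |ε| / 2 * ‖J‖ * Real.sqrt (1 - t) := by ring
    _ = |ε| * ‖D0‖ * (1 / Real.sqrt (1 - t)) +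
          (Real.exp |ε| / 2 * ‖J‖ * (1 - t)) * (1 / Real.sqrt (1 - t)) := by
        rw [hinv]; nth_rewrite 2 [hsqrt_eq]; ring
    _ ≤ |ε| * ‖D0‖ * (1 / Real.sqrt (1 - t)) + δ * (1 / Real.sqrt (1 - t)) := by
        gcongr
    _ = (|ε| * ‖D0‖ + δ) / Real.sqrt (1 - t) := by ring

/-- the ε-flow on the axis. [folklore] -/
theorem velE_axis (ε t r : ℝ) :
    velE ε t (EuclideanSpace.single 0 r) = EuclideanSpace.single 0 (strE ε t * r) := by
  ext i
  fin_cases i <;> simp [velE]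

/-- **backward singularity of `(1,0)` for the ε-flow**, `ε ≠ 0`. [folklore] -/
theorem singular_velE {ε : ℝ} (hε : ε ≠ 0) (r : ℝ) (hr : 0 < r) :
    eLpNorm (Function.uncurry (velE ε)) ⊤
      (volume.restrict (parabolicCylinder r ((1:ℝ), (0 : E3)))) = ⊤ := by
  by_contra hne
  set S := eLpNorm (Function.uncurry (velE ε)) ⊤
    (volume.restrict (parabolicCylinder r ((1:ℝ), (0:E3)))) with hS
  have hae : ∀ᵐ p ∂(volume.restrict (parabolicCylinder r ((1:ℝ), (0:E3)))),
      ‖Function.uncurry (velE ε) p‖ₑ ≤ S := by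
    rw [hS, eLpNorm_exponent_top]; exact ae_le_eLpNormEssSup
  have hε0 : 0 < |ε| := abs_pos.2 hε
  obtain ⟨n, hn⟩ : ∃ n : ℕ, max (Real.log (r ^ 2)⁻¹)
      (Real.log ((S.toReal + 1) / (|ε| * (r / 2)))) < n * (2 * π) := by
    obtain ⟨n, hn⟩ := exists_nat_gt (max (Real.log (r ^ 2)⁻¹)
      (Real.log ((S.toReal + 1) / (|ε| * (r / 2)))) / (2 * π))
    exact ⟨n, (div_lt_iff₀ (by positivity)).1 hn⟩
  have hn1 : Real.exp (-(n * (2 * π))) < r ^ 2 := by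
    rw [Real.exp_neg, inv_lt_comm₀ (Real.exp_pos _) (by positivity),
      ← Real.log_lt_iff_lt_exp (by positivity)]
    exact (le_max_left _ _).trans_lt hn
  have hn2 : S.toReal + 1 < |ε| * (r / 2) * Real.exp (n * (2 * π)) := by
    rw [← div_lt_iff₀' (by positivity), ← Real.log_lt_iff_lt_exp (by positivity)]
    exact (le_max_right _ _).trans_lt hn
  set t₀ : ℝ := 1 - Real.exp (-(n * (2 * π))) with ht₀
  set x₀ : E3 := EuclideanSpace.single 0 (r / 2) with hx₀
  have ht₀1 : t₀ < 1 := sub_lt_self _ (Real.exp_pos _)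
  have hval : ‖velE ε t₀ x₀‖ = |ε| * (r / 2) * Real.exp (n * (2 * π)) := by
    rw [hx₀, velE_axis, strE, ht₀, str_special, norm_single_zero, abs_mul, abs_mul,
      abs_of_pos (Real.exp_pos _), abs_of_pos (by positivity : (0:ℝ) < r / 2)]
    ring
  set U : Set (ℝ × E3) := {p | S.toReal + 1 < ‖Function.uncurry (velE ε) p‖} ∩ (Iio 1 ×ˢ univ) with hU
  have hcont : ContinuousOn (fun p : ℝ × E3 => ‖Function.uncurry (velE ε) p‖) (Iio 1 ×ˢ univ) :=
    fun p hp => ((contDiffAt_uncurry_velE ε (n := 0) (mem_prod.1 hp).1 p.2).continuousAt.norm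
      ).continuousWithinAt
  have hUo : IsOpen U := by
    rw [hU, inter_comm]
    exact hcont.isOpen_inter_preimage (isOpen_Iio.prod isOpen_univ) isOpen_Ioi
  have hmem : ((t₀, x₀) : ℝ × E3) ∈ U ∩ parabolicCylinder r ((1:ℝ), (0:E3)) := by
    refine ⟨⟨?_, ht₀1, mem_univ _⟩, ?_⟩
    · show S.toReal + 1 < ‖velE ε t₀ x₀‖
      rw [hval]; exact hn2
    · rw [mem_parabolicCylinder]
      refine ⟨⟨by rw [ht₀]; linarith, ht₀1⟩, ?_⟩
      rw [hx₀, dist_zero_right, norm_single_zero, abs_of_pos (by positivity)]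
      linarith
  have hpos : 0 < volume (U ∩ parabolicCylinder r ((1:ℝ), (0:E3))) :=
    (hUo.inter (isOpen_parabolicCylinder r _)).measure_pos volume ⟨_, hmem⟩
  have hnull : volume.restrict (parabolicCylinder r ((1:ℝ), (0:E3))) U = 0 := by
    refine measure_eq_zero_iff_ae_notMem.2 ?_
    filter_upwards [hae] with p hp hpU
    have h2 : S.toReal + 1 < ‖Function.uncurry (velE ε) p‖ := hpU.1
    have h3 : (‖Function.uncurry (velE ε) p‖ₑ).toReal ≤ S.toReal := ENNReal.toReal_mono hne hp
    rw [toReal_enorm] at h3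
    linarith
  rw [Measure.restrict_apply hUo.measurableSet] at hnull
  exact hpos.ne' hnull

/-- `AdaptedFrequencyConvergesWithoutDecay` strengthened by THREE smallness hypotheses with parameter
`δ > 0`: (S1) the parabolic-local Type-I constant is `≤ δ`; (S2) the kernel is Gaussian-comparable
with `c₂, C₂ ∈ [4ν e^{−δ}, 4ν e^{δ}]` and `c₁, C₁` within `e^{±δ}`-type factors of `(4πν)^{-3/2}`
— concretely `c₁ = (4πνe^{δ})^{-3/2}`, `C₁ = (4πνe^{−δ})^{-3/2}`; (S3) an a-priori oscillation budget
`|Λ t| ≤ δ` eventually.  Conclusion as in the crux. [folklore] -/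
def AdaptedFrequencyConvergesWithoutDecaySmall (δ : ℝ) : Prop :=
  ∀ (ν T : ℝ), 0 < ν → 0 < T → ∀ (u : ℝ → EuclideanSpace ℝ (Fin 3) → EuclideanSpace ℝ (Fin 3)) (p : ℝ → EuclideanSpace ℝ (Fin 3) → ℝ), Literature.Analysis.FluidPDE.IsClassicalNSSolutionOn (Set.Ico 0 T) ν 0 u p → ∀ (x₀ : EuclideanSpace ℝ (Fin 3)) (t₀ : ℝ) (G : ℝ → EuclideanSpace ℝ (Fin 3) → ℝ), t₀ ∈ Set.Ico 0 T → (∀ᶠ t in 𝓝[<] T, ∀ x, ‖x - x₀‖ ^ 2 ≤ T - t → ‖u t x‖ ≤ δ / Real.sqrt (T - t)) → (∀ r : ℝ, 0 < r → MeasureTheory.eLpNorm (Function.uncurry u) ⊤ (MeasureTheory.Measure.restrict MeasureTheory.volume (Literature.Analysis.FluidPDE.parabolicCylinder r (T, x₀))) = ⊤) → ContDiffOn ℝ 2 (Function.uncurry G) (Set.Ico t₀ T ×ˢ Set.univ) ∧ (∀ t ∈ Set.Ico t₀ T, ∀ x, 0 < G t x) ∧ (∀ t ∈ Set.Ico t₀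 T, ∀ x, Literature.Analysis.FluidPDE.timeDerivWithin (Set.Ico t₀ T) G t x + fderiv ℝ (G t) x (u t x) + ν * Laplacian.laplacian (G t) x = 0) ∧ (∀ t ∈ Set.Ico t₀ T, ∫ x, G t x = 1) ∧ (∀ φ : EuclideanSpace ℝ (Fin 3) → ℝ, Continuous φ → (∃ M : ℝ, ∀ x, |φ x| ≤ M) → Filter.Tendsto (fun t => ∫ x, φ x * G t x) (nhdsWithin T (Set.Iio T)) (nhds (φ x₀))) → (∀ t ∈ Set.Ico t₀ T, ∀ x, (4 * π * ν * Real.exp δ) ^ (-(3:ℝ) / 2) * (T - t) ^ (-(3:ℝ) / 2) * Real.exp (-(‖x - x₀‖ ^ 2) / ((4 * ν * Real.exp (-δ)) * (T - t))) ≤ G t x ∧ G t x ≤ (4 * π * ν * Real.exp (-δ)) ^ (-(3:ℝ) / 2) * (T - t) ^ (-(3:ℝ) / 2) * Real.exp (-(‖x - x₀‖ ^ 2) / ((4 * ν * Real.exp δ) * (T - t)))) → ∀ H Λ : ℝ → ℝ, H = (fun t => ∫ x, ‖Literature.Analysis.FluidPDE.curl (u t) x‖ ^ 2 * G t x) → Λ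 = (fun t => (T - t) * deriv H t / H t) → (∀ᶠ t in 𝓝[<] T, |Λ t| ≤ δ) → ∃ Λ₀ : ℝ, Filter.Tendsto Λ (nhdsWithin T (Set.Iio T)) (nhds Λ₀)

/-- **TIGHTNESS: no smallness threshold helps without a far-field hypothesis.** For every `δ > 0`
the δ-small strengthening is still false: take `ε = min(δ/4, δ/(2‖D₀‖+2))`-ish; concretely
`ε := δ / (4 * (‖D₀‖ + 1))`, so that `4|ε| ≤ δ`, `|ε|‖D₀‖ + |ε| ≤ δ` and `2|ε| ≤ δ`. [folklore] -/
theorem adaptedFrequencyConverges_false_without_decay_small {δ : ℝ} (hδ : 0 < δ) :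
    ¬ AdaptedFrequencyConvergesWithoutDecaySmall δ := by
  intro h
  set ε : ℝ := δ / (4 * (‖D0‖ + 1)) with hε
  have hD : 0 ≤ ‖D0‖ := norm_nonneg _
  have hε0 : 0 < ε := by rw [hε]; positivity
  have hεabs : |ε| = ε := abs_of_pos hε0
  have hε4 : 4 * |ε| ≤ δ := by
    rw [hεabs, hε, div_eq_mul_inv]
    have : (4 * (‖D0‖ + 1))⁻¹ ≤ 4⁻¹ := by
      apply inv_anti₀ (by norm_num); nlinarith
    nlinarith
  have hεD : |ε| * ‖D0‖ + |ε| ≤ δ := by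
    rw [hεabs, hε]
    rw [show δ / (4 * (‖D0‖ + 1)) * ‖D0‖ + δ / (4 * (‖D0‖ + 1)) = δ * ((‖D0‖ + 1) / (4 * (‖D0‖ + 1))) by ring]
    rw [show (‖D0‖ + 1) / (4 * (‖D0‖ + 1)) = 1 / 4 by field_simp]
    linarith
  have h1 : (0:ℝ) < 1 := one_pos
  -- local Type-I with constant ≤ δ
  have hTI : ∀ᶠ t in 𝓝[<] (1:ℝ), ∀ x : E3, ‖x - 0‖ ^ 2 ≤ 1 - t →
      ‖velE ε t x‖ ≤ δ / Real.sqrt (1 - t) := by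
    filter_upwards [local_typeI_velE ε hε0, self_mem_nhdsWithin] with t ht ht1 x hx
    refine (ht x hx).trans (div_le_div_of_nonneg_right ?_ (Real.sqrt_nonneg _))
    linarith
  -- comparability with δ-constants from the 4|ε|-constants
  have hcomp : ∀ t ∈ Set.Ico (0:ℝ) 1, ∀ x : E3,
      (4 * π * 1 * Real.exp δ) ^ (-(3:ℝ) / 2) * (1 - t) ^ (-(3:ℝ) / 2) *
          Real.exp (-(‖x - 0‖ ^ 2) / ((4 * 1 * Real.exp (-δ)) * (1 - t))) ≤ GE 1 ε t x ∧
        GE 1 ε t x ≤ (4 * π * 1 * Real.exp (-δ)) ^ (-(3:ℝ) / 2) * (1 - t) ^ (-(3:ℝ) / 2) *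
          Real.exp (-(‖x - 0‖ ^ 2) / ((4 * 1 * Real.exp δ) * (1 - t))) := by
    intro t ht x
    obtain ⟨hlo, hhi⟩ := GE_comparable h1 ε t ht x
    have hτ : 0 < 1 - t := sub_pos.2 ht.2
    have hn : 0 ≤ ‖x - 0‖ ^ 2 := sq_nonneg _
    have e1 : Real.exp (4 * |ε|) ≤ Real.exp δ := Real.exp_le_exp.2 hε4
    have e2 : Real.exp (-δ) ≤ Real.exp (-(4 * |ε|)) := Real.exp_le_exp.2 (by linarith)
    constructor
    · refine le_trans ?_ hlo
      have hA : (4 * π * 1 * Real.exp δ) ^ (-(3:ℝ) / 2) ≤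
          (2 * π * (2 * 1 * Real.exp (4 * |ε|))) ^ (-(3:ℝ) / 2) := by
        apply Real.rpow_le_rpow_of_nonpos (by positivity) ?_ (by norm_num)
        nlinarith [Real.pi_pos]
      have hB : Real.exp (-(‖x - 0‖ ^ 2) / ((4 * 1 * Real.exp (-δ)) * (1 - t))) ≤
          Real.exp (-(‖x - 0‖ ^ 2) / ((4 * 1 * Real.exp (-(4 * |ε|))) * (1 - t))) := by
        rw [Real.exp_le_exp, neg_div, neg_div, neg_le_neg_iff]
        apply div_le_div_of_nonneg_left hn (by positivity)
        gcongr
      exact mul_le_mul (mul_le_mul_of_nonneg_right hA (by positivity)) hB (by positivity)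
        (by positivity)
    · refine le_trans hhi ?_
      have hA : (2 * π * (2 * 1 * Real.exp (-(4 * |ε|)))) ^ (-(3:ℝ) / 2) ≤
          (4 * π * 1 * Real.exp (-δ)) ^ (-(3:ℝ) / 2) := by
        apply Real.rpow_le_rpow_of_nonpos (by positivity) ?_ (by norm_num)
        nlinarith [Real.pi_pos]
      have hB : Real.exp (-(‖x - 0‖ ^ 2) / ((4 * 1 * Real.exp (4 * |ε|)) * (1 - t))) ≤
          Real.exp (-(‖x - 0‖ ^ 2) / ((4 * 1 * Real.exp δ) * (1 - t))) := by
        rw [Real.exp_le_exp, neg_div, neg_div, neg_le_neg_iff]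
        apply div_le_div_of_nonneg_left hn (by positivity)
        gcongr
      exact mul_le_mul (mul_le_mul_of_nonneg_right hA (by positivity)) hB (by positivity)
        (by positivity)
  -- oscillation budget |Λ| ≤ 2|ε| ≤ δ
  obtain ⟨Λ₀, hlim⟩ := h 1 1 h1 h1 (velE ε) (presE ε) (isClassicalNSSolutionOn_velE ε 1) 0 0 (GE 1 ε)
    ⟨le_rfl, h1⟩ hTI (singular_velE hε0.ne') ⟨(contDiffOn_uncurry_GE 1 h1 ε (n := 2)).mono
      (prod_mono Ico_subset_Iio_self Subset.rfl), fun _ ht x => GE_pos h1 ε ht.2 x,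
      fun _ ht x => adjoint_eq_GE h1 ε ht x, fun _ ht => integral_GE h1 ε ht.2,
      fun _ hφ hM => tendsto_integral_mul_GE h1 ε hφ hM⟩ hcomp _ _ rfl rfl (by
        filter_upwards [Ico_mem_nhdsLT zero_lt_one] with t ht
        rw [frequencyE_eq h1 ε rfl rfl ht.2, abs_mul, abs_mul, abs_two, hεabs]
        have := Real.abs_cos_le_one (Real.log (1 - t))
        nlinarith)
  exact not_tendsto_frequencyE h1 hε0.ne' rfl rfl ⟨Λ₀, hlim⟩


/-! ## Part G (cycle 2): the stubs of the picked line `tauberian-omega-limit` on the witness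

Landed copies (namespace `…Negative`): the drefute seat's `Negative/TauberianStubsWithoutDecay.lean` (p81430:
`adaptedEnstrophy_vel`, `adaptedFrequency_vel`, `tendsto_sq_mul_adaptedEnstrophy_vel`, `stub_pinching_false_without_decay`
(two-sided first-skeleton form), `stub_slowDecrease_false_without_decay` with `ε = 1/4`, `stub_kernelCalculus_on_witness`) and this
seat's addendum `Negative/LineStubsActive.lean` (active one-sided `stub_pinchingLower_false_without_decay`, the `ε = 1` window,
the δ-small version). -/

/-! ### the witness in the vocabulary of the line -/

/-- The adapted enstrophy of the linear witness is `ω(t)²`. [folklore] -/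
theorem adaptedEnstrophy_vel {ν : ℝ} (hν : 0 < ν) {t : ℝ} (ht : t < 1) :
    adaptedEnstrophy vel (G ν) t = amp t ^ 2 := by
  rw [adaptedEnstrophy_apply]
  exact integral_curl_vel_sq_mul_G hν ht

/-- The adapted frequency of the linear witness about the pole `(1, 0)` is `2 cos log(1 − t)`. [folklore] -/
theorem adaptedFrequency_vel {ν : ℝ} (hν : 0 < ν) {t : ℝ} (ht : t < 1) :
    adaptedFrequency vel (G ν) 1 t = 2 * Real.cos (Real.log (1 - t)) :=
  frequency_eq hν (H := adaptedEnstrophy vel (G ν)) (Λ := adaptedFrequency vel (G ν) 1) rfl rfl ht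

/-- The exact kernel of the witness is an adapted backward kernel on `[0,1)` with pole `(1,0)`. [folklore] -/
theorem isAdaptedBackwardKernel_G {ν : ℝ} (hν : 0 < ν) :
    IsAdaptedBackwardKernel ν vel (Ico 0 1) 1 0 (G ν) :=
  isAdaptedBackwardKernel_iff.2 (kernel_clauses hν)

/-- The exact kernel of the witness is two-sided Gaussian-comparable. [folklore] -/
theorem isGaussianComparable_G {ν : ℝ} (hν : 0 < ν) :
    IsGaussianComparable (G ν) (Ico 0 1) 1 0 :=
  isGaussianComparable_iff_fin_three.2 (G_comparable hν)

/-- `(1−t)² H(t) ≤ (1−t)² e²` for the witness. [folklore] -/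
theorem sq_mul_adaptedEnstrophy_vel_le {ν : ℝ} (hν : 0 < ν) {t : ℝ} (ht : t < 1) :
    (1 - t) ^ 2 * adaptedEnstrophy vel (G ν) t ≤ (1 - t) ^ 2 * Real.exp 2 := by
  rw [adaptedEnstrophy_vel hν ht]
  refine mul_le_mul_of_nonneg_left ?_ (sq_nonneg _)
  calc amp t ^ 2 ≤ Real.exp 1 ^ 2 := pow_le_pow_left₀ (amp_pos t).le (amp_le t) 2
    _ = Real.exp 2 := by rw [← Real.exp_nat_mul]; norm_num

/-- The rescaled adapted enstrophy `(1−t)² H(t)` of the witness tends to `0` at the singular time: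
the vorticity stays bounded while only the strain blows up. [folklore] -/
theorem tendsto_sq_mul_adaptedEnstrophy_vel {ν : ℝ} (hν : 0 < ν) :
    Tendsto (fun t => (1 - t) ^ 2 * adaptedEnstrophy vel (G ν) t) (𝓝[<] 1) (𝓝 0) := by
  have h0 : Tendsto (fun t : ℝ => (1 - t) ^ 2 * Real.exp 2) (𝓝[<] 1) (𝓝 0) := by
    have hc : Continuous (fun t : ℝ => (1 - t) ^ 2 * Real.exp 2) := by fun_prop
    have h1 := hc.tendsto 1
    simp only [sub_self, ne_eq, OfNat.ofNat_ne_zero, not_false_eq_true, zero_pow, zero_mul] at h1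
    exact h1.mono_left nhdsWithin_le_nhds
  refine tendsto_of_tendsto_of_tendsto_of_le_of_le' tendsto_const_nhds h0 ?_ ?_
  · filter_upwards [self_mem_nhdsWithin] with t ht
    exact mul_nonneg (sq_nonneg _) (adaptedEnstrophy_nonneg fun x => (G_pos hν ht x).le)
  · filter_upwards [self_mem_nhdsWithin] with t ht
    exact sq_mul_adaptedEnstrophy_vel_le hν ht

/-! ### `stub_pinchingUpper` holds on the witness; `stub_pinchingLower` fails on it -/

/-- The witness satisfies the conclusion of `stub_pinchingUpper` (with `t₁ = 0`, `C₁ = e²`): the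
upper pinching is blind to the far field. [folklore] -/
theorem stub_pinchingUpper_witness {ν : ℝ} (hν : 0 < ν) :
    ∃ t₁ ∈ Ico (0:ℝ) 1, ∃ C₁ : ℝ, ∀ t ∈ Ico t₁ 1,
      (1 - t) ^ 2 * adaptedEnstrophy vel (G ν) t ≤ C₁ := by
  refine ⟨0, ⟨le_rfl, one_pos⟩, Real.exp 2, fun t ht => (sq_mul_adaptedEnstrophy_vel_le hν ht.2).trans ?_⟩
  have h1 : (1 - t) ^ 2 ≤ 1 := by nlinarith [ht.1, ht.2]
  calc (1 - t) ^ 2 * Real.exp 2 ≤ 1 * Real.exp 2 := by gcongr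
    _ = Real.exp 2 := one_mul _

/-- **`stub_pinchingLower` is false without the far-field hypotheses.**  The negated statement is
the lead's `stub_pinchingLower` (skeleton 1b56b576…) with `IsLerayHopfOn`, `HasRapidSpatialDecay`
DROPPED and `IsTypeIBlowup u T` WEAKENED to the parabolic-local Type-I bound at `x₀`; the classical
NS system, the backward singularity at `(T,x₀)`, `IsAdaptedBackwardKernel`, `IsGaussianComparable`
are kept verbatim.  Witness: the linear flow, for which `(1−t)² H(t) → 0`.  Hence the lower pinching
is the FAR-FIELD step of line `tauberian-omega-limit`. [folklore] -/
theorem stub_pinchingLower_false_without_decay :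
    ¬ (∀ (ν T : ℝ) (u : ℝ → EuclideanSpace ℝ (Fin 3) → EuclideanSpace ℝ (Fin 3))
        (p : ℝ → EuclideanSpace ℝ (Fin 3) → ℝ) (x₀ : EuclideanSpace ℝ (Fin 3)) (t₀ : ℝ)
        (G : ℝ → EuclideanSpace ℝ (Fin 3) → ℝ), 0 < ν → 0 < T →
        IsClassicalNSSolutionOn (Ico 0 T) ν 0 u p →
        (∃ C : ℝ, ∀ᶠ t in 𝓝[<] T, ∀ x, ‖x - x₀‖ ^ 2 ≤ T - t → ‖u t x‖ ≤ C / Real.sqrt (T - t)) →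
        t₀ ∈ Ico 0 T →
        (∀ r : ℝ, 0 < r → eLpNorm (Function.uncurry u) ⊤
          (volume.restrict (parabolicCylinder r (T, x₀))) = ⊤) →
        IsAdaptedBackwardKernel ν u (Ico t₀ T) T x₀ G → IsGaussianComparable G (Ico t₀ T) T x₀ →
        ∃ t₁ ∈ Ico t₀ T, ∃ c₀ : ℝ, 0 < c₀ ∧ ∀ t ∈ Ico t₁ T, c₀ ≤ (T - t) ^ 2 * adaptedEnstrophy u G t) := by
  intro h
  obtain ⟨t₁, ht₁, c₀, hc₀, hle⟩ := h 1 1 vel pres 0 0 (G 1) one_pos one_pos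
    (isClassicalNSSolutionOn_vel 1) local_typeI_vel ⟨le_rfl, one_pos⟩ singular_vel
    (isAdaptedBackwardKernel_G one_pos) (isGaussianComparable_G one_pos)
  have hev1 : ∀ᶠ t in 𝓝[<] (1:ℝ), (1 - t) ^ 2 * adaptedEnstrophy vel (G 1) t < c₀ :=
    (tendsto_sq_mul_adaptedEnstrophy_vel one_pos).eventually (Iio_mem_nhds hc₀)
  have hev2 : ∀ᶠ t in 𝓝[<] (1:ℝ), t ∈ Ico t₁ 1 := Ico_mem_nhdsLT ht₁.2
  obtain ⟨t, ht, ht'⟩ := (hev1.and hev2).exists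
  exact lt_irrefl c₀ ((hle t ht').trans_lt ht)

/-! ### `stub_slowDecrease` fails on the witness -/

/-- One dyadic window on which `2 cos log(1−t)` drops by more than `1`: from
`t = 1 − e^{−a}` to `t' = 1 − e^{−(a + 2/3)}`, `a = π/2 − 1/3 + 2πn`, the values are `2 sin(1/3)`
and `−2 sin(1/3)`, and `4 sin(1/3) > 1`; the window is dyadic because `2/3 ≤ log 2`. [folklore] -/
theorem two_cos_log_window (n : ℕ) :
    1 - Real.exp (-(π / 2 - 1 / 3 + n * (2 * π))) ≤ 1 - Real.exp (-(π / 2 - 1 / 3 + n * (2 * π) + 2 / 3)) ∧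
    1 - Real.exp (-(π / 2 - 1 / 3 + n * (2 * π) + 2 / 3)) < 1 ∧
    1 - (1 - Real.exp (-(π / 2 - 1 / 3 + n * (2 * π)))) ≤
      2 * (1 - (1 - Real.exp (-(π / 2 - 1 / 3 + n * (2 * π) + 2 / 3)))) ∧
    2 * Real.cos (Real.log (1 - (1 - Real.exp (-(π / 2 - 1 / 3 + n * (2 * π) + 2 / 3))))) + 1 <
      2 * Real.cos (Real.log (1 - (1 - Real.exp (-(π / 2 - 1 / 3 + n * (2 * π)))))) := by
  set a : ℝ := π / 2 - 1 / 3 + n * (2 * π) with ha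
  refine ⟨?_, ?_, ?_, ?_⟩
  · have : Real.exp (-(a + 2 / 3)) ≤ Real.exp (-a) := Real.exp_le_exp.2 (by linarith)
    linarith
  · linarith [Real.exp_pos (-(a + 2 / 3))]
  · -- `e^{-a} ≤ 2 e^{-(a+2/3)}` iff `2/3 ≤ log 2`
    have hlog : (2:ℝ) / 3 ≤ Real.log 2 := by linarith [Real.log_two_gt_d9]
    have h2 : Real.exp (2 / 3) ≤ 2 := (Real.le_log_iff_exp_le two_pos).1 hlog
    have h3 : Real.exp (-a) = Real.exp (-(a + 2 / 3)) * Real.exp (2 / 3) := by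
      rw [← Real.exp_add]; ring_nf
    rw [sub_sub_cancel, sub_sub_cancel, h3, mul_comm (2:ℝ)]
    exact mul_le_mul_of_nonneg_left h2 (Real.exp_pos _).le
  · rw [sub_sub_cancel, sub_sub_cancel, Real.log_exp, Real.log_exp, Real.cos_neg, Real.cos_neg]
    have hc1 : Real.cos a = Real.sin (1 / 3) := by
      rw [ha, Real.cos_add_nat_mul_two_pi, Real.cos_pi_div_two_sub]
    have hc2 : Real.cos (a + 2 / 3) = -Real.sin (1 / 3) := by
      have : a + 2 / 3 = 1 / 3 + π / 2 + n * (2 * π) := by rw [ha]; ring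
      rw [this, Real.cos_add_nat_mul_two_pi, Real.cos_add_pi_div_two]
    rw [hc1, hc2]
    have hs : (1:ℝ) / 3 - (1 / 3) ^ 3 / 6 < Real.sin (1 / 3) := Real.sin_gt_sub_cube (by norm_num)
    nlinarith

/-- **`t ↦ 2 cos log(1−t)` is not slowly decreasing at `1` over dyadic windows** (the property
`SlowlyDecreasingAt _ 1` of the line, written inline): with `ε = 1` every late window of
`two_cos_log_window` is violated. [folklore] -/
theorem not_slowlyDecreasing_two_cos_log :
    ¬ (∀ ε : ℝ, 0 < ε → ∃ t₁ : ℝ, t₁ < 1 ∧ ∀ t t' : ℝ, t₁ ≤ t → t ≤ t' → t' < 1 →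
        1 - t ≤ 2 * (1 - t') →
        2 * Real.cos (Real.log (1 - t)) ≤ 2 * Real.cos (Real.log (1 - t')) + ε) := by
  intro h
  obtain ⟨t₁, ht₁, hsd⟩ := h 1 one_pos
  -- a late window start `1 − e^{−aₙ} ≥ t₁`
  have hlim : Tendsto (fun n : ℕ => Real.exp (-(π / 2 - 1 / 3 + n * (2 * π)))) atTop (𝓝 0) := by
    have h1 : Tendsto (fun n : ℕ => π / 2 - 1 / 3 + (n : ℝ) * (2 * π)) atTop atTop :=
      tendsto_atTop_add_const_left _ _ (tendsto_natCast_atTop_atTop.atTop_mul_const (by positivity))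
    exact Real.tendsto_exp_neg_atTop_nhds_zero.comp h1
  obtain ⟨n, hn⟩ := (hlim.eventually (eventually_lt_nhds (sub_pos.2 ht₁))).exists
  obtain ⟨h1, h2, h3, h4⟩ := two_cos_log_window n
  have h5 := hsd _ _ (by linarith) h1 h2 h3
  linarith

/-- **`stub_slowDecrease` is false without the far-field hypotheses.**  The negated statement is the
lead's `stub_slowDecrease` (skeleton 1b56b576…; `SlowlyDecreasingAt (adaptedFrequency u G T) T`
unfolded) with `IsLerayHopfOn`, `HasRapidSpatialDecay` DROPPED and `IsTypeIBlowup u T` WEAKENED to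
the parabolic-local Type-I bound at `x₀`; everything else verbatim.  Witness: the linear flow, whose
adapted frequency `2 cos log(1−t)` drops by more than `1` over infinitely many late dyadic windows.
So the hardest stub, like the lower pinching, must import a far-field input; every inequality among
`G`-local quantities (`H, H′, H″, Λ, dΛ/ds, ∫ω·Sω G, ∫|∇ω|²G, ∂ₛ` of the rescaled strain, …) that
would imply slow decrease is refuted in advance by this flow. [folklore] -/
theorem stub_slowDecrease_false_without_decay :
    ¬ (∀ (ν T : ℝ) (u : ℝ → EuclideanSpace ℝ (Fin 3) → EuclideanSpace ℝ (Fin 3))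
        (p : ℝ → EuclideanSpace ℝ (Fin 3) → ℝ) (x₀ : EuclideanSpace ℝ (Fin 3)) (t₀ : ℝ)
        (G : ℝ → EuclideanSpace ℝ (Fin 3) → ℝ), 0 < ν → 0 < T →
        IsClassicalNSSolutionOn (Ico 0 T) ν 0 u p →
        (∃ C : ℝ, ∀ᶠ t in 𝓝[<] T, ∀ x, ‖x - x₀‖ ^ 2 ≤ T - t → ‖u t x‖ ≤ C / Real.sqrt (T - t)) →
        t₀ ∈ Ico 0 T →
        (∀ r : ℝ, 0 < r → eLpNorm (Function.uncurry u) ⊤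
          (volume.restrict (parabolicCylinder r (T, x₀))) = ⊤) →
        IsAdaptedBackwardKernel ν u (Ico t₀ T) T x₀ G → IsGaussianComparable G (Ico t₀ T) T x₀ →
        ∀ ε : ℝ, 0 < ε → ∃ t₁ : ℝ, t₁ < T ∧ ∀ t t' : ℝ, t₁ ≤ t → t ≤ t' → t' < T →
          T - t ≤ 2 * (T - t') → adaptedFrequency u G T t ≤ adaptedFrequency u G T t' + ε) := by
  intro h
  have hW := h 1 1 vel pres 0 0 (G 1) one_pos one_pos (isClassicalNSSolutionOn_vel 1) local_typeI_vel
    ⟨le_rfl, one_pos⟩ singular_vel (isAdaptedBackwardKernel_G one_pos) (isGaussianComparable_G one_pos)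
  refine not_slowlyDecreasing_two_cos_log fun ε hε => ?_
  obtain ⟨t₁, ht₁, hsd⟩ := hW ε hε
  refine ⟨t₁, ht₁, fun t t' h1 h2 h3 h4 => ?_⟩
  have h5 := hsd t t' h1 h2 h3 h4
  rwa [adaptedFrequency_vel one_pos (h2.trans_lt h3), adaptedFrequency_vel one_pos h3] at h5

/-- The crux's far-field hypotheses only STRENGTHEN the antecedent: a refutation of the lead's
`stub_slowDecrease` itself (all hypotheses of the crux) would refute the weakened statement above,
not conversely — the theorem above is load-bearing information ("any proof of `stub_slowDecrease`
must use Leray–Hopf / decay / the global sup in the Type-I bound"), not a refutation of the stub. [folklore] -/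
theorem not_slowDecreaseWithoutDecay_of_not_stub
    (h : ¬ (∀ (ν T : ℝ) (u : ℝ → EuclideanSpace ℝ (Fin 3) → EuclideanSpace ℝ (Fin 3))
        (p : ℝ → EuclideanSpace ℝ (Fin 3) → ℝ) (x₀ : EuclideanSpace ℝ (Fin 3)) (t₀ : ℝ)
        (G : ℝ → EuclideanSpace ℝ (Fin 3) → ℝ), 0 < ν → 0 < T →
        IsClassicalNSSolutionOn (Ico 0 T) ν 0 u p → IsLerayHopfOn T ν 0 (u 0) u →
        HasRapidSpatialDecay (u 0) → IsTypeIBlowup u T → t₀ ∈ Ico 0 T →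
        (∀ r : ℝ, 0 < r → eLpNorm (Function.uncurry u) ⊤
          (volume.restrict (parabolicCylinder r (T, x₀))) = ⊤) →
        IsAdaptedBackwardKernel ν u (Ico t₀ T) T x₀ G → IsGaussianComparable G (Ico t₀ T) T x₀ →
        ∀ ε : ℝ, 0 < ε → ∃ t₁ : ℝ, t₁ < T ∧ ∀ t t' : ℝ, t₁ ≤ t → t ≤ t' → t' < T →
          T - t ≤ 2 * (T - t') → adaptedFrequency u G T t ≤ adaptedFrequency u G T t' + ε)) :
    ¬ (∀ (ν T : ℝ) (u : ℝ → EuclideanSpace ℝ (Fin 3) → EuclideanSpace ℝ (Fin 3))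
        (p : ℝ → EuclideanSpace ℝ (Fin 3) → ℝ) (x₀ : EuclideanSpace ℝ (Fin 3)) (t₀ : ℝ)
        (G : ℝ → EuclideanSpace ℝ (Fin 3) → ℝ), 0 < ν → 0 < T →
        IsClassicalNSSolutionOn (Ico 0 T) ν 0 u p →
        (∃ C : ℝ, ∀ᶠ t in 𝓝[<] T, ∀ x, ‖x - x₀‖ ^ 2 ≤ T - t → ‖u t x‖ ≤ C / Real.sqrt (T - t)) →
        t₀ ∈ Ico 0 T →
        (∀ r : ℝ, 0 < r → eLpNorm (Function.uncurry u) ⊤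
          (volume.restrict (parabolicCylinder r (T, x₀))) = ⊤) →
        IsAdaptedBackwardKernel ν u (Ico t₀ T) T x₀ G → IsGaussianComparable G (Ico t₀ T) T x₀ →
        ∀ ε : ℝ, 0 < ε → ∃ t₁ : ℝ, t₁ < T ∧ ∀ t t' : ℝ, t₁ ≤ t → t ≤ t' → t' < T →
          T - t ≤ 2 * (T - t') → adaptedFrequency u G T t ≤ adaptedFrequency u G T t' + ε) := by
  intro hW
  apply h
  intro ν T u p x₀ t₀ G hν hT hcl _hLH _hdec hTI ht₀ hsing hK hcomp
  refine hW ν T u p x₀ t₀ G hν hT hcl ?_ ht₀ hsing hK hcomp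
  obtain ⟨C, hC⟩ := hTI
  exact ⟨C, hC.mono fun t ht x _ => ht x⟩


/-! ### Part G2 (cycle 2): no smallness threshold rescues `stub_slowDecrease` (ε-family of Part F) -/

/-- The adapted frequency of the ε-flow about the pole `(1,0)` is `2ε cos log(1−t)`. [folklore] -/
theorem adaptedFrequency_velE {ν : ℝ} (hν : 0 < ν) (ε : ℝ) {t : ℝ} (ht : t < 1) :
    adaptedFrequency (velE ε) (GE ν ε) 1 t = 2 * ε * Real.cos (Real.log (1 - t)) :=
  frequencyE_eq hν ε (H := adaptedEnstrophy (velE ε) (GE ν ε))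
    (Λ := adaptedFrequency (velE ε) (GE ν ε) 1) rfl rfl ht

/-- The ε-kernel is an adapted backward kernel on `[0,1)` with pole `(1,0)`. [folklore] -/
theorem isAdaptedBackwardKernel_GE {ν : ℝ} (hν : 0 < ν) (ε : ℝ) :
    IsAdaptedBackwardKernel ν (velE ε) (Ico 0 1) 1 0 (GE ν ε) :=
  ⟨(contDiffOn_uncurry_GE ν hν ε (n := 2)).mono (prod_mono Ico_subset_Iio_self Subset.rfl),
    fun _ ht x => GE_pos hν ε ht.2 x, fun _ ht x => adjoint_eq_GE hν ε ht x,
    fun _ ht => integral_GE hν ε ht.2, fun _ hφ hM => tendsto_integral_mul_GE hν ε hφ hM⟩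

/-- `2ε cos log(1−t)` drops by `4ε sin(1/3) > ε` over the late dyadic windows of
`two_cos_log_window`. [folklore] -/
theorem not_slowlyDecreasing_two_eps_cos_log {ε : ℝ} (hε : 0 < ε) :
    ¬ (∀ ε' : ℝ, 0 < ε' → ∃ t₁ : ℝ, t₁ < 1 ∧ ∀ t t' : ℝ, t₁ ≤ t → t ≤ t' → t' < 1 →
        1 - t ≤ 2 * (1 - t') →
        2 * ε * Real.cos (Real.log (1 - t)) ≤ 2 * ε * Real.cos (Real.log (1 - t')) + ε') := by
  intro h
  obtain ⟨t₁, ht₁, hsd⟩ := h ε hε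
  have hlim : Tendsto (fun n : ℕ => Real.exp (-(π / 2 - 1 / 3 + n * (2 * π)))) atTop (𝓝 0) := by
    have h1 : Tendsto (fun n : ℕ => π / 2 - 1 / 3 + (n : ℝ) * (2 * π)) atTop atTop :=
      tendsto_atTop_add_const_left _ _ (tendsto_natCast_atTop_atTop.atTop_mul_const (by positivity))
    exact Real.tendsto_exp_neg_atTop_nhds_zero.comp h1
  obtain ⟨n, hn⟩ := (hlim.eventually (eventually_lt_nhds (sub_pos.2 ht₁))).exists
  obtain ⟨h1, h2, h3, h4⟩ := two_cos_log_window n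
  have h5 := hsd _ _ (by linarith) h1 h2 h3
  have h6 := mul_lt_mul_of_pos_left h4 hε
  nlinarith

/-- **No smallness threshold rescues `stub_slowDecrease` without a far-field hypothesis.**  For every
`δ > 0` the following δ-small strengthening of the weakened stub is still false: local Type-I constant
`≤ δ`, kernel within `e^{±δ}` of the backward heat kernel's constants, oscillation budget
`|Λ| ≤ δ` eventually — and yet `Λ` is not slowly decreasing.  Witness: the ε-flow of Part F with
`ε = δ/(4(‖D₀‖+1))`, `Λ = 2ε cos log(1−t)`. [folklore] -/
theorem stub_slowDecrease_false_without_decay_small {δ : ℝ} (hδ : 0 < δ) :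
    ¬ (∀ (ν T : ℝ) (u : ℝ → EuclideanSpace ℝ (Fin 3) → EuclideanSpace ℝ (Fin 3))
        (p : ℝ → EuclideanSpace ℝ (Fin 3) → ℝ) (x₀ : EuclideanSpace ℝ (Fin 3)) (t₀ : ℝ)
        (G : ℝ → EuclideanSpace ℝ (Fin 3) → ℝ), 0 < ν → 0 < T →
        IsClassicalNSSolutionOn (Ico 0 T) ν 0 u p →
        (∀ᶠ t in 𝓝[<] T, ∀ x, ‖x - x₀‖ ^ 2 ≤ T - t → ‖u t x‖ ≤ δ / Real.sqrt (T - t)) →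
        t₀ ∈ Ico 0 T →
        (∀ r : ℝ, 0 < r → eLpNorm (Function.uncurry u) ⊤
          (volume.restrict (parabolicCylinder r (T, x₀))) = ⊤) →
        IsAdaptedBackwardKernel ν u (Ico t₀ T) T x₀ G →
        (∀ t ∈ Set.Ico t₀ T, ∀ x, (4 * π * ν * Real.exp δ) ^ (-(3:ℝ) / 2) * (T - t) ^ (-(3:ℝ) / 2) *
            Real.exp (-(‖x - x₀‖ ^ 2) / ((4 * ν * Real.exp (-δ)) * (T - t))) ≤ G t x ∧
          G t x ≤ (4 * π * ν * Real.exp (-δ)) ^ (-(3:ℝ) / 2) * (T - t) ^ (-(3:ℝ) / 2) *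
            Real.exp (-(‖x - x₀‖ ^ 2) / ((4 * ν * Real.exp δ) * (T - t)))) →
        (∀ᶠ t in 𝓝[<] T, |adaptedFrequency u G T t| ≤ δ) →
        ∀ ε : ℝ, 0 < ε → ∃ t₁ : ℝ, t₁ < T ∧ ∀ t t' : ℝ, t₁ ≤ t → t ≤ t' → t' < T →
          T - t ≤ 2 * (T - t') → adaptedFrequency u G T t ≤ adaptedFrequency u G T t' + ε) := by
  intro h
  set ε : ℝ := δ / (4 * (‖D0‖ + 1)) with hε
  have hD : 0 ≤ ‖D0‖ := norm_nonneg _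
  have hε0 : 0 < ε := by rw [hε]; positivity
  have hεabs : |ε| = ε := abs_of_pos hε0
  have hε4 : 4 * |ε| ≤ δ := by
    rw [hεabs, hε, div_eq_mul_inv]
    have : (4 * (‖D0‖ + 1))⁻¹ ≤ 4⁻¹ := by
      apply inv_anti₀ (by norm_num); nlinarith
    nlinarith
  have hεD : |ε| * ‖D0‖ + |ε| ≤ δ := by
    rw [hεabs, hε]
    rw [show δ / (4 * (‖D0‖ + 1)) * ‖D0‖ + δ / (4 * (‖D0‖ + 1)) = δ * ((‖D0‖ + 1) / (4 * (‖D0‖ + 1))) by ring]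
    rw [show (‖D0‖ + 1) / (4 * (‖D0‖ + 1)) = 1 / 4 by field_simp]
    linarith
  have h1 : (0:ℝ) < 1 := one_pos
  -- local Type-I with constant ≤ δ
  have hTI : ∀ᶠ t in 𝓝[<] (1:ℝ), ∀ x : E3, ‖x - 0‖ ^ 2 ≤ 1 - t →
      ‖velE ε t x‖ ≤ δ / Real.sqrt (1 - t) := by
    filter_upwards [local_typeI_velE ε hε0, self_mem_nhdsWithin] with t ht ht1 x hx
    refine (ht x hx).trans (div_le_div_of_nonneg_right ?_ (Real.sqrt_nonneg _))
    linarith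
  -- comparability with δ-constants from the 4|ε|-constants
  have hcomp : ∀ t ∈ Set.Ico (0:ℝ) 1, ∀ x : E3,
      (4 * π * 1 * Real.exp δ) ^ (-(3:ℝ) / 2) * (1 - t) ^ (-(3:ℝ) / 2) *
          Real.exp (-(‖x - 0‖ ^ 2) / ((4 * 1 * Real.exp (-δ)) * (1 - t))) ≤ GE 1 ε t x ∧
        GE 1 ε t x ≤ (4 * π * 1 * Real.exp (-δ)) ^ (-(3:ℝ) / 2) * (1 - t) ^ (-(3:ℝ) / 2) *
          Real.exp (-(‖x - 0‖ ^ 2) / ((4 * 1 * Real.exp δ) * (1 - t))) := by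
    intro t ht x
    obtain ⟨hlo, hhi⟩ := GE_comparable h1 ε t ht x
    have hτ : 0 < 1 - t := sub_pos.2 ht.2
    have hn : 0 ≤ ‖x - 0‖ ^ 2 := sq_nonneg _
    have e1 : Real.exp (4 * |ε|) ≤ Real.exp δ := Real.exp_le_exp.2 hε4
    have e2 : Real.exp (-δ) ≤ Real.exp (-(4 * |ε|)) := Real.exp_le_exp.2 (by linarith)
    constructor
    · refine le_trans ?_ hlo
      have hA : (4 * π * 1 * Real.exp δ) ^ (-(3:ℝ) / 2) ≤
          (2 * π * (2 * 1 * Real.exp (4 * |ε|))) ^ (-(3:ℝ) / 2) := by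
        apply Real.rpow_le_rpow_of_nonpos (by positivity) ?_ (by norm_num)
        nlinarith [Real.pi_pos]
      have hB : Real.exp (-(‖x - 0‖ ^ 2) / ((4 * 1 * Real.exp (-δ)) * (1 - t))) ≤
          Real.exp (-(‖x - 0‖ ^ 2) / ((4 * 1 * Real.exp (-(4 * |ε|))) * (1 - t))) := by
        rw [Real.exp_le_exp, neg_div, neg_div, neg_le_neg_iff]
        apply div_le_div_of_nonneg_left hn (by positivity)
        gcongr
      exact mul_le_mul (mul_le_mul_of_nonneg_right hA (by positivity)) hB (by positivity)
        (by positivity)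
    · refine le_trans hhi ?_
      have hA : (2 * π * (2 * 1 * Real.exp (-(4 * |ε|)))) ^ (-(3:ℝ) / 2) ≤
          (4 * π * 1 * Real.exp (-δ)) ^ (-(3:ℝ) / 2) := by
        apply Real.rpow_le_rpow_of_nonpos (by positivity) ?_ (by norm_num)
        nlinarith [Real.pi_pos]
      have hB : Real.exp (-(‖x - 0‖ ^ 2) / ((4 * 1 * Real.exp (4 * |ε|)) * (1 - t))) ≤
          Real.exp (-(‖x - 0‖ ^ 2) / ((4 * 1 * Real.exp δ) * (1 - t))) := by
        rw [Real.exp_le_exp, neg_div, neg_div, neg_le_neg_iff]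
        apply div_le_div_of_nonneg_left hn (by positivity)
        gcongr
      exact mul_le_mul (mul_le_mul_of_nonneg_right hA (by positivity)) hB (by positivity)
        (by positivity)
  -- oscillation budget |Λ| ≤ 2|ε| ≤ δ
  have hosc : ∀ᶠ t in 𝓝[<] (1:ℝ), |adaptedFrequency (velE ε) (GE 1 ε) 1 t| ≤ δ := by
    filter_upwards [Ico_mem_nhdsLT zero_lt_one] with t ht
    rw [adaptedFrequency_velE h1 ε ht.2, abs_mul, abs_mul, abs_two, hεabs]
    have := Real.abs_cos_le_one (Real.log (1 - t))
    nlinarith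
  have hW := h 1 1 (velE ε) (presE ε) 0 0 (GE 1 ε) h1 h1 (isClassicalNSSolutionOn_velE ε 1) hTI
    ⟨le_rfl, h1⟩ (singular_velE hε0.ne') (isAdaptedBackwardKernel_GE h1 ε) hcomp hosc
  refine not_slowlyDecreasing_two_eps_cos_log hε0 fun ε' hε' => ?_
  obtain ⟨t₁, ht₁, hsd⟩ := hW ε' hε'
  refine ⟨t₁, ht₁, fun t t' h1t h2 h3 h4 => ?_⟩
  have h5 := hsd t t' h1t h2 h3 h4
  rwa [adaptedFrequency_velE h1 ε (h2.trans_lt h3), adaptedFrequency_velE h1 ε h3] at h5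


/-! ## Part H (cycle 2): tightness of the Landau step — the lower pinching is necessary even for `∃ Λ₀`

Pure real analysis.  Landed copy: `Theorems/AdaptedFrequencyConverges/Negative/LandauTightness.lean`. -/

/-! ### the witness `landauH` -/

/-- similarity time `s(t) = −log(1−t)` [folklore] -/
def simTime (t : ℝ) : ℝ := -Real.log (1 - t)

/-- the profile exponent `f(s) = −s + (1+s)(sin log(1+s) − cos log(1+s))/4` [folklore] -/
def prof (s : ℝ) : ℝ :=
  -s + (1 + s) * (Real.sin (Real.log (1 + s)) - Real.cos (Real.log (1 + s))) / 4

/-- `f′(s) = −1 + ½ sin log(1+s)` [folklore] -/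
def profDeriv (s : ℝ) : ℝ := -1 + Real.sin (Real.log (1 + s)) / 2

/-- the witness "enstrophy" `H(t) = exp(2 s(t) + f(s(t))) = (1−t)⁻² e^{f(s(t))}` [folklore] -/
def landauH (t : ℝ) : ℝ := Real.exp (2 * simTime t + prof (simTime t))

/-- `H > 0` [folklore] -/
theorem landauH_pos (t : ℝ) : 0 < landauH t := Real.exp_pos _

/-- `ds/dt = 1/(1−t)` [folklore] -/
theorem hasDerivAt_simTime {t : ℝ} (ht : t < 1) : HasDerivAt simTime (1 - t)⁻¹ t := by
  have h1 : HasDerivAt (fun s : ℝ => 1 - s) (-1) t := (hasDerivAt_id t).const_sub 1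
  have h2 := ((Real.hasDerivAt_log (sub_pos.2 ht).ne').comp t h1).neg
  unfold simTime
  refine h2.congr_deriv ?_
  ring

/-- `s ≥ 0` on `[0, 1)` [folklore] -/
theorem simTime_nonneg {t : ℝ} (h0 : 0 ≤ t) (h1 : t < 1) : 0 ≤ simTime t := by
  unfold simTime
  have := Real.log_nonpos (sub_nonneg.2 h1.le) (by linarith : 1 - t ≤ 1)
  linarith

/-- `f′ = profDeriv` on `s > −1` [folklore] -/
theorem hasDerivAt_prof {s : ℝ} (hs : -1 < s) : HasDerivAt prof (profDeriv s) s := by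
  have h0 : (0:ℝ) < 1 + s := by linarith
  have h1 : HasDerivAt (fun x : ℝ => 1 + x) 1 s := (hasDerivAt_id s).const_add 1
  have hL : HasDerivAt (fun x : ℝ => Real.log (1 + x)) ((1 + s)⁻¹ * 1) s :=
    (Real.hasDerivAt_log h0.ne').comp s h1
  have h2 : HasDerivAt (fun x : ℝ => (1 + x) * (Real.sin (Real.log (1 + x)) - Real.cos (Real.log (1 + x))))
      (1 * (Real.sin (Real.log (1 + s)) - Real.cos (Real.log (1 + s))) +
        (1 + s) * (Real.cos (Real.log (1 + s)) * ((1 + s)⁻¹ * 1) -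
          -Real.sin (Real.log (1 + s)) * ((1 + s)⁻¹ * 1))) s :=
    h1.mul ((hL.sin).sub (hL.cos))
  have h3 : HasDerivAt (fun x : ℝ => -x + (1 + x) * (Real.sin (Real.log (1 + x)) - Real.cos (Real.log (1 + x))) / 4)
      (-1 + (1 * (Real.sin (Real.log (1 + s)) - Real.cos (Real.log (1 + s))) +
        (1 + s) * (Real.cos (Real.log (1 + s)) * ((1 + s)⁻¹ * 1) -
          -Real.sin (Real.log (1 + s)) * ((1 + s)⁻¹ * 1))) / 4) s :=
    (hasDerivAt_id' s).neg.add (h2.div_const 4)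
  unfold prof profDeriv
  refine h3.congr_deriv ?_
  field_simp
  ring

/-- `H′ = H · (2 + f′(s)) / (1−t)` [folklore] -/
theorem hasDerivAt_landauH {t : ℝ} (ht : t < 1) (hs : -1 < simTime t) :
    HasDerivAt landauH (landauH t * ((2 + profDeriv (simTime t)) * (1 - t)⁻¹)) t := by
  have h1 := hasDerivAt_simTime ht
  have h2 : HasDerivAt (fun x => 2 * simTime x + prof (simTime x))
      (2 * (1 - t)⁻¹ + profDeriv (simTime t) * (1 - t)⁻¹) t :=
    (h1.const_mul 2).add ((hasDerivAt_prof hs).comp t h1)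
  have h3 := h2.exp
  unfold landauH
  refine h3.congr_deriv ?_
  ring

/-- **the frequency of the witness**: `(1−t) H′/H = 1 + ½ sin log(1 + s(t))` [folklore] -/
theorem landau_frequency_eq {t : ℝ} (ht : t < 1) (hs : -1 < simTime t) :
    (1 - t) * deriv landauH t / landauH t = 1 + Real.sin (Real.log (1 + simTime t)) / 2 := by
  rw [(hasDerivAt_landauH ht hs).deriv]
  have hH : landauH t ≠ 0 := (landauH_pos t).ne'
  have h1 : (1 - t) ≠ 0 := (sub_pos.2 ht).ne'
  unfold profDeriv
  field_simp
  ring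

/-- **upper pinching holds**: `(1−t)² H(t) = e^{f(s)} ≤ e^{1/2}` on `[0,1)` [folklore] -/
theorem sq_mul_landauH_le {t : ℝ} (h0 : 0 ≤ t) (h1 : t < 1) :
    (1 - t) ^ 2 * landauH t ≤ Real.exp (1 / 2) := by
  have hpos : 0 < 1 - t := sub_pos.2 h1
  have hs := simTime_nonneg h0 h1
  have heq : (1 - t) ^ 2 * landauH t = Real.exp (prof (simTime t)) := by
    have h2 : (1 - t) ^ 2 = Real.exp (2 * Real.log (1 - t)) := by
      rw [show (2 : ℝ) * Real.log (1 - t) = ((2 : ℕ) : ℝ) * Real.log (1 - t) by norm_num,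
        Real.exp_nat_mul, Real.exp_log hpos]
    rw [h2, landauH, ← Real.exp_add]
    congr 1
    unfold simTime
    ring
  rw [heq, Real.exp_le_exp]
  unfold prof
  set L := Real.log (1 + simTime t)
  have h3 : (1 + simTime t) * (Real.sin L - Real.cos L) ≤ (1 + simTime t) * 2 :=
    mul_le_mul_of_nonneg_left (by linarith [Real.sin_le_one L, Real.neg_one_le_cos L]) (by linarith)
  linarith

/-- **slow oscillation** of the frequency of the witness over dyadic windows (both signs; in
particular it is slowly decreasing in the sense of the line). [folklore] -/
theorem landau_frequency_slowlyOscillating {ε : ℝ} (hε : 0 < ε) :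
    ∃ t₂ : ℝ, t₂ < 1 ∧ 0 ≤ t₂ ∧ ∀ t t' : ℝ, t₂ ≤ t → t ≤ t' → t' < 1 → 1 - t ≤ 2 * (1 - t') →
      |(1 - t) * deriv landauH t / landauH t - (1 - t') * deriv landauH t' / landauH t'| ≤ ε := by
  have hε2 : 0 < (2 * ε)⁻¹ := inv_pos.2 (mul_pos two_pos hε)
  refine ⟨1 - Real.exp (-(2 * ε)⁻¹), by linarith [Real.exp_pos (-(2 * ε)⁻¹)], ?_,
    fun t t' h2t htt' ht' hw => ?_⟩
  · have : Real.exp (-(2 * ε)⁻¹) ≤ 1 := Real.exp_le_one_iff.2 (by linarith)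
    linarith
  · have ht : t < 1 := htt'.trans_lt ht'
    have hpos : 0 < 1 - t := sub_pos.2 ht
    have hpos' : 0 < 1 - t' := sub_pos.2 ht'
    have hs0 : (2 * ε)⁻¹ ≤ simTime t := by
      have h1 : 1 - t ≤ Real.exp (-(2 * ε)⁻¹) := by linarith
      have h2 : Real.log (1 - t) ≤ -(2 * ε)⁻¹ := by
        have := Real.log_le_log hpos h1
        rwa [Real.log_exp] at this
      unfold simTime
      linarith
    have hss' : simTime t ≤ simTime t' := by
      unfold simTime
      have := Real.log_le_log hpos' (by linarith : 1 - t' ≤ 1 - t)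
      linarith
    have hs'le : simTime t' ≤ simTime t + 1 := by
      unfold simTime
      have hq : 0 < (1 - t) / (1 - t') := div_pos hpos hpos'
      have h1 : Real.log ((1 - t) / (1 - t')) ≤ (1 - t) / (1 - t') - 1 := Real.log_le_sub_one_of_pos hq
      have h2 : (1 - t) / (1 - t') ≤ 2 := by rw [div_le_iff₀ hpos']; linarith
      have h3 : Real.log ((1 - t) / (1 - t')) = Real.log (1 - t) - Real.log (1 - t') :=
        Real.log_div hpos.ne' hpos'.ne'
      linarith
    have hspos : 0 < 1 + simTime t := by linarith
    have hspos' : 0 < 1 + simTime t' := by linarith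
    rw [landau_frequency_eq ht (by linarith), landau_frequency_eq ht' (by linarith)]
    have hL : |Real.log (1 + simTime t) - Real.log (1 + simTime t')| ≤ (1 + simTime t)⁻¹ := by
      have hle : Real.log (1 + simTime t) ≤ Real.log (1 + simTime t') :=
        Real.log_le_log hspos (by linarith)
      rw [abs_sub_comm, abs_of_nonneg (by linarith)]
      have hq : 0 < (1 + simTime t') / (1 + simTime t) := div_pos hspos' hspos
      have h1 := Real.log_le_sub_one_of_pos hq
      rw [Real.log_div hspos'.ne' hspos.ne'] at h1
      have h2 : (1 + simTime t') / (1 + simTime t) - 1 = (simTime t' - simTime t) / (1 + simTime t) := by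
        field_simp
        ring
      have h3 : (simTime t' - simTime t) / (1 + simTime t) ≤ 1 / (1 + simTime t) :=
        div_le_div_of_nonneg_right (by linarith) hspos.le
      rw [one_div] at h3
      linarith
    have hsin := Real.abs_sin_sub_sin_le (Real.log (1 + simTime t)) (Real.log (1 + simTime t'))
    have hinv : (1 + simTime t)⁻¹ ≤ 2 * ε := by
      rw [inv_le_comm₀ hspos (mul_pos two_pos hε)]
      linarith
    have heq : |1 + Real.sin (Real.log (1 + simTime t)) / 2 -
          (1 + Real.sin (Real.log (1 + simTime t')) / 2)| =
        |Real.sin (Real.log (1 + simTime t)) - Real.sin (Real.log (1 + simTime t'))| / 2 := by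
      rw [show 1 + Real.sin (Real.log (1 + simTime t)) / 2 -
          (1 + Real.sin (Real.log (1 + simTime t')) / 2) =
          (Real.sin (Real.log (1 + simTime t)) - Real.sin (Real.log (1 + simTime t'))) / 2 by ring,
        abs_div, abs_two]
    rw [heq]
    linarith

/-- **the frequency of the witness has no limit at `1⁻`**: it equals `3/2` along
`1 − e·exp(−e^{π/2+2πn})` and `1/2` along `1 − e·exp(−e^{−π/2+2πn})`. [folklore] -/
theorem landau_frequency_not_tendsto :
    ¬ ∃ Λ₀ : ℝ, Tendsto (fun t => (1 - t) * deriv landauH t / landauH t) (𝓝[<] 1) (𝓝 Λ₀) := by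
  rintro ⟨Λ₀, hlim⟩
  set seq : ℝ → ℕ → ℝ := fun c n => 1 - Real.exp 1 * Real.exp (-Real.exp (c + n * (2 * π)))
    with hseq_def
  have hlt : ∀ c n, seq c n < 1 := fun c n => by
    simp only [hseq_def]
    nlinarith [Real.exp_pos 1, Real.exp_pos (-Real.exp (c + n * (2 * π)))]
  have hseq : ∀ c, Tendsto (seq c) atTop (𝓝[<] (1:ℝ)) := by
    intro c
    refine tendsto_nhdsWithin_iff.2 ⟨?_, Eventually.of_forall fun n => hlt c n⟩
    have h1 : Tendsto (fun n : ℕ => c + (n : ℝ) * (2 * π)) atTop atTop :=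
      tendsto_atTop_add_const_left _ _ (tendsto_natCast_atTop_atTop.atTop_mul_const (by positivity))
    have h2 : Tendsto (fun n : ℕ => Real.exp (c + n * (2 * π))) atTop atTop :=
      Real.tendsto_exp_atTop.comp h1
    have h3 := Real.tendsto_exp_neg_atTop_nhds_zero.comp h2
    have h4 := (h3.const_mul (Real.exp 1)).const_sub 1
    simp only [mul_zero, sub_zero] at h4
    exact h4
  have hval : ∀ c n, (1 - seq c n) * deriv landauH (seq c n) / landauH (seq c n) = 1 + Real.sin c / 2 := by
    intro c n
    have h1t : 1 - seq c n = Real.exp 1 * Real.exp (-Real.exp (c + n * (2 * π))) := by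
      simp only [hseq_def]; ring
    have hsim : simTime (seq c n) = Real.exp (c + n * (2 * π)) - 1 := by
      unfold simTime
      rw [h1t, Real.log_mul (Real.exp_pos 1).ne' (Real.exp_pos _).ne', Real.log_exp, Real.log_exp]
      ring
    have hs1 : 1 + simTime (seq c n) = Real.exp (c + n * (2 * π)) := by rw [hsim]; ring
    rw [landau_frequency_eq (hlt c n) (by rw [hsim]; linarith [Real.exp_pos (c + n * (2 * π))]), hs1,
      Real.log_exp, Real.sin_add_nat_mul_two_pi]
  have hlim1 := hlim.comp (hseq (π / 2))
  have hlim2 := hlim.comp (hseq (-(π / 2)))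
  have e1 : ((fun t => (1 - t) * deriv landauH t / landauH t) ∘ seq (π / 2)) = fun _ => 3 / 2 := by
    funext n
    rw [Function.comp_apply, hval, Real.sin_pi_div_two]
    norm_num
  have e2 : ((fun t => (1 - t) * deriv landauH t / landauH t) ∘ seq (-(π / 2))) = fun _ => 1 / 2 := by
    funext n
    rw [Function.comp_apply, hval, Real.sin_neg, Real.sin_pi_div_two]
    norm_num
  rw [e1] at hlim1
  rw [e2] at hlim2
  have ha := tendsto_nhds_unique hlim1 tendsto_const_nhds
  have hb := tendsto_nhds_unique hlim2 tendsto_const_nhds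
  linarith

/-! ### the tightness statements -/

/-- **The lower pinching is necessary in the Landau step, even for convergence to SOME limit.**
Refuted: "`H` differentiable and positive on `[t₁,T)`, `(T−t)² H ≤ C₁`, and `Λ = (T−t)H′/H` slowly
OSCILLATING over dyadic windows (`|Λ t − Λ t'| ≤ ε`, both signs) `⇒ Λ` has a limit at `T⁻`".
Witness `T = 1`, `t₁ = 0`, `H = landauH`, `Λ = 1 + ½ sin log(1 − log(1−t))`. [folklore] -/
theorem landau_false_without_lower_pinching :
    ¬ (∀ (T t₁ : ℝ) (H : ℝ → ℝ), t₁ < T → (∀ t ∈ Ico t₁ T, DifferentiableAt ℝ H t) →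
        (∀ t ∈ Ico t₁ T, 0 < H t) → (∃ C₁ : ℝ, ∀ t ∈ Ico t₁ T, (T - t) ^ 2 * H t ≤ C₁) →
        (∀ ε : ℝ, 0 < ε → ∃ t₂ : ℝ, t₂ < T ∧ ∀ t t' : ℝ, t₂ ≤ t → t ≤ t' → t' < T →
          T - t ≤ 2 * (T - t') →
          |(T - t) * deriv H t / H t - (T - t') * deriv H t' / H t'| ≤ ε) →
        ∃ Λ₀ : ℝ, Tendsto (fun t => (T - t) * deriv H t / H t) (𝓝[<] T) (𝓝 Λ₀)) := by
  intro h
  refine landau_frequency_not_tendsto (h 1 0 landauH one_pos ?_ (fun t _ => landauH_pos t)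
    ⟨Real.exp (1 / 2), fun t ht => sq_mul_landauH_le ht.1 ht.2⟩ ?_)
  · intro t ht
    exact (hasDerivAt_landauH ht.2 (by linarith [simTime_nonneg ht.1 ht.2])).differentiableAt
  · intro ε hε
    obtain ⟨t₂, ht₂, -, hosc⟩ := landau_frequency_slowlyOscillating hε
    exact ⟨t₂, ht₂, hosc⟩

/-- **`stub_landau` without its lower pinching is false**, even with the weaker conclusion
`∃ Λ₀, Λ → Λ₀` in place of `Λ → 2`: the statement below is the landed `stub_landau`
(`…TauberianOmegaLimit.stub_landau`) with the conjunct `c₀ ≤ (T - t) ^ 2 * H t` (and `0 < c₀`)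
replaced by `0 < H t`, and the conclusion weakened.  So the far-field stub `stub_pinchingLower`
cannot be bypassed inside the Tauberian frame. [folklore] -/
theorem stub_landau_false_without_lower_pinching :
    ¬ (∀ (T t₁ : ℝ) (H : ℝ → ℝ), t₁ < T → (∀ t ∈ Ico t₁ T, DifferentiableAt ℝ H t) →
        (∃ C₁ : ℝ, ∀ t ∈ Ico t₁ T, 0 < H t ∧ (T - t) ^ 2 * H t ≤ C₁) →
        (∀ ε : ℝ, 0 < ε → ∃ t₂ : ℝ, t₂ < T ∧ ∀ t t' : ℝ, t₂ ≤ t → t ≤ t' → t' < T →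
          T - t ≤ 2 * (T - t') → (T - t) * deriv H t / H t ≤ (T - t') * deriv H t' / H t' + ε) →
        ∃ Λ₀ : ℝ, Tendsto (fun t => (T - t) * deriv H t / H t) (𝓝[<] T) (𝓝 Λ₀)) := by
  intro h
  refine landau_false_without_lower_pinching fun T t₁ H ht₁ hd hpos hup hosc => ?_
  obtain ⟨C₁, hC₁⟩ := hup
  refine h T t₁ H ht₁ hd ⟨C₁, fun t ht => ⟨hpos t ht, hC₁ t ht⟩⟩ fun ε hε => ?_
  obtain ⟨t₂, ht₂, hw⟩ := hosc ε hε
  refine ⟨t₂, ht₂, fun t t' h1 h2 h3 h4 => ?_⟩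
  have := (abs_sub_le_iff.1 (hw t t' h1 h2 h3 h4)).1
  linarith


/-! ## Part I (cycle 2): a lower-pinched linear clock admits no adapted Gaussian kernel (triage F1, formal core)

For the linear flows of Part B an axisymmetric Gaussian `N(0, diag(α,β,β))` solves the adjoint equation exactly when
`α′ = 2dα − 2ν`, `β′ = −dβ − 2ν` (Part C4).  Under LOWER pinching of `H = ω²` (`c ≤ (1−t)ω`) the transverse
variance must turn negative before `t = 1`: pinching and an adapted Gaussian kernel exclude each other in the
linear class (the compressing strain that pinches the vorticity ejects the backward particles), so the §4 test
bench cannot be upgraded to a pinched one without leaving the linear class.  Landed copy: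
`Theorems/AdaptedFrequencyConverges/Negative/PinchedClock.lean`. -/

/-- **No positive transverse variance under lower pinching.**  If `ω` obeys the stretching law
`ω′ = dω` on `[t₀,1)` and is lower-pinched, `c ≤ (1−s)ω(s)` with `0 < c`, then every solution `β`
of the transverse variance equation `β′ = −dβ − 2ν` (`ν > 0`) on `[t₀,1)` is negative somewhere on
`[t₀,1)`: `(βω)′ = −2νω ≤ −2νc/(1−s)` forces `βω → −∞`. [folklore] -/
theorem no_positive_transverse_variance {ν c t₀ : ℝ} (hν : 0 < ν) (hc : 0 < c) (ht₀ : t₀ < 1)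
    {ω d β : ℝ → ℝ} (hω : ∀ s ∈ Ico t₀ 1, HasDerivAt ω (d s * ω s) s)
    (hpinch : ∀ s ∈ Ico t₀ 1, c ≤ (1 - s) * ω s)
    (hβ : ∀ s ∈ Ico t₀ 1, HasDerivAt β (-(d s) * β s - 2 * ν) s) :
    ∃ s ∈ Ico t₀ 1, β s < 0 := by
  -- the Lyapunov function `F = βω − 2νc log(1−s)` is non-increasing on `[t₀,1)`
  set F : ℝ → ℝ := fun s => β s * ω s - 2 * ν * c * Real.log (1 - s) with hF
  have hωpos : ∀ s ∈ Ico t₀ 1, 0 < ω s := fun s hs => by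
    have h1 : 0 < 1 - s := sub_pos.2 hs.2
    have h2 := hpinch s hs
    by_contra hle
    push Not at hle
    nlinarith
  have hderiv : ∀ s ∈ Ico t₀ 1, HasDerivAt F (-2 * ν * ω s + 2 * ν * c / (1 - s)) s := by
    intro s hs
    have h1 : HasDerivAt (fun x : ℝ => 1 - x) (-1) s := (hasDerivAt_id s).const_sub 1
    have hlog : HasDerivAt (fun x => Real.log (1 - x)) ((1 - s)⁻¹ * (-1)) s :=
      (Real.hasDerivAt_log (sub_pos.2 hs.2).ne').comp s h1
    have h2 := ((hβ s hs).mul (hω s hs)).sub (hlog.const_mul (2 * ν * c))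
    refine h2.congr_deriv ?_
    field_simp
    ring
  have hderiv_nonpos : ∀ s ∈ Ico t₀ 1, -2 * ν * ω s + 2 * ν * c / (1 - s) ≤ 0 := by
    intro s hs
    have h1 : 0 < 1 - s := sub_pos.2 hs.2
    have h2 : c / (1 - s) ≤ ω s := by rw [div_le_iff₀ h1]; linarith [hpinch s hs]
    have h3 : 2 * ν * c / (1 - s) = 2 * ν * (c / (1 - s)) := by ring
    rw [h3]
    nlinarith [mul_le_mul_of_nonneg_left h2 (by positivity : (0:ℝ) ≤ 2 * ν)]
  have hanti : AntitoneOn F (Ico t₀ 1) := by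
    have hcont : ContinuousOn F (Ico t₀ 1) := fun s hs => (hderiv s hs).continuousAt.continuousWithinAt
    refine antitoneOn_of_hasDerivWithinAt_nonpos (f' := fun s => -2 * ν * ω s + 2 * ν * c / (1 - s))
      (convex_Ico t₀ 1) hcont ?_ ?_
    · intro s hs
      rw [interior_Ico] at hs
      exact ((hderiv s (Ioo_subset_Ico_self hs)).hasDerivWithinAt)
    · intro s hs
      rw [interior_Ico] at hs
      exact hderiv_nonpos s (Ioo_subset_Ico_self hs)
  -- a late time `s` with `2νc·log(1−s) ≤ −|F t₀| − 1`
  set K : ℝ := (|F t₀| + 1) / (2 * ν * c) with hK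
  have hKpos : 0 < K := by positivity
  set s : ℝ := max t₀ (1 - Real.exp (-K)) with hs
  have hs1 : s < 1 := max_lt ht₀ (by linarith [Real.exp_pos (-K)])
  have hs0 : t₀ ≤ s := le_max_left _ _
  have hsI : s ∈ Ico t₀ 1 := ⟨hs0, hs1⟩
  have hlog : Real.log (1 - s) ≤ -K := by
    have h1 : 1 - s ≤ Real.exp (-K) := by have := le_max_right t₀ (1 - Real.exp (-K)); linarith
    have := Real.log_le_log (sub_pos.2 hs1) h1
    rwa [Real.log_exp] at this
  have hFle : F s ≤ F t₀ := hanti ⟨le_rfl, ht₀⟩ hsI hs0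
  have hprod : β s * ω s < 0 := by
    have h1 : F s = β s * ω s - 2 * ν * c * Real.log (1 - s) := rfl
    have h2 : 2 * ν * c * Real.log (1 - s) ≤ 2 * ν * c * (-K) :=
      mul_le_mul_of_nonneg_left hlog (by positivity)
    have h3 : 2 * ν * c * (-K) = -(|F t₀| + 1) := by
      rw [hK]; field_simp
    have h4 := le_abs_self (F t₀)
    linarith
  refine ⟨s, hsI, ?_⟩
  by_contra hge
  push Not at hge
  have := mul_nonneg hge (hωpos s hsI).le
  linarith


/-- **The adjoint equation forces the transverse variance equation.**  If the axisymmetric Gaussian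
`gK (A r) (B r)` (variances `A, B, B`, positive at `s`) satisfies the adjoint equation of the linear flow
`linVel (d s) (ω s)` at time `s ∈ [t₀,1)` for all `x`, then `B′(s) = −d(s)B(s) − 2ν` (evaluate the
equation divided by the Gaussian at `x = 0` and `x = e₁`; the rotation `½ω e₀×x` drops out). [folklore] -/
theorem transverse_variance_eq {ν t₀ : ℝ} {d ω A B dA dB : ℝ → ℝ} {s : ℝ} (hs : s ∈ Ico t₀ 1)
    (hA : HasDerivAt A (dA s) s) (hB : HasDerivAt B (dB s) s) (hApos : 0 < A s) (hBpos : 0 < B s)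
    (hadj : ∀ x : E3, timeDerivWithin (Ico t₀ 1) (fun r y => gK (A r) (B r) y) s x
        + fderiv ℝ (gK (A s) (B s)) x (linVel (d s) (ω s) x) + ν * (Δ (gK (A s) (B s))) x = 0) :
    dB s = -(d s) * B s - 2 * ν := by
  have hbr : ∀ x : E3, gK (A s) (B s) x *
      ( -(dA s / (2 * A s)) - dB s / B s + (x 0) ^ 2 * dA s / (2 * (A s) ^ 2)
          + ((x 1) ^ 2 + (x 2) ^ 2) * dB s / (2 * (B s) ^ 2)
        - (x 0 * (d s * x 0) / A s
            + (x 1 * (-(d s / 2) * x 1 - (ω s / 2) * x 2) + x 2 * (-(d s / 2) * x 2 + (ω s / 2) * x 1)) / B s)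
        + ν * ((x 0 / A s) ^ 2 + (x 1 / B s) ^ 2 + (x 2 / B s) ^ 2 - 1 / A s - 2 / B s)) = 0 := by
    intro x
    have h := hadj x
    rw [timeDerivWithin_apply,
      ((hasDerivAt_gK_comp hA hB hApos hBpos x).hasDerivWithinAt).derivWithin (uniqueDiffOn_Ico t₀ 1 s hs),
      fderiv_gK_apply, laplacian_gK, linVel_apply0, linVel_apply1, linVel_apply2] at h
    linear_combination h
  have hq : ∀ x : E3,
      -(dA s / (2 * A s)) - dB s / B s + (x 0) ^ 2 * dA s / (2 * (A s) ^ 2)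
          + ((x 1) ^ 2 + (x 2) ^ 2) * dB s / (2 * (B s) ^ 2)
        - (x 0 * (d s * x 0) / A s
            + (x 1 * (-(d s / 2) * x 1 - (ω s / 2) * x 2) + x 2 * (-(d s / 2) * x 2 + (ω s / 2) * x 1)) / B s)
        + ν * ((x 0 / A s) ^ 2 + (x 1 / B s) ^ 2 + (x 2 / B s) ^ 2 - 1 / A s - 2 / B s) = 0 :=
    fun x => (mul_eq_zero.1 (hbr x)).resolve_left (gK_pos hApos hBpos x).ne'
  have q0 := hq 0
  have q1 := hq (EuclideanSpace.single 1 1)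
  simp only [PiLp.zero_apply, PiLp.single_apply, if_neg (show (2 : Fin 3) ≠ 1 by decide),
    if_neg (show (0 : Fin 3) ≠ 1 by decide), if_pos] at q0 q1
  norm_num at q0 q1
  have hB0 : B s ≠ 0 := hBpos.ne'
  have hA0 : A s ≠ 0 := hApos.ne'
  have key : A s * (dB s + d s * B s + 2 * ν) = 0 := by
    field_simp at q0 q1
    linear_combination q1 - B s * q0
  have := (mul_eq_zero.1 key).resolve_left hA0
  linarith


/-- **A lower-pinched linear flow admits no adapted Gaussian kernel.**  For the linear flows
`linVel (d t) (ω t) = d(t) D₀x + ½ω(t) e₀×x` with the stretching law `ω′ = dω` on `[t₀,1)` and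
LOWER-PINCHED vorticity `c ≤ (1−t)ω(t)` (`⇔` lower pinching `c² ≤ (1−t)² H` of the adapted enstrophy
`H = ω²`), there are NO positive differentiable variances `A, B` on `[t₀,1)` for which the axisymmetric
Gaussian `gK (A t) (B t)` solves the adjoint equation `∂ₜG + u·∇G + νΔG = 0` (`ν > 0`): the hypotheses
below are contradictory.  (The cycle-1 witness `ω = amp` is not pinched — `(1−t)·amp t → 0` — and does
carry such a kernel.) [folklore] -/
theorem no_pinched_gaussian_kernel {ν c t₀ : ℝ} (hν : 0 < ν) (hc : 0 < c) (ht₀ : t₀ < 1)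
    {ω d A B dA dB : ℝ → ℝ} (hω : ∀ s ∈ Ico t₀ 1, HasDerivAt ω (d s * ω s) s)
    (hpinch : ∀ s ∈ Ico t₀ 1, c ≤ (1 - s) * ω s)
    (hA : ∀ s ∈ Ico t₀ 1, HasDerivAt A (dA s) s) (hB : ∀ s ∈ Ico t₀ 1, HasDerivAt B (dB s) s)
    (hApos : ∀ s ∈ Ico t₀ 1, 0 < A s) (hBpos : ∀ s ∈ Ico t₀ 1, 0 < B s)
    (hadj : ∀ s ∈ Ico t₀ 1, ∀ x : E3, timeDerivWithin (Ico t₀ 1) (fun r y => gK (A r) (B r) y) s x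
        + fderiv ℝ (gK (A s) (B s)) x (linVel (d s) (ω s) x) + ν * (Δ (gK (A s) (B s))) x = 0) :
    False := by
  have hB' : ∀ s ∈ Ico t₀ 1, HasDerivAt B (-(d s) * B s - 2 * ν) s := fun s hs => by
    have h := transverse_variance_eq hs (hA s hs) (hB s hs) (hApos s hs) (hBpos s hs) (hadj s hs)
    rw [← h]
    exact hB s hs
  obtain ⟨s, hs, hneg⟩ := no_positive_transverse_variance hν hc ht₀ hω hpinch hB'
  exact lt_irrefl (0:ℝ) ((hBpos s hs).trans hneg)


/-! ## Part J (cycle 2): the hardest stub is implied by the crux — the decomposition is tight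

With `stub_pinchingUpper` (p78510), `stub_pinchingLower` (p82804) and `stub_landau` (p78071) landed, the line proves
crux ⇐ `stub_slowDecrease` (+ `stub_kernelCalculus`, bookkeeping); conversely crux ⇒ `stub_slowDecrease` below.  So the
remaining NS stub is EQUIVALENT to the crux and inherits every obstruction of this file (§1–§6).  Landed copy:
`Theorems/AdaptedFrequencyConverges/Negative/SlowDecreaseOfCrux.lean`. -/

/-- **The crux implies the hardest stub.**  `AdaptedFrequencyConverges` implies the lead's active
`stub_slowDecrease` (skeleton 1b56b576…, statement verbatim): if `Λ = adaptedFrequency u G T` has a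
limit at `T⁻` then for every `ε > 0` it is eventually `ε`-slowly decreasing (indeed `ε`-slowly
oscillating, on all late pairs `t ≤ t'`, dyadic or not). [folklore] -/
theorem stub_slowDecrease_of_adaptedFrequencyConverges (hAFC : AdaptedFrequencyConverges) :
    ∀ (ν T : ℝ) (u : ℝ → EuclideanSpace ℝ (Fin 3) → EuclideanSpace ℝ (Fin 3))
      (p : ℝ → EuclideanSpace ℝ (Fin 3) → ℝ) (x₀ : EuclideanSpace ℝ (Fin 3)) (t₀ : ℝ)
      (G : ℝ → EuclideanSpace ℝ (Fin 3) → ℝ), 0 < ν → 0 < T →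
      IsClassicalNSSolutionOn (Ico 0 T) ν 0 u p → IsLerayHopfOn T ν 0 (u 0) u →
      HasRapidSpatialDecay (u 0) → IsTypeIBlowup u T → t₀ ∈ Ico 0 T →
      (∀ r : ℝ, 0 < r → eLpNorm (Function.uncurry u) ⊤
        (volume.restrict (parabolicCylinder r (T, x₀))) = ⊤) →
      IsAdaptedBackwardKernel ν u (Ico t₀ T) T x₀ G → IsGaussianComparable G (Ico t₀ T) T x₀ →
      ∀ ε : ℝ, 0 < ε → ∃ t₁ : ℝ, t₁ < T ∧ ∀ t t' : ℝ, t₁ ≤ t → t ≤ t' → t' < T →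
        T - t ≤ 2 * (T - t') → adaptedFrequency u G T t ≤ adaptedFrequency u G T t' + ε := by
  intro ν T u p x₀ t₀ G hν hT hcl hLH hdec hTI ht₀ hsing hK hcomp ε hε
  obtain ⟨Λ₀, hlim⟩ := hAFC ν T hν hT u p hcl hLH hdec hTI x₀ t₀ G ht₀ hsing
    (isAdaptedBackwardKernel_iff.1 hK) (isGaussianComparable_iff_fin_three.1 hcomp)
    (adaptedEnstrophy u G) (adaptedFrequency u G T) rfl rfl
  have hev : ∀ᶠ t in 𝓝[<] T, dist (adaptedFrequency u G T t) Λ₀ < ε / 2 :=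
    hlim (Metric.ball_mem_nhds Λ₀ (half_pos hε))
  obtain ⟨a, haT, ha⟩ := mem_nhdsLT_iff_exists_Ioo_subset.1 hev
  refine ⟨(a + T) / 2, by linarith [mem_Iio.1 haT], fun t t' h1 h2 h3 _ => ?_⟩
  have haT' : a < T := haT
  have ht : dist (adaptedFrequency u G T t) Λ₀ < ε / 2 := ha ⟨by linarith, h2.trans_lt h3⟩
  have ht' : dist (adaptedFrequency u G T t') Λ₀ < ε / 2 := ha ⟨by linarith, h3⟩
  rw [Real.dist_eq] at ht ht'
  have h4 := (abs_lt.1 ht).2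
  have h5 := (abs_lt.1 ht').1
  linarith


end Summit.NavierStokesRegularity.NavierStokesRegularity.Cruxes.AdaptedFrequencyConverges.Disproof

end
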